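import Literature.NumberTheory.ConnesMoscovici2022.UVProlateInhomogeneousToolkit
import Literature.NumberTheory.ConnesMoscovici2022.UVProlateBoundaryFunctional
import Literature.NumberTheory.ConnesMoscovici2022.UVProlateQuotientBasis
import Literature.NumberTheory.ConnesMoscovici2022.UVProlateDeficiencyODE
import Literature.NumberTheory.ConnesMoscovici2022.UVProlateVonNeumann
import Literature.NumberTheory.ConnesMoscovici2022.UVProlateMaxDomainRegularity
import Literature.NumberTheory.ConnesMoscovici2022.UVProlateMaxDomainFourier
import Literature.Analysis.FunctionSpaces.PlancherelL1L2
import Mathlib.Analysis.Fourier.FourierTransformDeriv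
import HarnessLib

/-!
# Connes–Moscovici 2022, Lemma 1.5: the printed basis vectors `α±, β±` lie in `dom W_max`

LINE 1 — FRAMING. RH-FREE corpus literature (cell rh-crit, C1 Connes–Consani/Moscovici corpus,
row O2 `UVProlateSpectrum`: Sturm–Liouville bookkeeping for the prolate wave operator
`W_λ = −∂ₓ(λ² − x²)∂ₓ + (2πλx)²` on `L²(ℝ)`; sequel material, no leaf / binder role in any route).
bears_on: LADDER-RH W-C/W-P.  WHAT THIS IS NOT: any claim about `ζ` or RH; nothing here bears on
the truth of RH.  Theorems only: 0 `def`s, 0 named facts, no `sorry`.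

## What this file is for

[ConnesMoscovici2022, Lemma 1.5] (= arXiv:2112.05500 Lemma 2.5), in the corrected typing
`CM22_lemma_1_5_corr` of `UVProlateQuotientBasis.lean`, asserts that the eight vectors
`{α±, β±, α̂±, β̂±}` lie in `dom W_max` and form a basis of `dom W_max / dom W_min`.  This file
supplies the CONCRETE MEMBERSHIP HALF for the printed vectors that are given by formulas:

* §1 `exists_prolateMax_eq_of_piecewise` — a **generic membership lemma**: a function `g` that is
  `C²` off `±λ`, compactly supported, with `g` and `Wg = −(p g′)′ + q g` (computed off `±λ`) in
  `L²`, whose `p g′` has a TWO-SIDED limit at each of `±λ` and with `p g → 0` there, lies in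
  `dom W_max` with `W_max g = Wg`.  Proof = the printed one for Lemma 1.3 ("using twice integration
  by parts, together with the fact that `(λ² − x²)φ′(x)` … vanish on the boundary"): Green's
  identity on compact pieces (`UVProlateInhomogeneousToolkit.intervalIntegral_green_of_contDiffOn`),
  passage to the lateral limits (`intervalIntegral_eq_sub_of_boundary_tendsto`), the brackets
  `θ·(p g′) − p θ′·g` having EQUAL lateral limits at `±λ` so that the three pieces telescope, and
  the weak characterisation of `dom W_max` (`exists_prolateMax_eq_of_forall_integral`).
* §2 `exists_prolateMax_indicator_mul` — **`1_{[−λ,λ]} · f ∈ dom W_max` for every `f ∈ C²(ℝ)`**,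
  `W_max (1_I f) = 1_I · W f`; in particular `β₊ = 1_I` and `β₋ = x·1_I`
  (`mem_prolateMax_of_ae_eq_betaPlus`, `mem_prolateMax_of_ae_eq_betaMinus`, stated on the `L²`
  classes exactly as the clauses of `CM22_lemma_1_5_corr`).
* §3 log tools: `intervalIntegrable_log_sq` (`log² ∈ L¹_loc`), `intervalIntegrable_log_abs_pSq_sq`,
  `hasDerivAt_log_abs_pSq`, `tendsto_pSq_mul_log`.
* §4 **`α₊ ∈ dom W_max`** for ANY `α` with the four clauses of `CM22_lemma_1_5_corr` (smooth off
  `±λ`, even, `= log|λ² − x²|` on `[¾λ, ⁵⁄₄λ]`, supported in `|x| ∈ (½λ, ³⁄₂λ)`):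
  `memLp_alpha`, `memLp_W_alpha`, `exists_prolateMax_alpha`, `mem_prolateMax_of_ae_eq_alphaPlus`,
  together with its BOUNDARY DATA `tendsto_pCoeff_mul_deriv_alpha` (`p α′ → −2a` at `a = ±λ`, the
  non-zero value of Lemma 1.2's boundary functional) and `tendsto_pCoeff_mul_alpha` (`p α → 0`).

* §5 **`α₋ = x·α₊ ∈ dom W_max`**: `pCoeff_mul_deriv_alphaMinus` (`p α₋′ = (λ²−x²)log|λ²−x²| − 2x²`
  on the window), `tendsto_pCoeff_mul_deriv_alphaMinus` (`→ −2λ²` at `±λ`), `memLp_alphaMinus`,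
  `memLp_W_alphaMinus`, `exists_prolateMax_alphaMinus`, `mem_prolateMax_of_ae_eq_alphaMinus`, and
  the first conjunct of `CM22_lemma_1_5_corr` for the four formula-vectors,
  `CM22_lemma_1_5_corr_mem_four`.

* §6 **`Ω` against cutoffs**: `intervalIntegral_green_piece'` (Green on a compact piece for a
  `C²` test function), `omegaForm_piecewise_indicator` — for a piecewise-`C²` `g` with boundary
  data `c±` and `β_f = 1_{[−λ,λ]}·f`: `Ω(g, β_f) = i·(f(λ)·c̄₊ − f(−λ)·c̄₋)` (eq. (1.7), middle
  piece only) — and the `{α±} × {β±}` block of the `Ω`-matrix of Lemma 1.5: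
  `omegaForm_alphaPlus_betaPlus` (`= −4λ·i`), `omegaForm_alphaMinus_betaMinus` (`= −4λ³·i`),
  `omegaForm_alphaPlus_betaMinus = 0`, `omegaForm_alphaMinus_betaPlus = 0`.

* §7 **eq. (1.7)**: `intervalIntegral_lagrange_piece`,
  `omegaForm_piecewise_piecewise` — `Ω(g₁, g₂) = −i(L₁ − L₂ + L₃ − L₄)`, the `Lₖ` being the four
  lateral limits at `∓λ` of the bracket `conj(g₁)(p g₂′) − conj(p g₁′) g₂`, for two compactly
  supported piecewise-`C²` vectors — and the `{α±} × {α±}` block: `omegaForm_alphaPlus_alphaPlus`,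
  `omegaForm_alphaMinus_alphaMinus`, `omegaForm_alphaPlus_alphaMinus`,
  `omegaForm_alphaMinus_alphaPlus`, all `= 0`.

* §7′ `omegaForm_piecewise_general`: eq. (1.7) with only the FIRST vector compactly supported (the
  second any `C²`-off-`±λ` element of `dom W_max` with classical `W_max`-image) — the door to the
  entries against the (everywhere smooth, non-compactly-supported) Fourier images.
* §8 `indicator_mul_piecewise_data`, `omegaForm_indicator_indicator`: **`Ω(1_I f₁, 1_I f₂) = 0`**
  (the `{β±} × {β±}` block).  With §6–§7 this gives the complete `Ω`-matrix of the four
  formula-vectors `α₊, α₋, β₊, β₋`: the only non-zero entries are `Ω(α₊,β₊) = −4λi`,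
  `Ω(α₋,β₋) = −4λ³i` and their Hermitian mirrors.

* §9 `prolateMax_ae_eq_classical_of_contDiff`: a `dom W_max` element with a `C²` representative
  `h` has `W_max`-image `−(p h′)′ + q h` a.e. (via cc-t6's regular representative) — the `hW₂`
  input of `omegaForm_piecewise_general` for smooth second arguments.

* §10 `CM22_lemma_1_5_corr_mem_eight`: **the full first conjunct of `CM22_lemma_1_5_corr`** — all
  eight vectors lie in `dom W_max` (Fourier images via cc-t10's `fourierL2_mem_prolateMax`).

* §11 `omegaForm_piecewise_smooth_eq_zero`, `omegaForm_alphaPlus_smooth`, `omegaForm_alphaMinus_smooth`,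
  `omegaForm_indicator_smooth`: **every formula-vector pairs to zero with every element of
  `dom W_max` having a `C²` representative** — the mixed formula × Fourier block vanishes as soon
  as the Fourier images are known to have smooth representatives.

* §12 `exists_contDiff_repr_fourierL2`: the Fourier image of a compactly supported `L²` function has a
  `C²` representative (its Fourier integral; Mathlib `Real.contDiff_fourier` + the tree's
  `fourier_toLp_ae_eq_fourierIntegral`) — with §11 every mixed formula × Fourier entry is `0`.

Not here (successor work for `CM22_lemma_1_5_corr`, second conjunct): the bookkeeping of the 8×8
`Ω`-matrix (Fourier × Fourier block = formula block by cc-t10's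
`UVProlateMaxDomainFourier.omegaForm_fourierL2`; mixed block `0` by §11–§12; formula block §6–§8),
its kernel, and the assembly via cc-t11's `UVProlateVonNeumann.CM22_lemma_1_5_corr_of_omegaMatrix`
(dimension count by von Neumann's formula with `finrank_eigenspace_prolateMax`).

## References

* [ConnesMoscovici2022] A. Connes, H. Moscovici, *The UV prolate spectrum matches the zeros of
  zeta*, PNAS 119 (2022) = arXiv:2112.05500, §1 (= arXiv §2): eq. (1.2), (1.5)–(1.7), Lemma 1.2
  and its proof ("`η₀ = log|x − λ| ∈ Dom W_max` and `L(η₀) ≠ 0`"), Lemma 1.3 and its proof,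
  Lemma 1.5 and the paragraph before it (held text `paper-arxiv-2112.05500`, chunks p0004–p0005;
  TeX `cc/src/arXiv2112.05500-Draft2.tex` l.380–494).
-/

noncomputable section

open Complex Set MeasureTheory Filter Topology intervalIntegral SchwartzMap
open scoped Real Topology InnerProductSpace FourierTransform

namespace Literature.NumberTheory.ConnesMoscovici2022

/-! ## §1. From Green on compact pieces to the whole line: a generic membership lemma -/

section Generic

variable {lam : ℝ}

/-- `p(λ) = 0`: `λ` is a singular point of `W_λ`. [cite: ConnesMoscovici2022, §1 eq. (1.1) (= arXiv:2112.05500 (2.1), chunk p0004:L5–L9)] -/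
theorem pCoeff_lam (lam : ℝ) : pCoeff lam lam = 0 := by simp [pCoeff]

/-- `p(−λ) = 0`: `−λ` is a singular point of `W_λ`. [cite: ConnesMoscovici2022, §1 eq. (1.1) (= arXiv:2112.05500 (2.1), chunk p0004:L5–L9)] -/
theorem pCoeff_neg_lam (lam : ℝ) : pCoeff lam (-lam) = 0 := by simp [pCoeff]

/-- The set `{x | x ≠ λ ∧ x ≠ −λ}` is open. [folklore] -/
private theorem isOpen_ne_lam (lam : ℝ) : IsOpen {x : ℝ | x ≠ lam ∧ x ≠ -lam} :=
  (isOpen_ne_fun continuous_id continuous_const).inter (isOpen_ne_fun continuous_id continuous_const)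

/-- **From Green on compact subintervals to a singular interval, with boundary limits.**  If
`F ∈ L¹(a, b)`, `∫_x^y F = B(y) − B(x)` for `a < x ≤ y < b`, `B → L_a` at `a⁺` and `B → L_b` at `b⁻`,
then `∫_a^b F = L_b − L_a` ("passage to the lateral limits towards the endpoints of the three
subintervals partitioning `ℝ`"). [cite: ConnesMoscovici2022, §1 text between (1.6) and (1.7) (= arXiv:2112.05500 (2.6)–(2.7), chunk p0005:L31–L38)] -/
theorem intervalIntegral_eq_sub_of_boundary_tendsto {a b : ℝ} (hab : a < b) {F B : ℝ → ℂ}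
    (hF : IntervalIntegrable F volume a b)
    (hId : ∀ x ∈ Ioo a b, ∀ y ∈ Ioo a b, x ≤ y → ∫ t in x..y, F t = B y - B x) {La Lb : ℂ}
    (ha : Tendsto B (𝓝[>] a) (𝓝 La)) (hb : Tendsto B (𝓝[<] b) (𝓝 Lb)) :
    ∫ t in a..b, F t = Lb - La := by
  have hba : ((b - a : ℝ) : ℂ) ≠ 0 := by exact_mod_cast (sub_pos.2 hab).ne'
  set m : ℂ := (Lb - La) / ((b - a : ℝ) : ℂ) with hm
  set ℓ : ℝ → ℂ := fun s ↦ La + m * ((s - a : ℝ) : ℂ) with hℓ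
  have hℓc : Continuous ℓ :=
    continuous_const.add (continuous_const.mul (Complex.continuous_ofReal.comp
      (continuous_id.sub continuous_const)))
  have hℓa : ℓ a = La := by simp [hℓ]
  have hℓb : ℓ b = Lb := by
    simp only [hℓ, hm]
    field_simp
    ring
  have h0 := intervalIntegral_eq_zero_of_boundary_tendsto_zero hab (F := fun t ↦ F t - m)
    (B := fun s ↦ B s - ℓ s) (hF.sub intervalIntegrable_const) ?_ ?_ ?_
  · have e : ∫ t in a..b, (F t - m) = (∫ t in a..b, F t) - ((b - a : ℝ) : ℂ) * m := by
      rw [intervalIntegral.integral_sub hF intervalIntegrable_const,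
        intervalIntegral.integral_const, Complex.real_smul]
    rw [e, sub_eq_zero] at h0
    rw [h0, hm]
    field_simp
  · intro x hx y hy hxy
    have hFi : IntervalIntegrable F volume x y :=
      (hF.mono_set (by
        rw [uIcc_of_le hab.le, uIcc_of_le hxy]
        exact Icc_subset_Icc hx.1.le hy.2.le))
    rw [intervalIntegral.integral_sub hFi intervalIntegrable_const, hId x hx y hy hxy,
      intervalIntegral.integral_const, Complex.real_smul]
    simp only [hℓ]
    push_cast
    ring
  · have : Tendsto (fun s ↦ B s - ℓ s) (𝓝[>] a) (𝓝 (La - ℓ a)) :=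
      ha.sub ((hℓc.tendsto a).mono_left nhdsWithin_le_nhds)
    rwa [hℓa, sub_self] at this
  · have : Tendsto (fun s ↦ B s - ℓ s) (𝓝[<] b) (𝓝 (Lb - ℓ b)) :=
      hb.sub ((hℓc.tendsto b).mono_left nhdsWithin_le_nhds)
    rwa [hℓb, sub_self] at this


/-- **Green's identity between `W` on a Schwartz function and a piecewise-`C²` function, on a
compact piece `[x, y]` avoiding `±λ`.**  With `v = p g′` and `Wg = −v′ + q g` on the piece,
`∫_x^y ((Wθ) g − θ (Wg)) = [θ v − p θ′ g]_x^y`. [cite: ConnesMoscovici2022, §1 eqs. (1.5)–(1.7) (= arXiv:2112.05500 (2.5)–(2.7), chunk p0005:L24–L38)] -/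
theorem intervalIntegral_green_piece (lam : ℝ) {x y : ℝ} (hxy : x ≤ y)
    (hsub : Icc x y ⊆ {s : ℝ | s ≠ lam ∧ s ≠ -lam}) {g Wg : ℝ → ℂ}
    (hg : ContDiffOn ℝ 2 g {s : ℝ | s ≠ lam ∧ s ≠ -lam})
    (hWg : ∀ s, s ≠ lam → s ≠ -lam →
      Wg s = -deriv (fun t ↦ pCoeff lam t * deriv g t) s + qCoeff lam s * g s)
    (θ : 𝓢(ℝ, ℂ)) :
    ∫ t in x..y, (prolateSchwartz lam θ t * g t - θ t * Wg t) =
      (θ y * (pCoeff lam y * deriv g y) - pCoeff lam y * deriv θ y * g y) -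
        (θ x * (pCoeff lam x * deriv g x) - pCoeff lam x * deriv θ x * g x) := by
  set U : Set ℝ := {s : ℝ | s ≠ lam ∧ s ≠ -lam} with hU_def
  have hU : IsOpen U := isOpen_ne_lam lam
  have h2 : ContDiffOn ℝ (1 + 1) g U := by simpa [one_add_one_eq_two] using hg
  have hg1 : ContDiffOn ℝ 1 g U := h2.of_succ
  have hgd' : ContDiffOn ℝ 1 (deriv g) U := h2.deriv_of_isOpen hU le_rfl
  set v : ℝ → ℂ := fun t ↦ pCoeff lam t * deriv g t with hv_def
  have hv1 : ContDiffOn ℝ 1 v U := ((contDiff_pCoeff_def lam 1).contDiffOn).mul hgd'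
  have hvd : ∀ s ∈ U, HasDerivAt v (deriv v s) s := fun s hs ↦
    ((hv1.differentiableOn one_ne_zero s hs).differentiableAt (hU.mem_nhds hs)).hasDerivAt
  have hv'c : ContinuousOn (deriv v) U := hv1.continuousOn_deriv_of_isOpen hU le_rfl
  have hIcc : uIcc x y = Icc x y := uIcc_of_le hxy
  -- FTC for `v` on `[x, s]`
  have hF : ∀ s ∈ Icc x y, pCoeff lam s * deriv g s - pCoeff lam x * deriv g x =
      ∫ t in x..s, deriv v t := by
    intro s hs
    have hsub' : uIcc x s ⊆ Icc x y := by
      rw [uIcc_of_le hs.1]; exact Icc_subset_Icc_right hs.2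
    rw [intervalIntegral.integral_eq_sub_of_hasDerivAt (fun t ht ↦ hvd t (hsub (hsub' ht)))
      (((hv'c.mono (hsub.trans' hsub')).mono (by rw [uIcc_of_le hs.1])).intervalIntegrable_of_Icc
        hs.1)]
  have hf : IntervalIntegrable (deriv v) volume x y :=
    ((hv'c.mono hsub)).intervalIntegrable_of_Icc hxy
  have hgreen := intervalIntegral_green_of_contDiffOn lam hxy hU hsub (θ := fun t ↦ θ t)
    (θ.smooth 2) hg1 hF hf
  rw [← hgreen]
  refine intervalIntegral.integral_congr fun t ht ↦ ?_
  rw [hIcc] at ht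
  have htU := hsub ht
  show prolateSchwartz lam θ t * g t - θ t * Wg t = _
  rw [prolateSchwartz_apply', hWg t htU.1 htU.2]
  ring

/-- **Generic membership in `dom W_max` for piecewise-`C²` functions with matching boundary
data.**  Let `g` be `C²` off `±λ`, vanish for `|x| ≥ R`, with `g` and `Wg := −(p g′)′ + q g`
(off `±λ`) square integrable; assume that at each of `±λ` the TWO-SIDED limit of `p g′` exists
and `p g → 0`.  Then `g ∈ dom W_max` and `W_max g = Wg`: the brackets `θ (p g′) − p θ′ g` of
Green's formula have equal lateral limits at `±λ`, so the three pieces telescope ("which shows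
that `W(P_λ f) = P_λ W f`" is the case `g = 1_{[−λ,λ]} f`).
[cite: ConnesMoscovici2022, §1 eq. (1.2), (1.7) and proof of Lemma 1.3 (= arXiv:2112.05500 (2.2), (2.7), chunk p0004:L16–L22, p0005:L31–L38, p0004:L110–p0005:L9)] -/
theorem exists_prolateMax_eq_of_piecewise (hlam : 0 < lam) {g Wg : ℝ → ℂ} {R : ℝ} {cp cm : ℂ}
    (hg : ContDiffOn ℝ 2 g {x : ℝ | x ≠ lam ∧ x ≠ -lam})
    (hgR : ∀ x, R ≤ |x| → g x = 0)
    (hWg : ∀ x, x ≠ lam → x ≠ -lam →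
      Wg x = -deriv (fun s ↦ pCoeff lam s * deriv g s) x + qCoeff lam x * g x)
    (hg2 : MemLp g 2 volume) (hWg2 : MemLp Wg 2 volume)
    (hvp : Tendsto (fun x ↦ pCoeff lam x * deriv g x) (𝓝[≠] lam) (𝓝 cp))
    (hvm : Tendsto (fun x ↦ pCoeff lam x * deriv g x) (𝓝[≠] (-lam)) (𝓝 cm))
    (hgp : Tendsto (fun x ↦ pCoeff lam x * g x) (𝓝[≠] lam) (𝓝 0))
    (hgm : Tendsto (fun x ↦ pCoeff lam x * g x) (𝓝[≠] (-lam)) (𝓝 0)) :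
    ∃ h : hg2.toLp g ∈ (prolateMax lam).domain,
      prolateMax lam ⟨hg2.toLp g, h⟩ = hWg2.toLp Wg := by
  set U : Set ℝ := {s : ℝ | s ≠ lam ∧ s ≠ -lam} with hU_def
  have hU : IsOpen U := isOpen_ne_lam lam
  set v : ℝ → ℂ := fun t ↦ pCoeff lam t * deriv g t with hv_def
  -- `g`, `g′`, `v`, `v′`, `Wg` vanish for `|x| > R₀`
  set R₀ : ℝ := max R (lam + 1) with hR₀
  have hO : IsOpen {s : ℝ | R₀ < |s|} := isOpen_lt continuous_const continuous_abs
  have hOU : ∀ s, R₀ < |s| → s ∈ U := by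
    intro s hs
    have h1 : lam + 1 ≤ R₀ := le_max_right _ _
    constructor
    · rintro rfl; rw [abs_of_pos hlam] at hs; linarith
    · rintro rfl; rw [abs_neg, abs_of_pos hlam] at hs; linarith
  have hg0 : ∀ s, R₀ < |s| → g s = 0 := fun s hs ↦ hgR s ((le_max_left _ _).trans hs.le)
  have hg0' : ∀ s, R₀ < |s| → g =ᶠ[𝓝 s] fun _ ↦ (0 : ℂ) := fun s hs ↦
    Filter.eventually_of_mem (hO.mem_nhds hs) fun t ht ↦ hg0 t ht
  have hdg0 : ∀ s, R₀ < |s| → deriv g s = 0 := by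
    intro s hs; rw [(hg0' s hs).deriv_eq, deriv_const]
  have hv0' : ∀ s, R₀ < |s| → v =ᶠ[𝓝 s] fun _ ↦ (0 : ℂ) := fun s hs ↦
    Filter.eventually_of_mem (hO.mem_nhds hs) fun t ht ↦ by
      simp only [hv_def, hdg0 t ht, mul_zero]
  have hdv0 : ∀ s, R₀ < |s| → deriv v s = 0 := by
    intro s hs; rw [(hv0' s hs).deriv_eq, deriv_const]
  have hWg0 : ∀ s, R₀ < |s| → Wg s = 0 := by
    intro s hs
    rw [hWg s (hOU s hs).1 (hOU s hs).2]
    have h1 : deriv v s = 0 := hdv0 s hs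
    simp only [hv_def] at h1
    rw [h1, hg0 s hs]; simp
  set R₁ : ℝ := R₀ + 1 with hR₁
  have hR₀lam : lam < R₀ := by
    have : lam + 1 ≤ R₀ := le_max_right _ _; linarith
  -- the weak equation, for every Schwartz `θ`
  refine exists_prolateMax_eq_of_forall_integral lam fun θ ↦ ?_
  have hθ2 : ContDiff ℝ 2 (fun t ↦ θ t) := θ.smooth 2
  have hθ1 : ContDiff ℝ 1 (fun t ↦ θ t) := θ.smooth 1
  set F : ℝ → ℂ := fun t ↦ prolateSchwartz lam θ t * g t - θ t * Wg t with hF_def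
  set B : ℝ → ℂ := fun s ↦ θ s * (pCoeff lam s * deriv g s) - pCoeff lam s * deriv θ s * g s
    with hB_def
  have hWθg : Integrable (fun t ↦ prolateSchwartz lam θ t * g t) :=
    ((prolateSchwartz lam θ).memLp 2 volume).integrable_mul hg2
  have hθWg : Integrable (fun t ↦ θ t * Wg t) := (θ.memLp 2 volume).integrable_mul hWg2
  have hFint : Integrable F := hWθg.sub hθWg
  have hFi : ∀ a b : ℝ, IntervalIntegrable F volume a b := fun a b ↦
    (hFint.integrableOn).intervalIntegrable
  -- Green on compact pieces
  have hId : ∀ a b : ℝ, Ioo a b ⊆ U → ∀ x ∈ Ioo a b, ∀ y ∈ Ioo a b, x ≤ y →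
      ∫ t in x..y, F t = B y - B x := by
    intro a b hab x hx y hy hxy
    have hsub : Icc x y ⊆ U := fun s hs ↦ hab ⟨hx.1.trans_le hs.1, hs.2.trans_lt hy.2⟩
    exact intervalIntegral_green_piece lam hxy hsub hg hWg θ
  -- the bracket limits at `±λ` (two-sided) and at `±R₁` (where everything vanishes)
  have hBlim : ∀ a c, Tendsto (fun x ↦ pCoeff lam x * deriv g x) (𝓝[≠] a) (𝓝 c) →
      Tendsto (fun x ↦ pCoeff lam x * g x) (𝓝[≠] a) (𝓝 0) →
      Tendsto B (𝓝[≠] a) (𝓝 (θ a * c)) := by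
    intro a c hv hg0
    have hθc : Tendsto (fun t ↦ θ t) (𝓝[≠] a) (𝓝 (θ a)) :=
      ((θ.continuous.tendsto a).mono_left nhdsWithin_le_nhds)
    have hθ'c : Tendsto (fun t ↦ deriv (fun t ↦ θ t) t) (𝓝[≠] a) (𝓝 (deriv (fun t ↦ θ t) a)) :=
      (((hθ1.continuous_deriv le_rfl).tendsto a).mono_left nhdsWithin_le_nhds)
    have h := (hθc.mul hv).sub (hθ'c.mul hg0)
    rw [mul_zero, sub_zero] at h
    refine h.congr' (Eventually.of_forall fun s ↦ ?_)
    simp only [hB_def]; ring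
  have hBp := hBlim lam cp hvp hgp
  have hBm := hBlim (-lam) cm hvm hgm
  have hBout : ∀ s, R₀ < |s| → Tendsto B (𝓝 s) (𝓝 0) := by
    intro s hs
    refine tendsto_const_nhds.congr' ?_
    filter_upwards [hO.mem_nhds hs] with t ht
    simp only [hB_def, hg0 t ht, hdg0 t ht]; simp
  have hR₁abs : R₀ < |R₁| := by
    rw [abs_of_pos (by linarith)]; linarith
  have hR₁abs' : R₀ < |(-R₁)| := by rw [abs_neg]; exact hR₁abs
  -- the three pieces
  have hP1 : ∫ t in (-R₁)..(-lam), F t = θ (-lam) * cm - 0 := by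
    refine intervalIntegral_eq_sub_of_boundary_tendsto (by linarith) (hFi _ _)
      (hId (-R₁) (-lam) (fun s hs ↦ ⟨by linarith [hs.2], hs.2.ne⟩)) ?_ ?_
    · exact (hBout _ hR₁abs').mono_left nhdsWithin_le_nhds
    · exact hBm.mono_left (nhdsWithin_mono _ fun s hs ↦ ne_of_lt hs)
  have hP2 : ∫ t in (-lam)..lam, F t = θ lam * cp - θ (-lam) * cm := by
    refine intervalIntegral_eq_sub_of_boundary_tendsto (by linarith) (hFi _ _)
      (hId (-lam) lam (fun s hs ↦ ⟨hs.2.ne, hs.1.ne'⟩)) ?_ ?_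
    · exact hBm.mono_left (nhdsWithin_mono _ fun s hs ↦ ne_of_gt hs)
    · exact hBp.mono_left (nhdsWithin_mono _ fun s hs ↦ ne_of_lt hs)
  have hP3 : ∫ t in lam..R₁, F t = 0 - θ lam * cp := by
    refine intervalIntegral_eq_sub_of_boundary_tendsto (by linarith) (hFi _ _)
      (hId lam R₁ (fun s hs ↦ ⟨hs.1.ne', by linarith [hs.1]⟩)) ?_ ?_
    · exact hBp.mono_left (nhdsWithin_mono _ fun s hs ↦ ne_of_gt hs)
    · exact (hBout _ hR₁abs).mono_left nhdsWithin_le_nhds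
  -- `F` vanishes outside `[−R₁, R₁]`, so `∫_ℝ F = ∫_{−R₁}^{R₁} F = 0`
  have hsupp : Function.support F ⊆ Ioc (-R₁) R₁ := by
    intro t ht
    rw [Function.mem_support] at ht
    by_contra hcon
    apply ht
    have hR : R₀ < |t| := by
      rw [mem_Ioc, not_and_or, not_lt, not_le] at hcon
      rcases hcon with h | h
      · rw [abs_of_neg (by linarith)]; linarith
      · rw [abs_of_pos (by linarith)]; linarith
    simp only [hF_def, hg0 t hR, hWg0 t hR, mul_zero, sub_zero]
  have hInt : ∫ t, F t = 0 := by
    rw [← intervalIntegral.integral_eq_integral_of_support_subset hsupp,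
      ← intervalIntegral.integral_add_adjacent_intervals (hFi (-R₁) (-lam)) (hFi (-lam) R₁),
      ← intervalIntegral.integral_add_adjacent_intervals (hFi (-lam) lam) (hFi lam R₁),
      hP1, hP2, hP3]
    ring
  -- conclude
  have e1 : ∫ t, prolateSchwartz lam θ t * (hg2.toLp g : L2R) t =
      ∫ t, prolateSchwartz lam θ t * g t :=
    integral_congr_ae (by
      filter_upwards [hg2.coeFn_toLp] with t ht
      rw [ht])
  have e2 : ∫ t, θ t * (hWg2.toLp Wg : L2R) t = ∫ t, θ t * Wg t :=
    integral_congr_ae (by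
      filter_upwards [hWg2.coeFn_toLp] with t ht
      rw [ht])
  rw [e1, e2]
  have : (∫ t, prolateSchwartz lam θ t * g t) - ∫ t, θ t * Wg t = 0 := by
    rw [← integral_sub hWθg hθWg]; exact hInt
  exact sub_eq_zero.1 this

end Generic

/-! ## §2. The cutoffs `β₊ = 1_{[−λ,λ]}` and `β₋ = x·1_{[−λ,λ]}` lie in `dom W_max` -/

section Beta

variable {lam : ℝ}

/-- Points of `{x ≠ ±λ}` near `λ` (punctured): `𝓝[≠] λ`-eventually `x ≠ ±λ`. [folklore] -/
private theorem eventually_nhdsNE_mem_ne_lam (hlam : 0 < lam) :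
    ∀ᶠ x in 𝓝[≠] lam, x ≠ lam ∧ x ≠ -lam := by
  have h1 : ∀ᶠ x in 𝓝[≠] lam, x ≠ lam := eventually_mem_nhdsWithin
  have h2 : ∀ᶠ x in 𝓝[≠] lam, x ≠ -lam :=
    mem_nhdsWithin_of_mem_nhds ((isOpen_ne_fun continuous_id continuous_const).mem_nhds
      (show lam ≠ -lam by linarith))
  exact h1.and h2

/-- Points of `{x ≠ ±λ}` near `−λ` (punctured): `𝓝[≠] (−λ)`-eventually `x ≠ ±λ`. [folklore] -/
private theorem eventually_nhdsNE_neg_mem_ne_lam (hlam : 0 < lam) :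
    ∀ᶠ x in 𝓝[≠] (-lam), x ≠ lam ∧ x ≠ -lam := by
  have h1 : ∀ᶠ x in 𝓝[≠] (-lam), x ≠ -lam := eventually_mem_nhdsWithin
  have h2 : ∀ᶠ x in 𝓝[≠] (-lam), x ≠ lam :=
    mem_nhdsWithin_of_mem_nhds ((isOpen_ne_fun continuous_id continuous_const).mem_nhds
      (show -lam ≠ lam by linarith))
  exact h2.and h1

/-- `p · h → 0` at a zero `a` of `p` when `h` is bounded near `a`. [folklore] -/
private theorem tendsto_pCoeff_mul_of_bound {a : ℝ} (ha : pCoeff lam a = 0) {l : Filter ℝ} (hl : l ≤ 𝓝 a)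
    {h : ℝ → ℂ} {C : ℝ} (hC : ∀ᶠ x in l, ‖h x‖ ≤ C) :
    Tendsto (fun x ↦ pCoeff lam x * h x) l (𝓝 0) := by
  have hp : Tendsto (fun x ↦ pCoeff lam x) l (𝓝 0) := by
    have := ((continuous_pCoeff_def lam).tendsto a).mono_left hl
    rwa [ha] at this
  have hp' : Tendsto (fun x ↦ ‖pCoeff lam x‖ * C) l (𝓝 0) := by
    have := hp.norm.mul_const C
    simpa using this
  refine squeeze_zero_norm' ?_ hp'
  filter_upwards [hC] with x hx
  rw [norm_mul]
  exact mul_le_mul_of_nonneg_left hx (norm_nonneg _)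

/-- A function that is locally constant on the open set `{x ≠ ±λ}` piece by piece: the indicator of
`[−λ, λ]` times a smooth function is `C^n` off `±λ`, and its derivative there is the indicator of
the derivative — the calculus behind "`P_λ f ∈ dom W_max`" for `f` smooth near `[−λ, λ]`.
[cite: ConnesMoscovici2022, proof of Lemma 1.3, first sentence (= arXiv:2112.05500, chunk p0004:L110–L112)] -/
theorem contDiffOn_indicator_mul {f : ℝ → ℂ} {n : WithTop ℕ∞} (hf : ContDiff ℝ n f) (lam : ℝ) :
    ContDiffOn ℝ n (fun x ↦ (Icc (-lam) lam).indicator f x) {x : ℝ | x ≠ lam ∧ x ≠ -lam} := by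
  intro x hx
  rcases lt_or_gt_of_ne hx.1 with h | h
  · rcases lt_or_gt_of_ne hx.2 with h' | h'
    · -- `x < −λ`: locally `0`
      have hev : (fun y ↦ (Icc (-lam) lam).indicator f y) =ᶠ[𝓝 x] fun _ ↦ (0 : ℂ) := by
        filter_upwards [Iio_mem_nhds h'] with y hy
        rw [indicator_of_notMem]; exact fun hm ↦ absurd hm.1 (not_le.2 hy)
      exact (contDiffAt_const.congr_of_eventuallyEq hev).contDiffWithinAt
    · -- `−λ < x < λ`: locally `f`
      have hev : (fun y ↦ (Icc (-lam) lam).indicator f y) =ᶠ[𝓝 x] f := by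
        filter_upwards [Ioo_mem_nhds h' h] with y hy
        rw [indicator_of_mem (Ioo_subset_Icc_self hy)]
      exact (hf.contDiffAt.congr_of_eventuallyEq hev).contDiffWithinAt
  · -- `λ < x`: locally `0`
    have hev : (fun y ↦ (Icc (-lam) lam).indicator f y) =ᶠ[𝓝 x] fun _ ↦ (0 : ℂ) := by
      filter_upwards [Ioi_mem_nhds h] with y hy
      rw [indicator_of_notMem]; exact fun hm ↦ absurd hm.2 (not_le.2 hy)
    exact (contDiffAt_const.congr_of_eventuallyEq hev).contDiffWithinAt

/-- Off `±λ`, the derivative of `P_λ f = 1_{[−λ,λ]} · f` is `1_{[−λ,λ]} · f′`.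
[cite: ConnesMoscovici2022, proof of Lemma 1.3, first sentence (= arXiv:2112.05500, chunk p0004:L110–L112)] -/
theorem deriv_indicator_mul {f : ℝ → ℂ} {x : ℝ} (hx : x ≠ lam ∧ x ≠ -lam) :
    deriv (fun y ↦ (Icc (-lam) lam).indicator f y) x = (Icc (-lam) lam).indicator (deriv f) x := by
  rcases lt_or_gt_of_ne hx.1 with h | h
  · rcases lt_or_gt_of_ne hx.2 with h' | h'
    · have hev : (fun y ↦ (Icc (-lam) lam).indicator f y) =ᶠ[𝓝 x] fun _ ↦ (0 : ℂ) := by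
        filter_upwards [Iio_mem_nhds h'] with y hy
        rw [indicator_of_notMem]; exact fun hm ↦ absurd hm.1 (not_le.2 hy)
      rw [hev.deriv_eq, deriv_const, indicator_of_notMem]
      exact fun hm ↦ absurd hm.1 (not_le.2 h')
    · have hev : (fun y ↦ (Icc (-lam) lam).indicator f y) =ᶠ[𝓝 x] f := by
        filter_upwards [Ioo_mem_nhds h' h] with y hy
        rw [indicator_of_mem (Ioo_subset_Icc_self hy)]
      rw [hev.deriv_eq, indicator_of_mem (show x ∈ Icc (-lam) lam from ⟨h'.le, h.le⟩)]
  · have hev : (fun y ↦ (Icc (-lam) lam).indicator f y) =ᶠ[𝓝 x] fun _ ↦ (0 : ℂ) := by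
      filter_upwards [Ioi_mem_nhds h] with y hy
      rw [indicator_of_notMem]; exact fun hm ↦ absurd hm.2 (not_le.2 hy)
    rw [hev.deriv_eq, deriv_const, indicator_of_notMem]
    exact fun hm ↦ absurd hm.2 (not_le.2 h)

/-- A bounded measurable function supported in `[−λ, λ]` is in `L²`: the indicator of `[−λ, λ]`
times a continuous function (`P_λ f ∈ L²`).
[cite: ConnesMoscovici2022, proof of Lemma 1.3, first sentence (= arXiv:2112.05500, chunk p0004:L110–L112)] -/
theorem memLp_indicator_mul_of_continuous {f : ℝ → ℂ} (hf : Continuous f) (lam : ℝ) :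
    MemLp (fun x ↦ (Icc (-lam) lam).indicator f x) 2 volume := by
  change MemLp ((Icc (-lam) lam).indicator f) 2 volume
  rw [memLp_indicator_iff_restrict measurableSet_Icc]
  haveI : IsFiniteMeasure (volume.restrict (Icc (-lam) lam)) :=
    ⟨by rw [Measure.restrict_apply_univ]; exact measure_Icc_lt_top⟩
  obtain ⟨C, hC⟩ := isCompact_Icc.exists_bound_of_continuousOn (hf.continuousOn (s := Icc (-lam) lam))
  exact MemLp.of_bound hf.aestronglyMeasurable C
    (ae_restrict_of_forall_mem measurableSet_Icc fun x hx ↦ hC x hx)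

/-- RH-FREE (PROVED). **`β = 1_{[−λ,λ]} · f ∈ dom W_max` for `f` smooth, with
`W_max β = 1_{[−λ,λ]} · W f`** — the printed "`β₊ = 1_I` … belongs to `P_λ 𝒮(ℝ)` and hence to
`dom W_max`", here for ANY smooth `f` (no decay needed since the cutoff has compact support), via
the generic lemma: `p β′ = 1_I p f′ → 0` and `p β → 0` at `±λ` because `p(±λ) = 0`.
[cite: ConnesMoscovici2022, text before Lemma 1.5 and proof of Lemma 1.3 (= arXiv:2112.05500, chunk p0005:L84–L92; p0004:L110–p0005:L9)] -/
theorem exists_prolateMax_indicator_mul (hlam : 0 < lam) {f : ℝ → ℂ} (hf : ContDiff ℝ 2 f) :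
    ∃ (hβ : MemLp (fun x ↦ (Icc (-lam) lam).indicator f x) 2 volume)
      (hW : MemLp (fun x ↦ (Icc (-lam) lam).indicator
        (fun y ↦ -deriv (fun s ↦ pCoeff lam s * deriv f s) y + qCoeff lam y * f y) x) 2 volume)
      (h : hβ.toLp _ ∈ (prolateMax lam).domain),
      prolateMax lam ⟨hβ.toLp _, h⟩ = hW.toLp _ := by
  set U : Set ℝ := {s : ℝ | s ≠ lam ∧ s ≠ -lam} with hU_def
  have hU : IsOpen U := isOpen_ne_lam lam
  have h2 : ContDiff ℝ (1 + 1) f := by simpa [one_add_one_eq_two] using hf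
  have hfd : Differentiable ℝ f := hf.differentiable (by norm_num)
  have hf'1 : ContDiff ℝ 1 (deriv f) := (contDiff_succ_iff_deriv.mp h2).2.2
  set g : ℝ → ℂ := fun x ↦ (Icc (-lam) lam).indicator f x with hg_def
  set Wf : ℝ → ℂ := fun y ↦ -deriv (fun s ↦ pCoeff lam s * deriv f s) y + qCoeff lam y * f y
    with hWf_def
  set Wg : ℝ → ℂ := fun x ↦ (Icc (-lam) lam).indicator Wf x with hWg_def
  have hβ : MemLp g 2 volume := memLp_indicator_mul_of_continuous hf.continuous lam
  -- `v = p g′ = 1_I · (p f′)` off `±λ`, a smooth function times the indicator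
  set w : ℝ → ℂ := fun s ↦ pCoeff lam s * deriv f s with hw_def
  have hw1 : ContDiff ℝ 1 w := (contDiff_pCoeff_def lam 1).mul hf'1
  have hv_eq : ∀ s ∈ U, pCoeff lam s * deriv g s = (Icc (-lam) lam).indicator w s := by
    intro s hs
    rw [hg_def, deriv_indicator_mul hs]
    by_cases hsI : s ∈ Icc (-lam) lam
    · rw [indicator_of_mem hsI, indicator_of_mem hsI]
    · rw [indicator_of_notMem hsI, indicator_of_notMem hsI, mul_zero]
  have hdv_eq : ∀ s ∈ U, deriv (fun t ↦ pCoeff lam t * deriv g t) s =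
      (Icc (-lam) lam).indicator (deriv w) s := by
    intro s hs
    have hev : (fun t ↦ pCoeff lam t * deriv g t) =ᶠ[𝓝 s]
        fun t ↦ (Icc (-lam) lam).indicator w t :=
      Filter.eventually_of_mem (hU.mem_nhds hs) fun t ht ↦ hv_eq t ht
    rw [hev.deriv_eq, deriv_indicator_mul hs]
  have hWfc : Continuous Wf := (hw1.continuous_deriv le_rfl).neg.add
    ((continuous_qCoeff_def lam).mul hf.continuous)
  have hW : MemLp Wg 2 volume := memLp_indicator_mul_of_continuous hWfc lam
  have hWg : ∀ x, x ≠ lam → x ≠ -lam →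
      Wg x = -deriv (fun s ↦ pCoeff lam s * deriv g s) x + qCoeff lam x * g x := by
    intro x h1 h2
    rw [hdv_eq x ⟨h1, h2⟩]
    simp only [hWg_def, hg_def, hWf_def]
    by_cases hxI : x ∈ Icc (-lam) lam
    · simp only [indicator_of_mem hxI]
    · simp only [indicator_of_notMem hxI, neg_zero, mul_zero, add_zero]
  -- boundary data: `p g′ → 0` (it is `1_I · p f′`, and `p f′ → 0`), `p g → 0`
  have hv_lim : ∀ a, pCoeff lam a = 0 → (∀ᶠ x in 𝓝[≠] a, x ≠ lam ∧ x ≠ -lam) →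
      Tendsto (fun x ↦ pCoeff lam x * deriv g x) (𝓝[≠] a) (𝓝 0) := by
    intro a ha hev
    have h0 : Tendsto (fun x ↦ pCoeff lam x * (Icc (-lam) lam).indicator (deriv f) x)
        (𝓝[≠] a) (𝓝 0) := by
      obtain ⟨C, hC⟩ := (isCompact_Icc (a := a - 1) (b := a + 1)).exists_bound_of_continuousOn
        ((hf'1.continuous).continuousOn)
      refine tendsto_pCoeff_mul_of_bound ha nhdsWithin_le_nhds (C := max C 0) ?_
      filter_upwards [mem_nhdsWithin_of_mem_nhds (Icc_mem_nhds (show a - 1 < a by linarith)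
        (show a < a + 1 by linarith))] with x hx
      refine (norm_indicator_le_norm_self _ _).trans ((hC x hx).trans (le_max_left _ _))
    refine h0.congr' ?_
    filter_upwards [hev] with x hx
    rw [hg_def, deriv_indicator_mul hx]
  have hg_lim : ∀ a, pCoeff lam a = 0 →
      Tendsto (fun x ↦ pCoeff lam x * g x) (𝓝[≠] a) (𝓝 0) := by
    intro a ha
    obtain ⟨C, hC⟩ := (isCompact_Icc (a := a - 1) (b := a + 1)).exists_bound_of_continuousOn
      (hf.continuous.continuousOn)
    refine tendsto_pCoeff_mul_of_bound ha nhdsWithin_le_nhds (C := max C 0) ?_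
    filter_upwards [mem_nhdsWithin_of_mem_nhds (Icc_mem_nhds (show a - 1 < a by linarith)
      (show a < a + 1 by linarith))] with x hx
    exact (norm_indicator_le_norm_self _ _).trans ((hC x hx).trans (le_max_left _ _))
  obtain ⟨h, hW'⟩ := exists_prolateMax_eq_of_piecewise hlam (R := lam + 1) (cp := 0) (cm := 0)
    (contDiffOn_indicator_mul hf lam)
    (fun x hx ↦ by
      rw [indicator_of_notMem]
      intro hm
      have : |x| ≤ lam := abs_le.2 ⟨hm.1, hm.2⟩
      linarith)
    hWg hβ hW (hv_lim lam (pCoeff_lam lam) (eventually_nhdsNE_mem_ne_lam hlam))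
    (hv_lim (-lam) (pCoeff_neg_lam lam) (eventually_nhdsNE_neg_mem_ne_lam hlam))
    (hg_lim lam (pCoeff_lam lam)) (hg_lim (-lam) (pCoeff_neg_lam lam))
  exact ⟨hβ, hW, h, hW'⟩

/-- RH-FREE (PROVED). **`β₊ = 1_{[−λ,λ]} ∈ dom W_max`**, on the `L²` class exactly as in the clause
of `CM22_lemma_1_5_corr` ("`β₊(x) = 1_I` … which belongs to `P_λ 𝒮(ℝ)` and hence to `dom W_max`").
[cite: ConnesMoscovici2022, text before Lemma 1.5 (= arXiv:2112.05500, chunk p0005:L88–L90)] -/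
theorem mem_prolateMax_of_ae_eq_betaPlus (hlam : 0 < lam) (βp : L2R)
    (hβp : (βp : ℝ → ℂ) =ᵐ[volume] (Icc (-lam) lam).indicator fun _ ↦ (1 : ℂ)) :
    βp ∈ (prolateMax lam).domain := by
  obtain ⟨hβ, _, h, _⟩ := exists_prolateMax_indicator_mul hlam (f := fun _ ↦ (1 : ℂ))
    contDiff_const
  have e : βp = hβ.toLp _ := Lp.ext (hβp.trans hβ.coeFn_toLp.symm)
  rw [e]; exact h

/-- RH-FREE (PROVED). **`β₋ = x·1_{[−λ,λ]} ∈ dom W_max`**, on the `L²` class exactly as in the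
clause of `CM22_lemma_1_5_corr` ("`β₋(x) := x β₊(x)`").
[cite: ConnesMoscovici2022, text before Lemma 1.5 (= arXiv:2112.05500, chunk p0005:L90–L92)] -/
theorem mem_prolateMax_of_ae_eq_betaMinus (hlam : 0 < lam) (βm : L2R)
    (hβm : (βm : ℝ → ℂ) =ᵐ[volume] (Icc (-lam) lam).indicator fun x ↦ (x : ℂ)) :
    βm ∈ (prolateMax lam).domain := by
  obtain ⟨hβ, _, h, _⟩ := exists_prolateMax_indicator_mul hlam (f := fun x : ℝ ↦ (x : ℂ))
    Complex.ofRealCLM.contDiff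
  have e : βm = hβ.toLp _ := Lp.ext (hβm.trans hβ.coeFn_toLp.symm)
  rw [e]; exact h

end Beta

/-! ## §3. Logarithmic integrability and the derivative of `log|λ² − x²|` -/

section LogTools

/-- `log² ∈ L¹_loc(ℝ)`: `t ↦ (log t)²` is interval integrable on every `[a, b]` (antiderivative
`t log²t − 2t log t + 2t` on `(0, 1]`, continuity elsewhere, evenness). [folklore] -/
private theorem intervalIntegrable_log_sq (a b : ℝ) :
    IntervalIntegrable (fun t ↦ Real.log t ^ 2) volume a b := by
  apply intervalIntegrable_of_even (f := fun t ↦ Real.log t ^ 2)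
    (fun x ↦ by simp only [Real.log_neg_eq_log])
  intro x hx
  apply IntervalIntegrable.trans (b := 1)
  · -- on `[0, 1]`: `log² = g′` with `g(t) = t log²t − 2 t log t + 2t ≥`, `g` continuous on `[0,1]`
    set g : ℝ → ℝ := fun t ↦ 4 * (Real.sqrt t * Real.log (Real.sqrt t)) ^ 2
      - 2 * (t * Real.log t) + 2 * t with hg
    have hgc : Continuous g :=
      ((continuous_const.mul ((Real.continuous_mul_log.comp Real.continuous_sqrt).pow 2)).sub
        (continuous_const.mul Real.continuous_mul_log)).add (continuous_const.mul continuous_id)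
    apply intervalIntegral.intervalIntegrable_deriv_of_nonneg (g := g) hgc.continuousOn
    · intro s hs
      rw [min_eq_left zero_le_one, max_eq_right zero_le_one] at hs
      have hs0 : 0 < s := hs.1
      have hs0' : s ≠ 0 := hs0.ne'
      -- near `s > 0`, `g(t) = t log²t − 2 t log t + 2t`
      have hev : g =ᶠ[𝓝 s] fun t ↦ t * Real.log t ^ 2 - 2 * (t * Real.log t) + 2 * t := by
        filter_upwards [Ioi_mem_nhds hs0] with t ht
        have ht0 : 0 ≤ t := le_of_lt ht
        simp only [hg]
        rw [Real.log_sqrt ht0, show (Real.sqrt t * (Real.log t / 2)) ^ 2 =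
          Real.sqrt t ^ 2 * (Real.log t ^ 2 / 4) by ring, Real.sq_sqrt ht0]
        ring
      have hd : HasDerivAt (fun t ↦ t * Real.log t ^ 2 - 2 * (t * Real.log t) + 2 * t)
          (Real.log s ^ 2) s := by
        have h1 : HasDerivAt (fun t ↦ t * Real.log t ^ 2)
            (1 * Real.log s ^ 2 + s * ((2 : ℕ) * Real.log s ^ (2 - 1) * s⁻¹)) s :=
          (hasDerivAt_id' s).mul ((Real.hasDerivAt_log hs0').pow 2)
        have h2 := Real.hasDerivAt_mul_log hs0'
        have h3 : HasDerivAt (fun t : ℝ ↦ 2 * t) (2 * 1) s := (hasDerivAt_id' s).const_mul 2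
        have h := (h1.sub (h2.const_mul 2)).add h3
        have e1 : s * ((2 : ℕ) * Real.log s ^ (2 - 1) * s⁻¹) = 2 * Real.log s := by
          rw [show (2 : ℕ) - 1 = 1 from rfl, pow_one, Nat.cast_ofNat]; field_simp
        have e2 : 1 * Real.log s ^ 2 + s * ((2 : ℕ) * Real.log s ^ (2 - 1) * s⁻¹)
            - 2 * (Real.log s + 1) + 2 * 1 = Real.log s ^ 2 := by
          rw [e1]; ring
        rw [e2] at h
        exact h
      exact hd.congr_of_eventuallyEq hev
    · exact fun s _ ↦ sq_nonneg _
  · -- on `[1, x]`: continuity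
    apply ContinuousOn.intervalIntegrable
    refine (Real.continuousOn_log.mono ?_).pow 2
    intro t ht
    have h1 : (0 : ℝ) ∉ uIcc 1 x := Set.notMem_uIcc_of_lt zero_lt_one hx
    exact fun h0 ↦ h1 (h0 ▸ ht)

/-- `log²|λ² − x²| ≤ 2 log²(x − λ) + 2 log²(x + λ)` (with equality of logs off `±λ`, and the
left side `= 0` at `±λ` by `log 0 = 0`). [folklore] -/
private theorem log_abs_pSq_sq_le (lam x : ℝ) :
    Real.log |lam ^ 2 - x ^ 2| ^ 2 ≤ 2 * Real.log (x - lam) ^ 2 + 2 * Real.log (x + lam) ^ 2 := by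
  rw [Real.log_abs]
  by_cases h : lam ^ 2 - x ^ 2 = 0
  · rw [h, Real.log_zero, zero_pow two_ne_zero]; positivity
  · have hfac : lam ^ 2 - x ^ 2 = -(x - lam) * (x + lam) := by ring
    have h1 : x - lam ≠ 0 := fun h0 ↦ h (by rw [hfac, h0]; ring)
    have h2 : x + lam ≠ 0 := fun h0 ↦ h (by rw [hfac, h0]; ring)
    rw [hfac, Real.log_mul (neg_ne_zero.2 h1) h2, Real.log_neg_eq_log]
    nlinarith [sq_nonneg (Real.log (x - lam) - Real.log (x + lam))]

/-- `x ↦ log²|λ² − x²|` is interval integrable on every `[a, b]`. [folklore] -/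
private theorem intervalIntegrable_log_abs_pSq_sq (lam a b : ℝ) :
    IntervalIntegrable (fun x ↦ Real.log |lam ^ 2 - x ^ 2| ^ 2) volume a b := by
  have h1 : IntervalIntegrable (fun x ↦ Real.log (x - lam) ^ 2) volume a b := by
    have := (intervalIntegrable_log_sq (a - lam) (b - lam)).comp_sub_right lam
    simpa using this
  have h2 : IntervalIntegrable (fun x ↦ Real.log (x + lam) ^ 2) volume a b := by
    have := (intervalIntegrable_log_sq (a + lam) (b + lam)).comp_add_right lam
    simpa using this
  have hdom := (h1.const_mul 2).add (h2.const_mul 2)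
  refine hdom.mono_fun' ?_ ?_
  · exact ((Real.measurable_log.comp ((measurable_const.sub (measurable_id.pow_const 2)).abs)).pow_const
      2).aestronglyMeasurable
  · refine Eventually.of_forall fun x ↦ ?_
    show ‖Real.log |lam ^ 2 - x ^ 2| ^ 2‖ ≤ 2 * Real.log (x - lam) ^ 2 + 2 * Real.log (x + lam) ^ 2
    rw [Real.norm_eq_abs, abs_of_nonneg (sq_nonneg _)]
    exact log_abs_pSq_sq_le lam x

/-- The derivative of `log|λ² − x²|` off `±λ`: `−2x/(λ² − x²)`. [folklore] -/
private theorem hasDerivAt_log_abs_pSq {lam x : ℝ} (hx : lam ^ 2 - x ^ 2 ≠ 0) :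
    HasDerivAt (fun y ↦ Real.log |lam ^ 2 - y ^ 2|) (-(2 * x) / (lam ^ 2 - x ^ 2)) x := by
  have h1 : HasDerivAt (fun y : ℝ ↦ lam ^ 2 - y * y) (-(1 * x + x * 1)) x :=
    ((hasDerivAt_id' x).mul (hasDerivAt_id' x)).const_sub (lam ^ 2)
  have hx' : lam ^ 2 - x * x ≠ 0 := by rwa [← sq] 
  have h2 := h1.log hx'
  have e : (fun y ↦ Real.log |lam ^ 2 - y ^ 2|) = fun y ↦ Real.log (lam ^ 2 - y * y) := by
    funext y; simp only [Real.log_abs, sq]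
  rw [e]
  convert h2 using 1
  rw [sq]; ring

/-- `(λ² − x²) log|λ² − x²| → 0` at `x → a` when `λ² = a²`. [folklore] -/
private theorem tendsto_pSq_mul_log {lam a : ℝ} (ha : lam ^ 2 - a ^ 2 = 0) :
    Tendsto (fun x ↦ (lam ^ 2 - x ^ 2) * Real.log |lam ^ 2 - x ^ 2|) (𝓝 a) (𝓝 0) := by
  have hc : Tendsto (fun x : ℝ ↦ lam ^ 2 - x ^ 2) (𝓝 a) (𝓝 (lam ^ 2 - a ^ 2)) :=
    (continuous_const.sub (continuous_id.pow 2)).tendsto a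
  rw [ha] at hc
  have h := (Real.continuous_mul_log.tendsto 0).comp hc
  simp only [Real.log_zero, mul_zero] at h
  refine h.congr fun x ↦ ?_
  simp only [Function.comp_apply, Real.log_abs]

end LogTools

/-! ## §4. The log-singular test vector `α₊` of Lemma 1.5 lies in `dom W_max`

Throughout, `α : ℝ → ℝ` carries exactly the four clauses of the corrected Lemma 1.5
(`CM22_lemma_1_5_corr` of `UVProlateQuotientBasis.lean`): smooth off `±λ`, even, equal to
`log|λ² − x²|` on `[¾λ, ⁵⁄₄λ]`, supported in `|x| ∈ (½λ, ³⁄₂λ)`. -/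

section Alpha

variable {lam : ℝ} {α : ℝ → ℝ}

/-- Even `α`: `α(|x|) = α(x)`. [folklore] -/
private theorem alpha_abs (heven : ∀ x, α (-x) = α x) (x : ℝ) : α |x| = α x := by
  rcases abs_choice x with h | h
  · rw [h]
  · rw [h, heven]

/-- `α = 0` on `|x| ≤ ½λ`. [cite: ConnesMoscovici2022, text before Lemma 1.5 (= arXiv:2112.05500, chunk p0005:L84–L88)] -/
theorem alpha_eq_zero_of_abs_le (heven : ∀ x, α (-x) = α x)
    (hsupp : ∀ x, 0 ≤ x → α x ≠ 0 → x ∈ Ioo (lam / 2) (3 / 2 * lam)) {x : ℝ}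
    (hx : |x| ≤ lam / 2) : α x = 0 := by
  rw [← alpha_abs heven x]
  by_contra h
  have := (hsupp |x| (abs_nonneg x) h).1
  linarith

/-- `α = 0` on `|x| ≥ ³⁄₂λ`. [cite: ConnesMoscovici2022, text before Lemma 1.5 (= arXiv:2112.05500, chunk p0005:L84–L88)] -/
theorem alpha_eq_zero_of_le_abs (heven : ∀ x, α (-x) = α x)
    (hsupp : ∀ x, 0 ≤ x → α x ≠ 0 → x ∈ Ioo (lam / 2) (3 / 2 * lam)) {x : ℝ}
    (hx : 3 / 2 * lam ≤ |x|) : α x = 0 := by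
  rw [← alpha_abs heven x]
  by_contra h
  have := (hsupp |x| (abs_nonneg x) h).2
  linarith

/-- `α = log|λ² − x²|` on `¾λ ≤ |x| ≤ ⁵⁄₄λ` (both signs of `x`, by evenness). [cite: ConnesMoscovici2022, text before Lemma 1.5 (= arXiv:2112.05500, chunk p0005:L84–L88)] -/
theorem alpha_eq_log (heven : ∀ x, α (-x) = α x)
    (hlog : ∀ x ∈ Icc (3 / 4 * lam) (5 / 4 * lam), α x = Real.log |lam ^ 2 - x ^ 2|) {x : ℝ}
    (h1 : 3 / 4 * lam ≤ |x|) (h2 : |x| ≤ 5 / 4 * lam) : α x = Real.log |lam ^ 2 - x ^ 2| := by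
  rw [← alpha_abs heven x, hlog |x| ⟨h1, h2⟩, sq_abs]

/-- The log window `{¾λ < |x| < ⁵⁄₄λ}` is open and contains `±λ`. [folklore] -/
private theorem isOpen_logWindow (lam : ℝ) : IsOpen {x : ℝ | 3 / 4 * lam < |x| ∧ |x| < 5 / 4 * lam} :=
  (isOpen_lt continuous_const continuous_abs).inter (isOpen_lt continuous_abs continuous_const)

/-- On the punctured log window, `p · (α : ℂ)′ = −2x`. [cite: ConnesMoscovici2022, proof of Lemma 1.2, last lines (= arXiv:2112.05500, chunk p0004:L100–L104)] -/
theorem pCoeff_mul_deriv_alpha (heven : ∀ x, α (-x) = α x)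
    (hlog : ∀ x ∈ Icc (3 / 4 * lam) (5 / 4 * lam), α x = Real.log |lam ^ 2 - x ^ 2|) {x : ℝ}
    (hw : 3 / 4 * lam < |x| ∧ |x| < 5 / 4 * lam) (hU : x ≠ lam ∧ x ≠ -lam) :
    pCoeff lam x * deriv (fun t ↦ (α t : ℂ)) x = ((-2 * x : ℝ) : ℂ) := by
  have hne : lam ^ 2 - x ^ 2 ≠ 0 := by
    intro h0
    have : (lam - x) * (lam + x) = 0 := by rw [← h0]; ring
    rcases mul_eq_zero.1 this with h | h
    · exact hU.1 (by linarith)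
    · exact hU.2 (by linarith)
  have hev : (fun t ↦ (α t : ℂ)) =ᶠ[𝓝 x] fun t ↦ ((Real.log |lam ^ 2 - t ^ 2| : ℝ) : ℂ) := by
    filter_upwards [(isOpen_logWindow lam).mem_nhds hw] with t ht
    rw [alpha_eq_log heven hlog ht.1.le ht.2.le]
  rw [hev.deriv_eq, ((hasDerivAt_log_abs_pSq hne).ofReal_comp).deriv]
  rw [show pCoeff lam x = ((lam ^ 2 - x ^ 2 : ℝ) : ℂ) from rfl, ← Complex.ofReal_mul]
  congr 1
  field_simp

/-- On the log window, `p · α = (λ² − x²) log|λ² − x²|`. [cite: ConnesMoscovici2022, Lemma 1.5 setting (= arXiv:2112.05500, chunk p0005:L84–L92)] -/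
theorem pCoeff_mul_alpha (heven : ∀ x, α (-x) = α x)
    (hlog : ∀ x ∈ Icc (3 / 4 * lam) (5 / 4 * lam), α x = Real.log |lam ^ 2 - x ^ 2|) {x : ℝ}
    (hw : 3 / 4 * lam < |x| ∧ |x| < 5 / 4 * lam) :
    pCoeff lam x * (α x : ℂ) = (((lam ^ 2 - x ^ 2) * Real.log |lam ^ 2 - x ^ 2| : ℝ) : ℂ) := by
  rw [alpha_eq_log heven hlog hw.1.le hw.2.le, show pCoeff lam x = ((lam ^ 2 - x ^ 2 : ℝ) : ℂ)
    from rfl, ← Complex.ofReal_mul]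

/-- RH-FREE (PROVED). **Boundary datum of `α` at `±λ`: `p α′ → −2a` (two-sided) at `a = ±λ`** —
the non-vanishing value `L(α) = −2λ ≠ 0` of the boundary functional of Lemma 1.2 on the log
singularity ("One has `η₀ = log|x − λ| ∈ Dom W_max` and `L(η₀) ≠ 0`"), here for the basis vector
`α₊` of Lemma 1.5. [cite: ConnesMoscovici2022, proof of Lemma 1.2 (= arXiv:2112.05500 Lemma 2.2, chunk p0004:L100–L104) and Lemma 1.5 (chunk p0005:L84–L92)] -/
theorem tendsto_pCoeff_mul_deriv_alpha (hlam : 0 < lam) (heven : ∀ x, α (-x) = α x)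
    (hlog : ∀ x ∈ Icc (3 / 4 * lam) (5 / 4 * lam), α x = Real.log |lam ^ 2 - x ^ 2|) {a : ℝ}
    (ha : a = lam ∨ a = -lam) :
    Tendsto (fun x ↦ pCoeff lam x * deriv (fun t ↦ (α t : ℂ)) x) (𝓝[≠] a)
      (𝓝 ((-2 * a : ℝ) : ℂ)) := by
  have haw : 3 / 4 * lam < |a| ∧ |a| < 5 / 4 * lam := by
    rcases ha with rfl | rfl
    · rw [abs_of_pos hlam]; constructor <;> linarith
    · rw [abs_neg, abs_of_pos hlam]; constructor <;> linarith
  have hevU : ∀ᶠ x in 𝓝[≠] a, x ≠ lam ∧ x ≠ -lam := by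
    rcases ha with rfl | rfl
    · exact eventually_nhdsNE_mem_ne_lam hlam
    · exact eventually_nhdsNE_neg_mem_ne_lam hlam
  have hc : Tendsto (fun x : ℝ ↦ ((-2 * x : ℝ) : ℂ)) (𝓝[≠] a) (𝓝 ((-2 * a : ℝ) : ℂ)) :=
    ((Complex.continuous_ofReal.comp (continuous_const.mul continuous_id)).tendsto a).mono_left
      nhdsWithin_le_nhds
  refine hc.congr' ?_
  filter_upwards [hevU, mem_nhdsWithin_of_mem_nhds ((isOpen_logWindow lam).mem_nhds haw)]
    with x hxU hxw
  exact (pCoeff_mul_deriv_alpha heven hlog hxw hxU).symm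

/-- RH-FREE (PROVED). **`p α → 0` at `±λ`** (`(λ² − x²) log|λ² − x²| → 0`).
[cite: ConnesMoscovici2022, Lemma 1.5 setting (= arXiv:2112.05500, chunk p0005:L84–L92)] -/
theorem tendsto_pCoeff_mul_alpha (hlam : 0 < lam) (heven : ∀ x, α (-x) = α x)
    (hlog : ∀ x ∈ Icc (3 / 4 * lam) (5 / 4 * lam), α x = Real.log |lam ^ 2 - x ^ 2|) {a : ℝ}
    (ha : a = lam ∨ a = -lam) :
    Tendsto (fun x ↦ pCoeff lam x * (α x : ℂ)) (𝓝[≠] a) (𝓝 0) := by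
  have haw : 3 / 4 * lam < |a| ∧ |a| < 5 / 4 * lam := by
    rcases ha with rfl | rfl
    · rw [abs_of_pos hlam]; constructor <;> linarith
    · rw [abs_neg, abs_of_pos hlam]; constructor <;> linarith
  have ha2 : lam ^ 2 - a ^ 2 = 0 := by
    rcases ha with rfl | rfl <;> ring
  have h0 : Tendsto (fun x ↦ (((lam ^ 2 - x ^ 2) * Real.log |lam ^ 2 - x ^ 2| : ℝ) : ℂ)) (𝓝[≠] a)
      (𝓝 0) := by
    have := ((Complex.continuous_ofReal.tendsto 0).comp (tendsto_pSq_mul_log ha2)).mono_left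
      (nhdsWithin_le_nhds (s := {x | x ≠ a}))
    rw [Complex.ofReal_zero] at this
    exact this
  refine h0.congr' ?_
  filter_upwards [mem_nhdsWithin_of_mem_nhds ((isOpen_logWindow lam).mem_nhds haw)] with x hxw
  exact (pCoeff_mul_alpha heven hlog hxw).symm

/-- The exceptional set `{±λ}` is null: `{x ≠ ±λ}` has full measure. [folklore] -/
private theorem ae_mem_ne_lam (lam : ℝ) : ∀ᵐ x ∂(volume : Measure ℝ), x ∈ {x : ℝ | x ≠ lam ∧ x ≠ -lam} := by
  have h : {x : ℝ | x ≠ lam ∧ x ≠ -lam} = ({lam, -lam} : Set ℝ)ᶜ := by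
    ext x; simp [not_or]
  show {x : ℝ | x ≠ lam ∧ x ≠ -lam} ∈ ae volume
  rw [h, compl_mem_ae_iff]
  exact ((Set.finite_singleton (-lam)).insert lam).measure_zero volume

/-- `(α : ℂ)` is a.e.-strongly measurable (continuous off the null set `{±λ}`). [folklore] -/
private theorem aestronglyMeasurable_alpha (hαU : ContDiffOn ℝ (⊤ : ℕ∞) α {x | x ≠ lam ∧ x ≠ -lam}) :
    AEStronglyMeasurable (fun t ↦ (α t : ℂ)) volume := by
  have hrestr : (volume : Measure ℝ).restrict {x : ℝ | x ≠ lam ∧ x ≠ -lam} = volume :=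
    Measure.restrict_eq_self_of_ae_mem (ae_mem_ne_lam lam)
  rw [← hrestr]
  exact (Complex.continuous_ofReal.comp_continuousOn hαU.continuousOn).aestronglyMeasurable
    (isOpen_ne_lam lam).measurableSet

/-- The compact "smooth annulus" `K = {½λ ≤ |x| ≤ ¾λ} ∪ {⁵⁄₄λ ≤ |x| ≤ ³⁄₂λ}` where `α` is smooth
and a priori only bounded. [folklore] -/
private theorem isCompact_smoothAnnulus (hlam : 0 < lam) :
    IsCompact ({x : ℝ | lam / 2 ≤ |x| ∧ |x| ≤ 3 / 4 * lam} ∪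
      {x : ℝ | 5 / 4 * lam ≤ |x| ∧ |x| ≤ 3 / 2 * lam}) := by
  refine (isCompact_Icc (a := -(2 * lam)) (b := 2 * lam)).of_isClosed_subset ?_ ?_
  · exact ((isClosed_le continuous_const continuous_abs).inter
      (isClosed_le continuous_abs continuous_const)).union
      ((isClosed_le continuous_const continuous_abs).inter
      (isClosed_le continuous_abs continuous_const))
  · rintro x (hx | hx)
    · exact abs_le.1 (by linarith [hx.2])
    · exact abs_le.1 (by linarith [hx.2])

/-- The smooth annulus avoids `±λ`. [folklore] -/
private theorem smoothAnnulus_subset (hlam : 0 < lam) :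
    ({x : ℝ | lam / 2 ≤ |x| ∧ |x| ≤ 3 / 4 * lam} ∪
      {x : ℝ | 5 / 4 * lam ≤ |x| ∧ |x| ≤ 3 / 2 * lam}) ⊆ {x : ℝ | x ≠ lam ∧ x ≠ -lam} := by
  rintro x hx
  have hxa : |x| ≠ lam := by
    rcases hx with hx | hx
    · exact fun h ↦ by linarith [hx.2]
    · exact fun h ↦ by linarith [hx.1]
  constructor
  · rintro rfl; exact hxa (abs_of_pos hlam)
  · rintro rfl; exact hxa (by rw [abs_neg, abs_of_pos hlam])

/-- RH-FREE (PROVED). **`α ∈ L²(ℝ)`** (bounded off the log window, `log²`-integrable on it,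
compact support). [cite: ConnesMoscovici2022, Lemma 1.5 setting (= arXiv:2112.05500, chunk p0005:L84–L92)] -/
theorem memLp_alpha (hlam : 0 < lam) (hαU : ContDiffOn ℝ (⊤ : ℕ∞) α {x | x ≠ lam ∧ x ≠ -lam})
    (heven : ∀ x, α (-x) = α x)
    (hlog : ∀ x ∈ Icc (3 / 4 * lam) (5 / 4 * lam), α x = Real.log |lam ^ 2 - x ^ 2|)
    (hsupp : ∀ x, 0 ≤ x → α x ≠ 0 → x ∈ Ioo (lam / 2) (3 / 2 * lam)) :
    MemLp (fun t ↦ (α t : ℂ)) 2 volume := by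
  have hmeas := aestronglyMeasurable_alpha hαU
  obtain ⟨M, hM⟩ := (isCompact_smoothAnnulus hlam).exists_bound_of_continuousOn
    (hαU.continuousOn.mono (smoothAnnulus_subset hlam))
  set L : ℝ → ℝ := fun x ↦ Real.log |lam ^ 2 - x ^ 2| with hL
  set b : ℝ → ℝ := fun x ↦ (Icc (-(2 * lam)) (2 * lam)).indicator (fun x ↦ M ^ 2 + L x ^ 2) x
    with hb
  have hbi : Integrable b := by
    have h : IntervalIntegrable (fun x ↦ M ^ 2 + L x ^ 2) volume (-(2 * lam)) (2 * lam) :=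
      intervalIntegrable_const.add (intervalIntegrable_log_abs_pSq_sq lam _ _)
    exact ((intervalIntegrable_iff_integrableOn_Icc_of_le (by linarith)).1 h).integrable_indicator
      measurableSet_Icc
  rw [memLp_two_iff_integrable_sq_norm hmeas]
  refine hbi.mono' (hmeas.norm.aemeasurable.pow_const 2).aestronglyMeasurable
    (Eventually.of_forall fun x ↦ ?_)
  rw [norm_pow, norm_norm, Complex.norm_real, Real.norm_eq_abs, sq_abs]
  have hLnn : 0 ≤ M ^ 2 + L x ^ 2 := by positivity
  by_cases hx2 : |x| ≤ 2 * lam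
  · have hxI : x ∈ Icc (-(2 * lam)) (2 * lam) := abs_le.1 hx2
    simp only [hb, indicator_of_mem hxI]
    rcases le_or_gt |x| (lam / 2) with h1 | h1
    · rw [alpha_eq_zero_of_abs_le heven hsupp h1]; simpa using hLnn
    rcases le_or_gt |x| (3 / 4 * lam) with h2 | h2
    · have hb' := hM x (Or.inl ⟨h1.le, h2⟩)
      rw [Real.norm_eq_abs] at hb'
      nlinarith [abs_nonneg (α x), sq_abs (α x), sq_nonneg (L x)]
    rcases lt_or_ge |x| (5 / 4 * lam) with h3 | h3
    · rw [alpha_eq_log heven hlog h2.le h3.le]; nlinarith [sq_nonneg M]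
    rcases le_or_gt |x| (3 / 2 * lam) with h4 | h4
    · have hb' := hM x (Or.inr ⟨h3, h4⟩)
      rw [Real.norm_eq_abs] at hb'
      nlinarith [abs_nonneg (α x), sq_abs (α x), sq_nonneg (L x)]
    · rw [alpha_eq_zero_of_le_abs heven hsupp h4.le]; simpa using hLnn
  · have hxI : x ∉ Icc (-(2 * lam)) (2 * lam) := fun h ↦ hx2 (abs_le.2 h)
    simp only [hb, indicator_of_notMem hxI]
    rw [alpha_eq_zero_of_le_abs heven hsupp (by rw [not_le] at hx2; linarith)]
    simp

/-- RH-FREE (PROVED). **`W α ∈ L²(ℝ)`**, `W α := −(p (α:ℂ)′)′ + q α` computed pointwise off `±λ`: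
it vanishes off the support, is continuous (hence bounded) on the smooth annulus, and equals
`2 + q log|λ² − x²|` on the log window. [cite: ConnesMoscovici2022, Lemma 1.5 setting and eq. (1.2) (= arXiv:2112.05500, chunk p0005:L84–L92; p0004:L16–L22)] -/
theorem memLp_W_alpha (hlam : 0 < lam) (hαU : ContDiffOn ℝ (⊤ : ℕ∞) α {x | x ≠ lam ∧ x ≠ -lam})
    (heven : ∀ x, α (-x) = α x)
    (hlog : ∀ x ∈ Icc (3 / 4 * lam) (5 / 4 * lam), α x = Real.log |lam ^ 2 - x ^ 2|)
    (hsupp : ∀ x, 0 ≤ x → α x ≠ 0 → x ∈ Ioo (lam / 2) (3 / 2 * lam)) :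
    MemLp (fun x ↦ -deriv (fun s ↦ pCoeff lam s * deriv (fun t ↦ (α t : ℂ)) s) x
      + qCoeff lam x * (α x : ℂ)) 2 volume := by
  set U : Set ℝ := {s : ℝ | s ≠ lam ∧ s ≠ -lam} with hU_def
  have hU : IsOpen U := isOpen_ne_lam lam
  set G : ℝ → ℂ := fun t ↦ (α t : ℂ) with hG_def
  set V : ℝ → ℂ := fun s ↦ pCoeff lam s * deriv G s with hV_def
  set WG : ℝ → ℂ := fun x ↦ -deriv V x + qCoeff lam x * G x with hWG_def
  have hmeasG := aestronglyMeasurable_alpha hαU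
  have hmeas : AEStronglyMeasurable WG volume :=
    ((measurable_deriv V).neg.aestronglyMeasurable).add
      (((continuous_qCoeff_def lam).aestronglyMeasurable).mul hmeasG)
  -- regularity off `±λ`
  have hGtop : ContDiffOn ℝ (⊤ : ℕ∞) G U := Complex.ofRealCLM.contDiff.comp_contDiffOn hαU
  have h2' : ContDiffOn ℝ 2 G U := hGtop.of_le (WithTop.coe_le_coe.mpr le_top)
  have h2 : ContDiffOn ℝ (1 + 1) G U := by simpa [one_add_one_eq_two] using h2'
  have hGd' : ContDiffOn ℝ 1 (deriv G) U := h2.deriv_of_isOpen hU le_rfl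
  have hV1 : ContDiffOn ℝ 1 V U := ((contDiff_pCoeff_def lam 1).contDiffOn).mul hGd'
  have hV'c : ContinuousOn (deriv V) U := hV1.continuousOn_deriv_of_isOpen hU le_rfl
  have hWGc : ContinuousOn WG U :=
    hV'c.neg.add ((continuous_qCoeff_def lam).continuousOn.mul hGtop.continuousOn)
  -- the zero region
  have hO : IsOpen ({s : ℝ | |s| < lam / 2} ∪ {s : ℝ | 3 / 2 * lam < |s|}) :=
    (isOpen_lt continuous_abs continuous_const).union (isOpen_lt continuous_const continuous_abs)
  have hGO : ∀ s ∈ ({s : ℝ | |s| < lam / 2} ∪ {s : ℝ | 3 / 2 * lam < |s|}), G s = 0 := by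
    rintro s (hs | hs)
    · simp [hG_def, alpha_eq_zero_of_abs_le heven hsupp (le_of_lt hs)]
    · simp [hG_def, alpha_eq_zero_of_le_abs heven hsupp (le_of_lt hs)]
  have hdGO : ∀ s ∈ ({s : ℝ | |s| < lam / 2} ∪ {s : ℝ | 3 / 2 * lam < |s|}), deriv G s = 0 := by
    intro s hs
    have hev : G =ᶠ[𝓝 s] fun _ ↦ (0 : ℂ) :=
      Filter.eventually_of_mem (hO.mem_nhds hs) fun t ht ↦ hGO t ht
    rw [hev.deriv_eq, deriv_const]
  have hWGO : ∀ s ∈ ({s : ℝ | |s| < lam / 2} ∪ {s : ℝ | 3 / 2 * lam < |s|}), WG s = 0 := by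
    intro s hs
    have hev : V =ᶠ[𝓝 s] fun _ ↦ (0 : ℂ) :=
      Filter.eventually_of_mem (hO.mem_nhds hs) fun t ht ↦ by
        simp only [hV_def, hdGO t ht, mul_zero]
    simp only [hWG_def, hev.deriv_eq, deriv_const, hGO s hs]; simp
  -- the log window: `V = −2x`, `V′ = −2`, `WG = 2 + q log|λ² − x²|`
  have hVw : ∀ s, 3 / 4 * lam < |s| ∧ |s| < 5 / 4 * lam → s ∈ U → V s = ((-2 * s : ℝ) : ℂ) :=
    fun s hs hsU ↦ pCoeff_mul_deriv_alpha heven hlog hs hsU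
  have hdVw : ∀ s, 3 / 4 * lam < |s| ∧ |s| < 5 / 4 * lam → s ∈ U → deriv V s = -2 := by
    intro s hs hsU
    have hev : V =ᶠ[𝓝 s] fun t ↦ ((-2 * t : ℝ) : ℂ) :=
      Filter.eventually_of_mem (((isOpen_logWindow lam).inter hU).mem_nhds ⟨hs, hsU⟩)
        fun t ht ↦ hVw t ht.1 ht.2
    rw [hev.deriv_eq, (((hasDerivAt_id' s).const_mul (-2 : ℝ)).ofReal_comp).deriv]
    push_cast; ring
  have hWGw : ∀ s, 3 / 4 * lam < |s| ∧ |s| < 5 / 4 * lam → s ∈ U →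
      WG s = 2 + qCoeff lam s * ((Real.log |lam ^ 2 - s ^ 2| : ℝ) : ℂ) := by
    intro s hs hsU
    simp only [hWG_def, hdVw s hs hsU, hG_def, alpha_eq_log heven hlog hs.1.le hs.2.le]
    ring
  -- the bound
  obtain ⟨M, hM⟩ := (isCompact_smoothAnnulus hlam).exists_bound_of_continuousOn
    (hWGc.mono (smoothAnnulus_subset hlam))
  set L : ℝ → ℝ := fun x ↦ Real.log |lam ^ 2 - x ^ 2| with hL
  set Q : ℝ := (2 * π * lam) ^ 2 * (2 * lam) ^ 2 with hQ
  have hq_le : ∀ x, |x| ≤ 2 * lam → ‖qCoeff lam x‖ ≤ Q := by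
    intro x hx
    rw [show qCoeff lam x = (((2 * π * lam) ^ 2 * x ^ 2 : ℝ) : ℂ) from rfl, Complex.norm_real,
      Real.norm_eq_abs, abs_of_nonneg (by positivity), hQ]
    have : x ^ 2 ≤ (2 * lam) ^ 2 := by
      rw [← sq_abs x]; exact pow_le_pow_left₀ (abs_nonneg x) hx 2
    exact mul_le_mul_of_nonneg_left this (by positivity)
  set b : ℝ → ℝ := fun x ↦ (Icc (-(2 * lam)) (2 * lam)).indicator
    (fun x ↦ M ^ 2 + 8 + 2 * Q ^ 2 * L x ^ 2) x with hb
  have hbi : Integrable b := by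
    have h : IntervalIntegrable (fun x ↦ M ^ 2 + 8 + 2 * Q ^ 2 * L x ^ 2) volume (-(2 * lam))
        (2 * lam) :=
      intervalIntegrable_const.add ((intervalIntegrable_log_abs_pSq_sq lam _ _).const_mul _)
    exact ((intervalIntegrable_iff_integrableOn_Icc_of_le (by linarith)).1 h).integrable_indicator
      measurableSet_Icc
  rw [memLp_two_iff_integrable_sq_norm hmeas]
  refine hbi.mono' (hmeas.norm.aemeasurable.pow_const 2).aestronglyMeasurable ?_
  filter_upwards [ae_mem_ne_lam lam] with x hxU
  rw [norm_pow, norm_norm]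
  have hnn : 0 ≤ M ^ 2 + 8 + 2 * Q ^ 2 * L x ^ 2 := by positivity
  by_cases hx2 : |x| ≤ 2 * lam
  · have hxI : x ∈ Icc (-(2 * lam)) (2 * lam) := abs_le.1 hx2
    simp only [hb, indicator_of_mem hxI]
    rcases lt_or_ge |x| (lam / 2) with h1 | h1
    · rw [hWGO x (Or.inl h1)]; simpa using hnn
    rcases le_or_gt |x| (3 / 4 * lam) with h2 | h2
    · have hb' := hM x (Or.inl ⟨h1, h2⟩)
      have hM0 : 0 ≤ M := (norm_nonneg _).trans hb'
      nlinarith [norm_nonneg (WG x), sq_nonneg (L x), sq_nonneg Q]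
    rcases lt_or_ge |x| (5 / 4 * lam) with h3 | h3
    · rw [hWGw x ⟨h2, h3⟩ hxU]
      have hn : ‖(2 : ℂ) + qCoeff lam x * ((L x : ℝ) : ℂ)‖ ≤ 2 + Q * |L x| := by
        refine (norm_add_le _ _).trans ?_
        rw [norm_mul, Complex.norm_real, Real.norm_eq_abs]
        have h2n : ‖(2 : ℂ)‖ = 2 := by simp
        rw [h2n]
        have := hq_le x hx2
        gcongr
      have hn0 : 0 ≤ ‖(2 : ℂ) + qCoeff lam x * ((L x : ℝ) : ℂ)‖ := norm_nonneg _
      calc ‖(2 : ℂ) + qCoeff lam x * ((L x : ℝ) : ℂ)‖ ^ 2 ≤ (2 + Q * |L x|) ^ 2 :=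
            pow_le_pow_left₀ hn0 hn 2
        _ ≤ M ^ 2 + 8 + 2 * Q ^ 2 * L x ^ 2 := by
            nlinarith [sq_nonneg (2 - Q * |L x|), sq_abs (L x), sq_nonneg M]
    rcases le_or_gt |x| (3 / 2 * lam) with h4 | h4
    · have hb' := hM x (Or.inr ⟨h3, h4⟩)
      have hM0 : 0 ≤ M := (norm_nonneg _).trans hb'
      nlinarith [norm_nonneg (WG x), sq_nonneg (L x), sq_nonneg Q]
    · rw [hWGO x (Or.inr h4)]; simpa using hnn
  · have hxI : x ∉ Icc (-(2 * lam)) (2 * lam) := fun h ↦ hx2 (abs_le.2 h)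
    simp only [hb, indicator_of_notMem hxI]
    rw [hWGO x (Or.inr (by rw [not_le] at hx2; simp only [mem_setOf_eq]; linarith))]
    simp

/-- RH-FREE (PROVED). **The basis vector `α₊` of Lemma 1.5 lies in `dom W_max`**, with
`W_max α = −(p α′)′ + q α` (pointwise off `±λ`): any `α` with the four clauses of
`CM22_lemma_1_5_corr` (smooth off `±λ`, even, `= log|λ² − x²|` on `[¾λ, ⁵⁄₄λ]`, supported in
`|x| ∈ (½λ, ³⁄₂λ)`).  Mechanism: `p α′ = −2x` is continuous ACROSS `±λ` and `p α → 0`, so the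
generic piecewise lemma applies ("`η₀ = log|x − λ| ∈ Dom W_max`").
[cite: ConnesMoscovici2022, Lemma 1.5 and proof of Lemma 1.2 (= arXiv:2112.05500 Lemma 2.5, chunk p0005:L84–L92; Lemma 2.2, chunk p0004:L100–L104)] -/
theorem exists_prolateMax_alpha (hlam : 0 < lam)
    (hαU : ContDiffOn ℝ (⊤ : ℕ∞) α {x | x ≠ lam ∧ x ≠ -lam}) (heven : ∀ x, α (-x) = α x)
    (hlog : ∀ x ∈ Icc (3 / 4 * lam) (5 / 4 * lam), α x = Real.log |lam ^ 2 - x ^ 2|)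
    (hsupp : ∀ x, 0 ≤ x → α x ≠ 0 → x ∈ Ioo (lam / 2) (3 / 2 * lam)) :
    ∃ h : (memLp_alpha hlam hαU heven hlog hsupp).toLp _ ∈ (prolateMax lam).domain,
      prolateMax lam ⟨(memLp_alpha hlam hαU heven hlog hsupp).toLp _, h⟩ =
        (memLp_W_alpha hlam hαU heven hlog hsupp).toLp _ := by
  have hGtop : ContDiffOn ℝ (⊤ : ℕ∞) (fun t ↦ (α t : ℂ)) {x | x ≠ lam ∧ x ≠ -lam} :=
    Complex.ofRealCLM.contDiff.comp_contDiffOn hαU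
  refine exists_prolateMax_eq_of_piecewise hlam (R := 3 / 2 * lam)
    (cp := ((-2 * lam : ℝ) : ℂ)) (cm := ((-2 * (-lam) : ℝ) : ℂ))
    (hGtop.of_le (WithTop.coe_le_coe.mpr le_top))
    (fun x hx ↦ by simp [alpha_eq_zero_of_le_abs heven hsupp hx]) (fun x _ _ ↦ rfl)
    (memLp_alpha hlam hαU heven hlog hsupp) (memLp_W_alpha hlam hαU heven hlog hsupp)
    (tendsto_pCoeff_mul_deriv_alpha hlam heven hlog (Or.inl rfl))
    (tendsto_pCoeff_mul_deriv_alpha hlam heven hlog (Or.inr rfl))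
    (tendsto_pCoeff_mul_alpha hlam heven hlog (Or.inl rfl))
    (tendsto_pCoeff_mul_alpha hlam heven hlog (Or.inr rfl))

/-- RH-FREE (PROVED). **`α₊ ∈ dom W_max`**, on the `L²` class exactly as in the clause of
`CM22_lemma_1_5_corr` (first conjunct of the lemma for the vector `α₊`).
[cite: ConnesMoscovici2022, Lemma 1.5 (= arXiv:2112.05500 Lemma 2.5, chunk p0005:L84–L92)] -/
theorem mem_prolateMax_of_ae_eq_alphaPlus (hlam : 0 < lam)
    (hαU : ContDiffOn ℝ (⊤ : ℕ∞) α {x | x ≠ lam ∧ x ≠ -lam}) (heven : ∀ x, α (-x) = α x)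
    (hlog : ∀ x ∈ Icc (3 / 4 * lam) (5 / 4 * lam), α x = Real.log |lam ^ 2 - x ^ 2|)
    (hsupp : ∀ x, 0 ≤ x → α x ≠ 0 → x ∈ Ioo (lam / 2) (3 / 2 * lam)) (αp : L2R)
    (hαp : (αp : ℝ → ℂ) =ᵐ[volume] fun x ↦ (α x : ℂ)) :
    αp ∈ (prolateMax lam).domain := by
  obtain ⟨h, _⟩ := exists_prolateMax_alpha hlam hαU heven hlog hsupp
  have e : αp = (memLp_alpha hlam hαU heven hlog hsupp).toLp _ :=
    Lp.ext (hαp.trans (memLp_alpha hlam hαU heven hlog hsupp).coeFn_toLp.symm)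
  rw [e]; exact h

/-- RH-FREE (PROVED). Sanity link to the corrected Lemma 1.5: its `α`-clauses are exactly the
hypotheses used above, so the first conjunct of `CM22_lemma_1_5_corr` holds for the coordinates
`αp, βp, βm` (indices `0, 2, 3` of the printed octuple). [cite: ConnesMoscovici2022, Lemma 1.5 (= arXiv:2112.05500 Lemma 2.5, chunk p0005:L84–L92)] -/
theorem CM22_lemma_1_5_corr_mem_three (hlam : 0 < lam)
    (hαU : ContDiffOn ℝ (⊤ : ℕ∞) α {x | x ≠ lam ∧ x ≠ -lam}) (heven : ∀ x, α (-x) = α x)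
    (hlog : ∀ x ∈ Icc (3 / 4 * lam) (5 / 4 * lam), α x = Real.log |lam ^ 2 - x ^ 2|)
    (hsupp : ∀ x, 0 ≤ x → α x ≠ 0 → x ∈ Ioo (lam / 2) (3 / 2 * lam)) (αp βp βm : L2R)
    (hαp : (αp : ℝ → ℂ) =ᵐ[volume] fun x ↦ (α x : ℂ))
    (hβp : (βp : ℝ → ℂ) =ᵐ[volume] (Icc (-lam) lam).indicator fun _ ↦ (1 : ℂ))
    (hβm : (βm : ℝ → ℂ) =ᵐ[volume] (Icc (-lam) lam).indicator fun x ↦ (x : ℂ)) :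
    αp ∈ (prolateMax lam).domain ∧ βp ∈ (prolateMax lam).domain ∧
      βm ∈ (prolateMax lam).domain :=
  ⟨mem_prolateMax_of_ae_eq_alphaPlus hlam hαU heven hlog hsupp αp hαp,
    mem_prolateMax_of_ae_eq_betaPlus hlam βp hβp, mem_prolateMax_of_ae_eq_betaMinus hlam βm hβm⟩

/-! ### §5. The odd partner `α₋ = x·α₊` -/

/-- Product rule for `α₋ = x·α` off `±λ`: `(x α)′ = α + x α′`. [folklore] -/
private theorem deriv_alphaMinus (hαU : ContDiffOn ℝ (⊤ : ℕ∞) α {x | x ≠ lam ∧ x ≠ -lam}) {x : ℝ}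
    (hx : x ≠ lam ∧ x ≠ -lam) :
    deriv (fun t : ℝ ↦ (t : ℂ) * (α t : ℂ)) x = (α x : ℂ) + (x : ℂ) * deriv (fun t ↦ (α t : ℂ)) x := by
  have hGtop : ContDiffOn ℝ (⊤ : ℕ∞) (fun t ↦ (α t : ℂ)) {x | x ≠ lam ∧ x ≠ -lam} :=
    Complex.ofRealCLM.contDiff.comp_contDiffOn hαU
  have hGd : HasDerivAt (fun t ↦ (α t : ℂ)) (deriv (fun t ↦ (α t : ℂ)) x) x :=
    ((hGtop.differentiableOn (by simp) x hx).differentiableAt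
      ((isOpen_ne_lam lam).mem_nhds hx)).hasDerivAt
  have h : HasDerivAt (fun t : ℝ ↦ (t : ℂ) * (α t : ℂ))
      (((1 : ℝ) : ℂ) * (α x : ℂ) + (x : ℂ) * deriv (fun t ↦ (α t : ℂ)) x) x :=
    ((hasDerivAt_id' x).ofReal_comp).mul hGd
  rw [h.deriv]; push_cast; ring

/-- On the punctured log window, `p · (α₋ : ℂ)′ = (λ² − x²) log|λ² − x²| − 2x²`.
[cite: ConnesMoscovici2022, proof of Lemma 1.5, "`[α₋, β₋](x) = x² [α₊, β₊](x)`" (= arXiv:2112.05500, chunk p0005:L96–L98)] -/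
theorem pCoeff_mul_deriv_alphaMinus (hαU : ContDiffOn ℝ (⊤ : ℕ∞) α {x | x ≠ lam ∧ x ≠ -lam})
    (heven : ∀ x, α (-x) = α x)
    (hlog : ∀ x ∈ Icc (3 / 4 * lam) (5 / 4 * lam), α x = Real.log |lam ^ 2 - x ^ 2|) {x : ℝ}
    (hw : 3 / 4 * lam < |x| ∧ |x| < 5 / 4 * lam) (hU : x ≠ lam ∧ x ≠ -lam) :
    pCoeff lam x * deriv (fun t : ℝ ↦ (t : ℂ) * (α t : ℂ)) x =
      (((lam ^ 2 - x ^ 2) * Real.log |lam ^ 2 - x ^ 2| - 2 * x ^ 2 : ℝ) : ℂ) := by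
  rw [deriv_alphaMinus hαU hU, mul_add, ← mul_assoc, mul_comm (pCoeff lam x) (x : ℂ), mul_assoc,
    pCoeff_mul_deriv_alpha heven hlog hw hU, pCoeff_mul_alpha heven hlog hw]
  push_cast; ring

/-- RH-FREE (PROVED). Boundary datum of `α₋ = x α` at `a = ±λ`: `p α₋′ → a·(−2a) = −2λ²` (two-sided).
[cite: ConnesMoscovici2022, proof of Lemma 1.5 (= arXiv:2112.05500, chunk p0005:L96–L98)] -/
theorem tendsto_pCoeff_mul_deriv_alphaMinus (hlam : 0 < lam)
    (hαU : ContDiffOn ℝ (⊤ : ℕ∞) α {x | x ≠ lam ∧ x ≠ -lam}) (heven : ∀ x, α (-x) = α x)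
    (hlog : ∀ x ∈ Icc (3 / 4 * lam) (5 / 4 * lam), α x = Real.log |lam ^ 2 - x ^ 2|) {a : ℝ}
    (ha : a = lam ∨ a = -lam) :
    Tendsto (fun x ↦ pCoeff lam x * deriv (fun t : ℝ ↦ (t : ℂ) * (α t : ℂ)) x) (𝓝[≠] a)
      (𝓝 ((a : ℂ) * ((-2 * a : ℝ) : ℂ))) := by
  have hevU : ∀ᶠ x in 𝓝[≠] a, x ≠ lam ∧ x ≠ -lam := by
    rcases ha with rfl | rfl
    · exact eventually_nhdsNE_mem_ne_lam hlam
    · exact eventually_nhdsNE_neg_mem_ne_lam hlam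
  have hx : Tendsto (fun x : ℝ ↦ (x : ℂ)) (𝓝[≠] a) (𝓝 (a : ℂ)) :=
    (Complex.continuous_ofReal.tendsto a).mono_left nhdsWithin_le_nhds
  have h := (tendsto_pCoeff_mul_alpha hlam heven hlog ha).add
    (hx.mul (tendsto_pCoeff_mul_deriv_alpha hlam heven hlog ha))
  rw [zero_add] at h
  refine h.congr' ?_
  filter_upwards [hevU] with x hxU
  rw [deriv_alphaMinus hαU hxU]; ring

/-- RH-FREE (PROVED). `p α₋ → 0` at `±λ`. [cite: ConnesMoscovici2022, proof of Lemma 1.5 (= arXiv:2112.05500, chunk p0005:L96–L98)] -/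
theorem tendsto_pCoeff_mul_alphaMinus (hlam : 0 < lam) (heven : ∀ x, α (-x) = α x)
    (hlog : ∀ x ∈ Icc (3 / 4 * lam) (5 / 4 * lam), α x = Real.log |lam ^ 2 - x ^ 2|) {a : ℝ}
    (ha : a = lam ∨ a = -lam) :
    Tendsto (fun x ↦ pCoeff lam x * ((x : ℂ) * (α x : ℂ))) (𝓝[≠] a) (𝓝 0) := by
  have hx : Tendsto (fun x : ℝ ↦ (x : ℂ)) (𝓝[≠] a) (𝓝 (a : ℂ)) :=
    (Complex.continuous_ofReal.tendsto a).mono_left nhdsWithin_le_nhds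
  have h := hx.mul (tendsto_pCoeff_mul_alpha hlam heven hlog ha)
  rw [mul_zero] at h
  refine h.congr' (Eventually.of_forall fun x ↦ ?_)
  simp only; ring

/-- RH-FREE (PROVED). `α₋ = x α ∈ L²(ℝ)` (`|x| ≤ ³⁄₂λ` on the support). [cite: ConnesMoscovici2022, Lemma 1.5 setting (= arXiv:2112.05500, chunk p0005:L90–L92)] -/
theorem memLp_alphaMinus (hlam : 0 < lam)
    (hαU : ContDiffOn ℝ (⊤ : ℕ∞) α {x | x ≠ lam ∧ x ≠ -lam}) (heven : ∀ x, α (-x) = α x)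
    (hlog : ∀ x ∈ Icc (3 / 4 * lam) (5 / 4 * lam), α x = Real.log |lam ^ 2 - x ^ 2|)
    (hsupp : ∀ x, 0 ≤ x → α x ≠ 0 → x ∈ Ioo (lam / 2) (3 / 2 * lam)) :
    MemLp (fun t : ℝ ↦ (t : ℂ) * (α t : ℂ)) 2 volume := by
  refine (memLp_alpha hlam hαU heven hlog hsupp).of_le_mul (c := 3 / 2 * lam)
    (Complex.continuous_ofReal.aestronglyMeasurable.mul (aestronglyMeasurable_alpha hαU))
    (Eventually.of_forall fun x ↦ ?_)
  rw [norm_mul, Complex.norm_real, Real.norm_eq_abs]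
  by_cases hx : |x| ≤ 3 / 2 * lam
  · exact mul_le_mul_of_nonneg_right hx (norm_nonneg _)
  · rw [alpha_eq_zero_of_le_abs heven hsupp (le_of_not_ge hx)]; simp

/-- RH-FREE (PROVED). `W α₋ ∈ L²(ℝ)`: on the log window `p α₋′ = (λ² − x²)log|λ² − x²| − 2x²`
has derivative `−2x log|λ² − x²| − 6x`, so `W α₋ = 2x log|λ² − x²| + 6x + q x log|λ² − x²|`
there; bounded on the smooth annulus; zero off the support.
[cite: ConnesMoscovici2022, Lemma 1.5 setting and eq. (1.2) (= arXiv:2112.05500, chunk p0005:L90–L98; p0004:L16–L22)] -/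
theorem memLp_W_alphaMinus (hlam : 0 < lam)
    (hαU : ContDiffOn ℝ (⊤ : ℕ∞) α {x | x ≠ lam ∧ x ≠ -lam}) (heven : ∀ x, α (-x) = α x)
    (hlog : ∀ x ∈ Icc (3 / 4 * lam) (5 / 4 * lam), α x = Real.log |lam ^ 2 - x ^ 2|)
    (hsupp : ∀ x, 0 ≤ x → α x ≠ 0 → x ∈ Ioo (lam / 2) (3 / 2 * lam)) :
    MemLp (fun x ↦ -deriv (fun s ↦ pCoeff lam s * deriv (fun t : ℝ ↦ (t : ℂ) * (α t : ℂ)) s) x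
      + qCoeff lam x * ((x : ℂ) * (α x : ℂ))) 2 volume := by
  set U : Set ℝ := {s : ℝ | s ≠ lam ∧ s ≠ -lam} with hU_def
  have hU : IsOpen U := isOpen_ne_lam lam
  set G : ℝ → ℂ := fun t ↦ (t : ℂ) * (α t : ℂ) with hG_def
  set V : ℝ → ℂ := fun s ↦ pCoeff lam s * deriv G s with hV_def
  set WG : ℝ → ℂ := fun x ↦ -deriv V x + qCoeff lam x * G x with hWG_def
  have hmeasG : AEStronglyMeasurable G volume :=
    Complex.continuous_ofReal.aestronglyMeasurable.mul (aestronglyMeasurable_alpha hαU)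
  have hmeas : AEStronglyMeasurable WG volume :=
    ((measurable_deriv V).neg.aestronglyMeasurable).add
      (((continuous_qCoeff_def lam).aestronglyMeasurable).mul hmeasG)
  -- regularity off `±λ`
  have hGtop : ContDiffOn ℝ (⊤ : ℕ∞) G U :=
    (Complex.ofRealCLM.contDiff.comp contDiff_id).contDiffOn.mul
      (Complex.ofRealCLM.contDiff.comp_contDiffOn hαU)
  have h2' : ContDiffOn ℝ 2 G U := hGtop.of_le (WithTop.coe_le_coe.mpr le_top)
  have h2 : ContDiffOn ℝ (1 + 1) G U := by simpa [one_add_one_eq_two] using h2'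
  have hGd' : ContDiffOn ℝ 1 (deriv G) U := h2.deriv_of_isOpen hU le_rfl
  have hV1 : ContDiffOn ℝ 1 V U := ((contDiff_pCoeff_def lam 1).contDiffOn).mul hGd'
  have hV'c : ContinuousOn (deriv V) U := hV1.continuousOn_deriv_of_isOpen hU le_rfl
  have hWGc : ContinuousOn WG U :=
    hV'c.neg.add ((continuous_qCoeff_def lam).continuousOn.mul hGtop.continuousOn)
  -- the zero region
  have hO : IsOpen ({s : ℝ | |s| < lam / 2} ∪ {s : ℝ | 3 / 2 * lam < |s|}) :=
    (isOpen_lt continuous_abs continuous_const).union (isOpen_lt continuous_const continuous_abs)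
  have hGO : ∀ s ∈ ({s : ℝ | |s| < lam / 2} ∪ {s : ℝ | 3 / 2 * lam < |s|}), G s = 0 := by
    rintro s (hs | hs)
    · simp [hG_def, alpha_eq_zero_of_abs_le heven hsupp (le_of_lt hs)]
    · simp [hG_def, alpha_eq_zero_of_le_abs heven hsupp (le_of_lt hs)]
  have hdGO : ∀ s ∈ ({s : ℝ | |s| < lam / 2} ∪ {s : ℝ | 3 / 2 * lam < |s|}), deriv G s = 0 := by
    intro s hs
    have hev : G =ᶠ[𝓝 s] fun _ ↦ (0 : ℂ) :=
      Filter.eventually_of_mem (hO.mem_nhds hs) fun t ht ↦ hGO t ht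
    rw [hev.deriv_eq, deriv_const]
  have hWGO : ∀ s ∈ ({s : ℝ | |s| < lam / 2} ∪ {s : ℝ | 3 / 2 * lam < |s|}), WG s = 0 := by
    intro s hs
    have hev : V =ᶠ[𝓝 s] fun _ ↦ (0 : ℂ) :=
      Filter.eventually_of_mem (hO.mem_nhds hs) fun t ht ↦ by
        simp only [hV_def, hdGO t ht, mul_zero]
    simp only [hWG_def, hev.deriv_eq, deriv_const, hGO s hs]; simp
  -- the log window
  set L : ℝ → ℝ := fun x ↦ Real.log |lam ^ 2 - x ^ 2| with hL
  have hVw : ∀ s, 3 / 4 * lam < |s| ∧ |s| < 5 / 4 * lam → s ∈ U →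
      V s = (((lam ^ 2 - s ^ 2) * L s - 2 * s ^ 2 : ℝ) : ℂ) :=
    fun s hs hsU ↦ pCoeff_mul_deriv_alphaMinus hαU heven hlog hs hsU
  have hdVw : ∀ s, 3 / 4 * lam < |s| ∧ |s| < 5 / 4 * lam → s ∈ U →
      deriv V s = ((-2 * s * L s - 6 * s : ℝ) : ℂ) := by
    intro s hs hsU
    have hne : lam ^ 2 - s ^ 2 ≠ 0 := by
      intro h0
      have : (lam - s) * (lam + s) = 0 := by rw [← h0]; ring
      rcases mul_eq_zero.1 this with h | h
      · exact hsU.1 (by linarith)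
      · exact hsU.2 (by linarith)
    have hev : V =ᶠ[𝓝 s] fun t ↦ (((lam ^ 2 - t ^ 2) * L t - 2 * t ^ 2 : ℝ) : ℂ) :=
      Filter.eventually_of_mem (((isOpen_logWindow lam).inter hU).mem_nhds ⟨hs, hsU⟩)
        fun t ht ↦ hVw t ht.1 ht.2
    have hpr : HasDerivAt (fun t : ℝ ↦ lam ^ 2 - t ^ 2) (-(((2 : ℕ) : ℝ) * s ^ (2 - 1))) s :=
      (hasDerivAt_pow 2 s).const_sub (lam ^ 2)
    have hd := (hpr.mul (hasDerivAt_log_abs_pSq hne)).sub ((hasDerivAt_pow 2 s).const_mul 2)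
    have e : -(((2 : ℕ) : ℝ) * s ^ (2 - 1)) * Real.log |lam ^ 2 - s ^ 2| +
        (lam ^ 2 - s ^ 2) * (-(2 * s) / (lam ^ 2 - s ^ 2)) - 2 * (((2 : ℕ) : ℝ) * s ^ (2 - 1)) =
        -2 * s * L s - 6 * s := by
      rw [show (2 : ℕ) - 1 = 1 from rfl, pow_one, Nat.cast_ofNat, hL]
      field_simp
      ring
    rw [e] at hd
    have hd' : HasDerivAt (fun t ↦ (lam ^ 2 - t ^ 2) * L t - 2 * t ^ 2) (-2 * s * L s - 6 * s) s :=
      hd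
    rw [hev.deriv_eq, hd'.ofReal_comp.deriv]
  have hWGw : ∀ s, 3 / 4 * lam < |s| ∧ |s| < 5 / 4 * lam → s ∈ U →
      WG s = ((2 * s * L s + 6 * s : ℝ) : ℂ) + qCoeff lam s * ((s * L s : ℝ) : ℂ) := by
    intro s hs hsU
    simp only [hWG_def, hdVw s hs hsU, hG_def, alpha_eq_log heven hlog hs.1.le hs.2.le, hL]
    push_cast; ring
  -- the bound
  obtain ⟨M, hM⟩ := (isCompact_smoothAnnulus hlam).exists_bound_of_continuousOn
    (hWGc.mono (smoothAnnulus_subset hlam))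
  set Q : ℝ := (2 * π * lam) ^ 2 * (2 * lam) ^ 2 with hQ
  have hq_le : ∀ x, |x| ≤ 2 * lam → ‖qCoeff lam x‖ ≤ Q := by
    intro x hx
    rw [show qCoeff lam x = (((2 * π * lam) ^ 2 * x ^ 2 : ℝ) : ℂ) from rfl, Complex.norm_real,
      Real.norm_eq_abs, abs_of_nonneg (by positivity), hQ]
    have : x ^ 2 ≤ (2 * lam) ^ 2 := by
      rw [← sq_abs x]; exact pow_le_pow_left₀ (abs_nonneg x) hx 2
    exact mul_le_mul_of_nonneg_left this (by positivity)
  set A : ℝ := 4 * lam + 2 * lam * Q with hA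
  set B : ℝ := 12 * lam with hB
  have hA0 : 0 ≤ A := by positivity
  set b : ℝ → ℝ := fun x ↦ (Icc (-(2 * lam)) (2 * lam)).indicator
    (fun x ↦ M ^ 2 + 2 * B ^ 2 + 2 * A ^ 2 * L x ^ 2) x with hb
  have hbi : Integrable b := by
    have h : IntervalIntegrable (fun x ↦ M ^ 2 + 2 * B ^ 2 + 2 * A ^ 2 * L x ^ 2) volume
        (-(2 * lam)) (2 * lam) :=
      intervalIntegrable_const.add ((intervalIntegrable_log_abs_pSq_sq lam _ _).const_mul _)
    exact ((intervalIntegrable_iff_integrableOn_Icc_of_le (by linarith)).1 h).integrable_indicator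
      measurableSet_Icc
  rw [memLp_two_iff_integrable_sq_norm hmeas]
  refine hbi.mono' (hmeas.norm.aemeasurable.pow_const 2).aestronglyMeasurable ?_
  filter_upwards [ae_mem_ne_lam lam] with x hxU
  rw [norm_pow, norm_norm]
  have hnn : 0 ≤ M ^ 2 + 2 * B ^ 2 + 2 * A ^ 2 * L x ^ 2 := by positivity
  by_cases hx2 : |x| ≤ 2 * lam
  · have hxI : x ∈ Icc (-(2 * lam)) (2 * lam) := abs_le.1 hx2
    simp only [hb, indicator_of_mem hxI]
    rcases lt_or_ge |x| (lam / 2) with h1 | h1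
    · rw [hWGO x (Or.inl h1)]; simpa using hnn
    rcases le_or_gt |x| (3 / 4 * lam) with h2 | h2
    · have hb' := hM x (Or.inl ⟨h1, h2⟩)
      have hM0 : 0 ≤ M := (norm_nonneg _).trans hb'
      nlinarith [norm_nonneg (WG x), sq_nonneg (L x), sq_nonneg A, sq_nonneg B]
    rcases lt_or_ge |x| (5 / 4 * lam) with h3 | h3
    · rw [hWGw x ⟨h2, h3⟩ hxU]
      have hn : ‖((2 * x * L x + 6 * x : ℝ) : ℂ) + qCoeff lam x * ((x * L x : ℝ) : ℂ)‖ ≤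
          A * |L x| + B := by
        refine (norm_add_le _ _).trans ?_
        rw [norm_mul, Complex.norm_real, Complex.norm_real, Real.norm_eq_abs, Real.norm_eq_abs,
          abs_mul, hA, hB]
        have h1' : |2 * x * L x + 6 * x| ≤ 2 * (2 * lam) * |L x| + 6 * (2 * lam) := by
          refine (abs_add_le _ _).trans ?_
          rw [abs_mul, abs_mul, abs_mul, abs_of_pos (by norm_num : (0:ℝ) < 2),
            abs_of_pos (by norm_num : (0:ℝ) < 6)]
          gcongr
        have h2' : ‖qCoeff lam x‖ * (|x| * |L x|) ≤ Q * (2 * lam * |L x|) := by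
          have := hq_le x hx2
          gcongr
        nlinarith [h1', h2', abs_nonneg (L x)]
      have hn0 : 0 ≤ ‖((2 * x * L x + 6 * x : ℝ) : ℂ) + qCoeff lam x * ((x * L x : ℝ) : ℂ)‖ :=
        norm_nonneg _
      calc ‖((2 * x * L x + 6 * x : ℝ) : ℂ) + qCoeff lam x * ((x * L x : ℝ) : ℂ)‖ ^ 2
          ≤ (A * |L x| + B) ^ 2 := pow_le_pow_left₀ hn0 hn 2
        _ ≤ M ^ 2 + 2 * B ^ 2 + 2 * A ^ 2 * L x ^ 2 := by
            nlinarith [sq_nonneg (A * |L x| - B), sq_abs (L x), sq_nonneg M]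
    rcases le_or_gt |x| (3 / 2 * lam) with h4 | h4
    · have hb' := hM x (Or.inr ⟨h3, h4⟩)
      have hM0 : 0 ≤ M := (norm_nonneg _).trans hb'
      nlinarith [norm_nonneg (WG x), sq_nonneg (L x), sq_nonneg A, sq_nonneg B]
    · rw [hWGO x (Or.inr h4)]; simpa using hnn
  · have hxI : x ∉ Icc (-(2 * lam)) (2 * lam) := fun h ↦ hx2 (abs_le.2 h)
    simp only [hb, indicator_of_notMem hxI]
    rw [hWGO x (Or.inr (by rw [not_le] at hx2; simp only [mem_setOf_eq]; linarith))]
    simp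

/-- RH-FREE (PROVED). **The basis vector `α₋ = x α₊` of Lemma 1.5 lies in `dom W_max`**, with
`W_max α₋ = −(p α₋′)′ + q α₋` off `±λ`; boundary data `p α₋′ → −2λ²` (both sides) at `±λ`.
[cite: ConnesMoscovici2022, Lemma 1.5 (= arXiv:2112.05500 Lemma 2.5, chunk p0005:L84–L98)] -/
theorem exists_prolateMax_alphaMinus (hlam : 0 < lam)
    (hαU : ContDiffOn ℝ (⊤ : ℕ∞) α {x | x ≠ lam ∧ x ≠ -lam}) (heven : ∀ x, α (-x) = α x)
    (hlog : ∀ x ∈ Icc (3 / 4 * lam) (5 / 4 * lam), α x = Real.log |lam ^ 2 - x ^ 2|)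
    (hsupp : ∀ x, 0 ≤ x → α x ≠ 0 → x ∈ Ioo (lam / 2) (3 / 2 * lam)) :
    ∃ h : (memLp_alphaMinus hlam hαU heven hlog hsupp).toLp _ ∈ (prolateMax lam).domain,
      prolateMax lam ⟨(memLp_alphaMinus hlam hαU heven hlog hsupp).toLp _, h⟩ =
        (memLp_W_alphaMinus hlam hαU heven hlog hsupp).toLp _ := by
  have hGtop : ContDiffOn ℝ (⊤ : ℕ∞) (fun t : ℝ ↦ (t : ℂ) * (α t : ℂ)) {x | x ≠ lam ∧ x ≠ -lam} :=
    (Complex.ofRealCLM.contDiff.comp contDiff_id).contDiffOn.mul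
      (Complex.ofRealCLM.contDiff.comp_contDiffOn hαU)
  refine exists_prolateMax_eq_of_piecewise hlam (R := 3 / 2 * lam)
    (cp := (lam : ℂ) * ((-2 * lam : ℝ) : ℂ)) (cm := ((-lam : ℝ) : ℂ) * ((-2 * (-lam) : ℝ) : ℂ))
    (hGtop.of_le (WithTop.coe_le_coe.mpr le_top))
    (fun x hx ↦ by simp [alpha_eq_zero_of_le_abs heven hsupp hx]) (fun x _ _ ↦ rfl)
    (memLp_alphaMinus hlam hαU heven hlog hsupp) (memLp_W_alphaMinus hlam hαU heven hlog hsupp)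
    (tendsto_pCoeff_mul_deriv_alphaMinus hlam hαU heven hlog (Or.inl rfl))
    (by
      have := tendsto_pCoeff_mul_deriv_alphaMinus hlam hαU heven hlog (Or.inr rfl)
      simpa using this)
    (tendsto_pCoeff_mul_alphaMinus hlam heven hlog (Or.inl rfl))
    (tendsto_pCoeff_mul_alphaMinus hlam heven hlog (Or.inr rfl))

/-- RH-FREE (PROVED). **`α₋ ∈ dom W_max`**, on the `L²` class exactly as in the clause of
`CM22_lemma_1_5_corr`. [cite: ConnesMoscovici2022, Lemma 1.5 (= arXiv:2112.05500 Lemma 2.5, chunk p0005:L84–L92)] -/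
theorem mem_prolateMax_of_ae_eq_alphaMinus (hlam : 0 < lam)
    (hαU : ContDiffOn ℝ (⊤ : ℕ∞) α {x | x ≠ lam ∧ x ≠ -lam}) (heven : ∀ x, α (-x) = α x)
    (hlog : ∀ x ∈ Icc (3 / 4 * lam) (5 / 4 * lam), α x = Real.log |lam ^ 2 - x ^ 2|)
    (hsupp : ∀ x, 0 ≤ x → α x ≠ 0 → x ∈ Ioo (lam / 2) (3 / 2 * lam)) (αm : L2R)
    (hαm : (αm : ℝ → ℂ) =ᵐ[volume] fun x ↦ (x * α x : ℂ)) :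
    αm ∈ (prolateMax lam).domain := by
  obtain ⟨h, _⟩ := exists_prolateMax_alphaMinus hlam hαU heven hlog hsupp
  have e : αm = (memLp_alphaMinus hlam hαU heven hlog hsupp).toLp _ :=
    Lp.ext (hαm.trans (memLp_alphaMinus hlam hαU heven hlog hsupp).coeFn_toLp.symm)
  rw [e]; exact h

/-- RH-FREE (PROVED). **First conjunct of the corrected Lemma 1.5 for the four formula-vectors**
`α₊, α₋, β₊, β₋` (indices `0–3` of the printed octuple; the Fourier images `4–7` follow from the
`𝔽`-invariance of `dom W_max`, not proved here). [cite: ConnesMoscovici2022, Lemma 1.5 (= arXiv:2112.05500 Lemma 2.5, chunk p0005:L84–L92)] -/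
theorem CM22_lemma_1_5_corr_mem_four (hlam : 0 < lam)
    (hαU : ContDiffOn ℝ (⊤ : ℕ∞) α {x | x ≠ lam ∧ x ≠ -lam}) (heven : ∀ x, α (-x) = α x)
    (hlog : ∀ x ∈ Icc (3 / 4 * lam) (5 / 4 * lam), α x = Real.log |lam ^ 2 - x ^ 2|)
    (hsupp : ∀ x, 0 ≤ x → α x ≠ 0 → x ∈ Ioo (lam / 2) (3 / 2 * lam)) (αp αm βp βm : L2R)
    (hαp : (αp : ℝ → ℂ) =ᵐ[volume] fun x ↦ (α x : ℂ))
    (hαm : (αm : ℝ → ℂ) =ᵐ[volume] fun x ↦ (x * α x : ℂ))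
    (hβp : (βp : ℝ → ℂ) =ᵐ[volume] (Icc (-lam) lam).indicator fun _ ↦ (1 : ℂ))
    (hβm : (βm : ℝ → ℂ) =ᵐ[volume] (Icc (-lam) lam).indicator fun x ↦ (x : ℂ)) :
    αp ∈ (prolateMax lam).domain ∧ αm ∈ (prolateMax lam).domain ∧
      βp ∈ (prolateMax lam).domain ∧ βm ∈ (prolateMax lam).domain :=
  ⟨mem_prolateMax_of_ae_eq_alphaPlus hlam hαU heven hlog hsupp αp hαp,
    mem_prolateMax_of_ae_eq_alphaMinus hlam hαU heven hlog hsupp αm hαm,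
    mem_prolateMax_of_ae_eq_betaPlus hlam βp hβp, mem_prolateMax_of_ae_eq_betaMinus hlam βm hβm⟩

end Alpha

/-! ## §6. The `Ω`-pairing of a piecewise-`C²` vector against a cutoff `1_{[−λ,λ]}·f`

`iΩ(ξ, η) = [ξ, η̄]|_{−λ}^{λ} + …` (eq. (1.7)): for `η = 1_I f` only the middle piece survives and
the brackets at `±λ` are `f(±λ)·\overline{(p ξ′)(±λ)}`. -/

section OmegaCutoff

variable {lam : ℝ}

/-- Green's identity on a compact piece `[x, y]` avoiding `±λ`, for a `C²` test function `θ`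
(not necessarily Schwartz) and a piecewise-`C²` `g`: `∫_x^y ((Wθ) g − θ (Wg)) = [θ (p g′) − p θ′ g]_x^y`.
[cite: ConnesMoscovici2022, §1 eqs. (1.5)–(1.7) (= arXiv:2112.05500 (2.5)–(2.7), chunk p0005:L24–L38)] -/
theorem intervalIntegral_green_piece' (lam : ℝ) {x y : ℝ} (hxy : x ≤ y)
    (hsub : Icc x y ⊆ {s : ℝ | s ≠ lam ∧ s ≠ -lam}) {g Wg : ℝ → ℂ}
    (hg : ContDiffOn ℝ 2 g {s : ℝ | s ≠ lam ∧ s ≠ -lam})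
    (hWg : ∀ s, s ≠ lam → s ≠ -lam →
      Wg s = -deriv (fun t ↦ pCoeff lam t * deriv g t) s + qCoeff lam s * g s)
    {θ : ℝ → ℂ} (hθ : ContDiff ℝ 2 θ) :
    ∫ t in x..y, ((-deriv (fun s ↦ pCoeff lam s * deriv θ s) t + qCoeff lam t * θ t) * g t
        - θ t * Wg t) =
      (θ y * (pCoeff lam y * deriv g y) - pCoeff lam y * deriv θ y * g y) -
        (θ x * (pCoeff lam x * deriv g x) - pCoeff lam x * deriv θ x * g x) := by
  set U : Set ℝ := {s : ℝ | s ≠ lam ∧ s ≠ -lam} with hU_def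
  have hU : IsOpen U := isOpen_ne_lam lam
  have h2 : ContDiffOn ℝ (1 + 1) g U := by simpa [one_add_one_eq_two] using hg
  have hg1 : ContDiffOn ℝ 1 g U := h2.of_succ
  have hgd' : ContDiffOn ℝ 1 (deriv g) U := h2.deriv_of_isOpen hU le_rfl
  set v : ℝ → ℂ := fun t ↦ pCoeff lam t * deriv g t with hv_def
  have hv1 : ContDiffOn ℝ 1 v U := ((contDiff_pCoeff_def lam 1).contDiffOn).mul hgd'
  have hvd : ∀ s ∈ U, HasDerivAt v (deriv v s) s := fun s hs ↦
    ((hv1.differentiableOn one_ne_zero s hs).differentiableAt (hU.mem_nhds hs)).hasDerivAt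
  have hv'c : ContinuousOn (deriv v) U := hv1.continuousOn_deriv_of_isOpen hU le_rfl
  have hIcc : uIcc x y = Icc x y := uIcc_of_le hxy
  have hF : ∀ s ∈ Icc x y, pCoeff lam s * deriv g s - pCoeff lam x * deriv g x =
      ∫ t in x..s, deriv v t := by
    intro s hs
    have hsub' : uIcc x s ⊆ Icc x y := by
      rw [uIcc_of_le hs.1]; exact Icc_subset_Icc_right hs.2
    rw [intervalIntegral.integral_eq_sub_of_hasDerivAt (fun t ht ↦ hvd t (hsub (hsub' ht)))
      (((hv'c.mono (hsub.trans' hsub')).mono (by rw [uIcc_of_le hs.1])).intervalIntegrable_of_Icc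
        hs.1)]
  have hf : IntervalIntegrable (deriv v) volume x y :=
    ((hv'c.mono hsub)).intervalIntegrable_of_Icc hxy
  have hgreen := intervalIntegral_green_of_contDiffOn lam hxy hU hsub hθ hg1 hF hf
  rw [← hgreen]
  refine intervalIntegral.integral_congr fun t ht ↦ ?_
  rw [hIcc] at ht
  have htU := hsub ht
  show _ - θ t * Wg t = _
  rw [hWg t htU.1 htU.2]
  ring

/-- The inner product of two `L²` classes given by functions, the second cut off to `[−λ, λ]`,
as an integral over `[−λ, λ]`. [folklore] -/
private theorem inner_toLp_indicator {u f : ℝ → ℂ} (hu : MemLp u 2 volume)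
    (hβ : MemLp (fun x ↦ (Icc (-lam) lam).indicator f x) 2 volume) :
    ⟪(hu.toLp u : L2R), (hβ.toLp _ : L2R)⟫_ℂ =
      ∫ x in Icc (-lam) lam, (starRingEnd ℂ) (u x) * f x := by
  rw [L2.inner_def, ← MeasureTheory.integral_indicator measurableSet_Icc]
  refine integral_congr_ae ?_
  filter_upwards [hu.coeFn_toLp, hβ.coeFn_toLp] with x hx hβx
  rw [hx, hβx, RCLike.inner_apply]
  by_cases hxI : x ∈ Icc (-lam) lam
  · simp [indicator_of_mem hxI, mul_comm]
  · simp [indicator_of_notMem hxI]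

/-- RH-FREE (PROVED). **`Ω` against a cutoff, in boundary terms.**  For a piecewise-`C²` vector
`g ∈ dom W_max` with boundary data `p g′ → c₊` at `λ`, `→ c₋` at `−λ` (two-sided), `p g → 0`,
and `β_f = 1_{[−λ,λ]}·f` (`f ∈ C²`):
`Ω(g, β_f) = i·(f(λ)·c̄₊ − f(−λ)·c̄₋)` — eq. (1.7) with only the middle piece contributing, the
brackets `[ξ, η̄] = p(ξ η̄′ − η̄ ξ′)` evaluated as lateral limits.
[cite: ConnesMoscovici2022, §1 eq. (1.7) and proof of Lemma 1.5 (= arXiv:2112.05500 (2.7), chunk p0005:L31–L38; Lemma 2.5 proof L94–L98)] -/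
theorem omegaForm_piecewise_indicator (hlam : 0 < lam) {g Wg : ℝ → ℂ} {R : ℝ} {cp cm : ℂ}
    (hg : ContDiffOn ℝ 2 g {x : ℝ | x ≠ lam ∧ x ≠ -lam})
    (hgR : ∀ x, R ≤ |x| → g x = 0)
    (hWg : ∀ x, x ≠ lam → x ≠ -lam →
      Wg x = -deriv (fun s ↦ pCoeff lam s * deriv g s) x + qCoeff lam x * g x)
    (hg2 : MemLp g 2 volume) (hWg2 : MemLp Wg 2 volume)
    (hvp : Tendsto (fun x ↦ pCoeff lam x * deriv g x) (𝓝[≠] lam) (𝓝 cp))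
    (hvm : Tendsto (fun x ↦ pCoeff lam x * deriv g x) (𝓝[≠] (-lam)) (𝓝 cm))
    (hgp : Tendsto (fun x ↦ pCoeff lam x * g x) (𝓝[≠] lam) (𝓝 0))
    (hgm : Tendsto (fun x ↦ pCoeff lam x * g x) (𝓝[≠] (-lam)) (𝓝 0))
    {f : ℝ → ℂ} (hf : ContDiff ℝ 2 f)
    (hβ : MemLp (fun x ↦ (Icc (-lam) lam).indicator f x) 2 volume)
    (hG : hg2.toLp g ∈ (prolateMax lam).domain) (hB : hβ.toLp _ ∈ (prolateMax lam).domain) :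
    omegaForm lam ⟨hg2.toLp g, hG⟩ ⟨hβ.toLp _, hB⟩ =
      I * (f lam * (starRingEnd ℂ) cp - f (-lam) * (starRingEnd ℂ) cm) := by
  set U : Set ℝ := {s : ℝ | s ≠ lam ∧ s ≠ -lam} with hU_def
  have hU : IsOpen U := isOpen_ne_lam lam
  -- the two `W_max` images
  obtain ⟨hG', hWG⟩ := exists_prolateMax_eq_of_piecewise hlam hg hgR hWg hg2 hWg2 hvp hvm hgp hgm
  obtain ⟨hβ', hWβ, hB', hWB⟩ := exists_prolateMax_indicator_mul hlam hf
  set Wf : ℝ → ℂ := fun y ↦ -deriv (fun s ↦ pCoeff lam s * deriv f s) y + qCoeff lam y * f y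
    with hWf_def
  have e1 : prolateMax lam ⟨hg2.toLp g, hG⟩ = hWg2.toLp Wg := hWG
  have e2 : prolateMax lam ⟨hβ.toLp _, hB⟩ = hWβ.toLp _ := hWB
  -- conjugate data: `ḡ = conj ∘ g`
  set gc : ℝ → ℂ := fun t ↦ (starRingEnd ℂ) (g t) with hgc_def
  set Wgc : ℝ → ℂ := fun t ↦ (starRingEnd ℂ) (Wg t) with hWgc_def
  have hconjC : ContDiff ℝ 2 (fun z : ℂ ↦ (starRingEnd ℂ) z) := Complex.conjCLE.contDiff
  have hgc : ContDiffOn ℝ 2 gc U := hconjC.comp_contDiffOn hg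
  have h2g : ContDiffOn ℝ (1 + 1) g U := by simpa [one_add_one_eq_two] using hg
  have hgdiff : ∀ s ∈ U, HasDerivAt g (deriv g s) s := fun s hs ↦
    ((h2g.differentiableOn (by simp) s hs).differentiableAt (hU.mem_nhds hs)).hasDerivAt
  have hdgc : ∀ s ∈ U, deriv gc s = (starRingEnd ℂ) (deriv g s) := by
    intro s hs
    have := (hgdiff s hs).star
    rw [hgc_def]
    exact this.deriv
  set v : ℝ → ℂ := fun t ↦ pCoeff lam t * deriv g t with hv_def
  set vc : ℝ → ℂ := fun t ↦ pCoeff lam t * deriv gc t with hvc_def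
  have hpreal : ∀ t, (starRingEnd ℂ) (pCoeff lam t) = pCoeff lam t := fun t ↦ by
    rw [show pCoeff lam t = ((lam ^ 2 - t ^ 2 : ℝ) : ℂ) from rfl, Complex.conj_ofReal]
  have hqreal : ∀ t, (starRingEnd ℂ) (qCoeff lam t) = qCoeff lam t := fun t ↦ by
    rw [show qCoeff lam t = (((2 * π * lam) ^ 2 * t ^ 2 : ℝ) : ℂ) from rfl, Complex.conj_ofReal]
  have hvc_eq : ∀ s ∈ U, vc s = (starRingEnd ℂ) (v s) := by
    intro s hs
    simp only [hvc_def, hv_def, hdgc s hs, map_mul, hpreal]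
  have hgd' : ContDiffOn ℝ 1 (deriv g) U := h2g.deriv_of_isOpen hU le_rfl
  have hv1 : ContDiffOn ℝ 1 v U := ((contDiff_pCoeff_def lam 1).contDiffOn).mul hgd'
  have hvdiff : ∀ s ∈ U, HasDerivAt v (deriv v s) s := fun s hs ↦
    ((hv1.differentiableOn one_ne_zero s hs).differentiableAt (hU.mem_nhds hs)).hasDerivAt
  have hdvc : ∀ s ∈ U, deriv vc s = (starRingEnd ℂ) (deriv v s) := by
    intro s hs
    have hev : vc =ᶠ[𝓝 s] fun t ↦ (starRingEnd ℂ) (v t) :=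
      Filter.eventually_of_mem (hU.mem_nhds hs) fun t ht ↦ hvc_eq t ht
    rw [hev.deriv_eq]
    exact ((hvdiff s hs).star).deriv
  have hWgc : ∀ s, s ≠ lam → s ≠ -lam →
      Wgc s = -deriv (fun t ↦ pCoeff lam t * deriv gc t) s + qCoeff lam s * gc s := by
    intro s h1 h2
    have hdv := hdvc s ⟨h1, h2⟩
    simp only [hvc_def] at hdv
    rw [hdv, hWgc_def, hgc_def]
    simp only [hWg s h1 h2, map_add, map_neg, map_mul, hqreal]
  -- boundary limits for the conjugate data
  have hevU : ∀ a, a = lam ∨ a = -lam → ∀ᶠ x in 𝓝[≠] a, x ∈ U := by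
    rintro a (rfl | rfl)
    · exact eventually_nhdsNE_mem_ne_lam hlam
    · exact eventually_nhdsNE_neg_mem_ne_lam hlam
  have hvc_lim : ∀ a c, a = lam ∨ a = -lam → Tendsto v (𝓝[≠] a) (𝓝 c) →
      Tendsto (fun x ↦ pCoeff lam x * deriv gc x) (𝓝[≠] a) (𝓝 ((starRingEnd ℂ) c)) := by
    intro a c ha hv
    have h := (Complex.continuous_conj.tendsto c).comp hv
    refine h.congr' ?_
    filter_upwards [hevU a ha] with x hx
    exact (hvc_eq x hx).symm
  have hgc_lim : ∀ a, Tendsto (fun x ↦ pCoeff lam x * g x) (𝓝[≠] a) (𝓝 0) →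
      Tendsto (fun x ↦ pCoeff lam x * gc x) (𝓝[≠] a) (𝓝 0) := by
    intro a h0
    have h := (Complex.continuous_conj.tendsto 0).comp h0
    rw [map_zero] at h
    refine h.congr' (Eventually.of_forall fun x ↦ ?_)
    simp only [Function.comp_apply, map_mul, hpreal, hgc_def]
  -- the inner products as integrals over `[−λ, λ]`
  have hi1 : ⟪(hWg2.toLp Wg : L2R), (hβ.toLp _ : L2R)⟫_ℂ =
      ∫ x in Icc (-lam) lam, Wgc x * f x := inner_toLp_indicator hWg2 hβ
  have hi2 : ⟪(hg2.toLp g : L2R), (hWβ.toLp _ : L2R)⟫_ℂ =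
      ∫ x in Icc (-lam) lam, gc x * Wf x := inner_toLp_indicator hg2 hWβ
  -- integrability on `[−λ, λ]`
  haveI : IsFiniteMeasure ((volume : Measure ℝ).restrict (Icc (-lam) lam)) :=
    ⟨by rw [Measure.restrict_apply_univ]; exact measure_Icc_lt_top⟩
  have hWgI : IntegrableOn Wg (Icc (-lam) lam) := (hWg2.restrict _).integrable one_le_two
  have hgI : IntegrableOn g (Icc (-lam) lam) := (hg2.restrict _).integrable one_le_two
  have hWfc : Continuous Wf := by
    have h2f : ContDiff ℝ (1 + 1) f := by simpa [one_add_one_eq_two] using hf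
    have hf'1 : ContDiff ℝ 1 (deriv f) := (contDiff_succ_iff_deriv.mp h2f).2.2
    exact (((contDiff_pCoeff_def lam 1).mul hf'1).continuous_deriv le_rfl).neg.add
      ((continuous_qCoeff_def lam).mul hf.continuous)
  obtain ⟨Cf, hCf⟩ := isCompact_Icc.exists_bound_of_continuousOn
    (hf.continuous.continuousOn (s := Icc (-lam) lam))
  obtain ⟨CW, hCW⟩ := isCompact_Icc.exists_bound_of_continuousOn
    (hWfc.continuousOn (s := Icc (-lam) lam))
  have hI1 : IntegrableOn (fun x ↦ Wgc x * f x) (Icc (-lam) lam) := by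
    refine Integrable.mono' (hWgI.norm.mul_const Cf)
      ((Complex.continuous_conj.comp_aestronglyMeasurable hWgI.aestronglyMeasurable).mul
        hf.continuous.aestronglyMeasurable) ?_
    filter_upwards [ae_restrict_mem measurableSet_Icc] with x hx
    rw [norm_mul, hWgc_def, Complex.norm_conj]
    exact mul_le_mul_of_nonneg_left (hCf x hx) (norm_nonneg _)
  have hI2 : IntegrableOn (fun x ↦ gc x * Wf x) (Icc (-lam) lam) := by
    refine Integrable.mono' (hgI.norm.mul_const CW)
      ((Complex.continuous_conj.comp_aestronglyMeasurable hgI.aestronglyMeasurable).mul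
        hWfc.aestronglyMeasurable) ?_
    filter_upwards [ae_restrict_mem measurableSet_Icc] with x hx
    rw [norm_mul, hgc_def, Complex.norm_conj]
    exact mul_le_mul_of_nonneg_left (hCW x hx) (norm_nonneg _)
  -- Green on the middle piece for the pair `(f, ḡ)`
  set F : ℝ → ℂ := fun t ↦ (Wf t * gc t - f t * Wgc t) with hF_def
  set Bf : ℝ → ℂ := fun s ↦ f s * (pCoeff lam s * deriv gc s) - pCoeff lam s * deriv f s * gc s
    with hBf_def
  have hFi : IntervalIntegrable F volume (-lam) lam := by
    rw [intervalIntegrable_iff_integrableOn_Icc_of_le (by linarith)]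
    have h := (hI2.congr_fun (fun x _ ↦ mul_comm (gc x) (Wf x)) measurableSet_Icc).sub
      (hI1.congr_fun (fun x _ ↦ mul_comm (Wgc x) (f x)) measurableSet_Icc)
    exact h
  have hId : ∀ x ∈ Ioo (-lam) lam, ∀ y ∈ Ioo (-lam) lam, x ≤ y →
      ∫ t in x..y, F t = Bf y - Bf x := by
    intro x hx y hy hxy
    have hsub : Icc x y ⊆ U := fun s hs ↦
      ⟨(hs.2.trans_lt hy.2).ne, ((hx.1.trans_le hs.1)).ne'⟩
    have := intervalIntegral_green_piece' lam hxy hsub hgc hWgc hf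
    simpa only [hF_def, hBf_def, hWf_def] using this
  have hBlim : ∀ a c, a = lam ∨ a = -lam → Tendsto v (𝓝[≠] a) (𝓝 c) →
      Tendsto (fun x ↦ pCoeff lam x * g x) (𝓝[≠] a) (𝓝 0) →
      Tendsto Bf (𝓝[≠] a) (𝓝 (f a * (starRingEnd ℂ) c)) := by
    intro a c ha hv hg0
    have hθc : Tendsto f (𝓝[≠] a) (𝓝 (f a)) :=
      ((hf.continuous.tendsto a).mono_left nhdsWithin_le_nhds)
    have hθ'c : Tendsto (deriv f) (𝓝[≠] a) (𝓝 (deriv f a)) :=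
      (((hf.continuous_deriv (by norm_num)).tendsto a).mono_left nhdsWithin_le_nhds)
    have h := (hθc.mul (hvc_lim a c ha hv)).sub (hθ'c.mul (hgc_lim a hg0))
    rw [mul_zero, sub_zero] at h
    refine h.congr' (Eventually.of_forall fun s ↦ ?_)
    simp only [hBf_def]; ring
  have hmid : ∫ t in (-lam)..lam, F t =
      f lam * (starRingEnd ℂ) cp - f (-lam) * (starRingEnd ℂ) cm := by
    refine intervalIntegral_eq_sub_of_boundary_tendsto (by linarith) hFi hId ?_ ?_
    · exact (hBlim (-lam) cm (Or.inr rfl) hvm hgm).mono_left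
        (nhdsWithin_mono _ fun s hs ↦ ne_of_gt hs)
    · exact (hBlim lam cp (Or.inl rfl) hvp hgp).mono_left
        (nhdsWithin_mono _ fun s hs ↦ ne_of_lt hs)
  -- assemble
  have hdiff : ⟪(hWg2.toLp Wg : L2R), (hβ.toLp _ : L2R)⟫_ℂ -
      ⟪(hg2.toLp g : L2R), (hWβ.toLp _ : L2R)⟫_ℂ = -(∫ t in (-lam)..lam, F t) := by
    rw [hi1, hi2, ← integral_sub hI1 hI2, intervalIntegral.integral_of_le (by linarith),
      integral_Icc_eq_integral_Ioc, ← MeasureTheory.integral_neg]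
    refine setIntegral_congr_fun measurableSet_Ioc fun x _ ↦ ?_
    simp only [hF_def]; ring
  unfold omegaForm
  rw [e1, e2, hdiff, hmid]
  ring

/-! ### The `{α±} × {β±}` block of the `Ω`-matrix of Lemma 1.5 -/

section OmegaMatrix

variable {α : ℝ → ℝ}

/-- RH-FREE (PROVED). **`Ω(α₊, β₊) = −4λ·i ≠ 0`** — the non-zero entry pairing the log
singularity of `α₊` with the jump of `β₊ = 1_I` ("the matrix representation of `Ω₊` … has a single
nonzero entry in each row and column"; `[α₊, β̄₊]` jumps by `(pα₊′)(λ⁻) − (pα₊′)(−λ⁺) = −4λ`).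
[cite: ConnesMoscovici2022, proof of Lemma 1.5 (= arXiv:2112.05500 Lemma 2.5, chunk p0005:L94–L96)] -/
theorem omegaForm_alphaPlus_betaPlus {lam : ℝ} (hlam : 0 < lam)
    (hαU : ContDiffOn ℝ (⊤ : ℕ∞) α {x | x ≠ lam ∧ x ≠ -lam}) (heven : ∀ x, α (-x) = α x)
    (hlog : ∀ x ∈ Icc (3 / 4 * lam) (5 / 4 * lam), α x = Real.log |lam ^ 2 - x ^ 2|)
    (hsupp : ∀ x, 0 ≤ x → α x ≠ 0 → x ∈ Ioo (lam / 2) (3 / 2 * lam)) (αp βp : L2R)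
    (hαp : (αp : ℝ → ℂ) =ᵐ[volume] fun x ↦ (α x : ℂ))
    (hβp : (βp : ℝ → ℂ) =ᵐ[volume] (Icc (-lam) lam).indicator fun _ ↦ (1 : ℂ))
    (hα : αp ∈ (prolateMax lam).domain) (hβ : βp ∈ (prolateMax lam).domain) :
    omegaForm lam ⟨αp, hα⟩ ⟨βp, hβ⟩ = -(4 * lam) * I := by
  have hβ2 : MemLp (fun x ↦ (Icc (-lam) lam).indicator (fun _ : ℝ ↦ (1 : ℂ)) x) 2 volume :=
    memLp_indicator_mul_of_continuous continuous_const lam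
  have eα : αp = (memLp_alpha hlam hαU heven hlog hsupp).toLp _ :=
    Lp.ext (hαp.trans (memLp_alpha hlam hαU heven hlog hsupp).coeFn_toLp.symm)
  have eβ : βp = hβ2.toLp _ := Lp.ext (hβp.trans hβ2.coeFn_toLp.symm)
  have hα' : (memLp_alpha hlam hαU heven hlog hsupp).toLp _ ∈ (prolateMax lam).domain := eα ▸ hα
  have hβ' : hβ2.toLp _ ∈ (prolateMax lam).domain := eβ ▸ hβ
  have e1 : (⟨αp, hα⟩ : (prolateMax lam).domain) =
      ⟨(memLp_alpha hlam hαU heven hlog hsupp).toLp _, hα'⟩ := Subtype.ext eα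
  have e2 : (⟨βp, hβ⟩ : (prolateMax lam).domain) = ⟨hβ2.toLp _, hβ'⟩ := Subtype.ext eβ
  have hGtop : ContDiffOn ℝ (⊤ : ℕ∞) (fun t ↦ (α t : ℂ)) {x | x ≠ lam ∧ x ≠ -lam} :=
    Complex.ofRealCLM.contDiff.comp_contDiffOn hαU
  rw [e1, e2, omegaForm_piecewise_indicator hlam (R := 3 / 2 * lam)
    (cp := ((-2 * lam : ℝ) : ℂ)) (cm := ((-2 * (-lam) : ℝ) : ℂ))
    (hGtop.of_le (WithTop.coe_le_coe.mpr le_top))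
    (fun x hx ↦ by simp [alpha_eq_zero_of_le_abs heven hsupp hx]) (fun x _ _ ↦ rfl)
    (memLp_alpha hlam hαU heven hlog hsupp) (memLp_W_alpha hlam hαU heven hlog hsupp)
    (tendsto_pCoeff_mul_deriv_alpha hlam heven hlog (Or.inl rfl))
    (tendsto_pCoeff_mul_deriv_alpha hlam heven hlog (Or.inr rfl))
    (tendsto_pCoeff_mul_alpha hlam heven hlog (Or.inl rfl))
    (tendsto_pCoeff_mul_alpha hlam heven hlog (Or.inr rfl)) contDiff_const hβ2 hα' hβ']
  simp only [Complex.conj_ofReal]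
  push_cast
  ring

/-- RH-FREE (PROVED). **`Ω(α₋, β₋) = −4λ³·i ≠ 0`** (odd sector: "`[α₋, β₋](x) = x²[α₊, β₊](x)`").
[cite: ConnesMoscovici2022, proof of Lemma 1.5 (= arXiv:2112.05500 Lemma 2.5, chunk p0005:L96–L98)] -/
theorem omegaForm_alphaMinus_betaMinus {lam : ℝ} (hlam : 0 < lam)
    (hαU : ContDiffOn ℝ (⊤ : ℕ∞) α {x | x ≠ lam ∧ x ≠ -lam}) (heven : ∀ x, α (-x) = α x)
    (hlog : ∀ x ∈ Icc (3 / 4 * lam) (5 / 4 * lam), α x = Real.log |lam ^ 2 - x ^ 2|)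
    (hsupp : ∀ x, 0 ≤ x → α x ≠ 0 → x ∈ Ioo (lam / 2) (3 / 2 * lam)) (αm βm : L2R)
    (hαm : (αm : ℝ → ℂ) =ᵐ[volume] fun x ↦ (x * α x : ℂ))
    (hβm : (βm : ℝ → ℂ) =ᵐ[volume] (Icc (-lam) lam).indicator fun x ↦ (x : ℂ))
    (hα : αm ∈ (prolateMax lam).domain) (hβ : βm ∈ (prolateMax lam).domain) :
    omegaForm lam ⟨αm, hα⟩ ⟨βm, hβ⟩ = -(4 * lam ^ 3) * I := by
  have hβ2 : MemLp (fun x ↦ (Icc (-lam) lam).indicator (fun x : ℝ ↦ (x : ℂ)) x) 2 volume :=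
    memLp_indicator_mul_of_continuous Complex.continuous_ofReal lam
  have eα : αm = (memLp_alphaMinus hlam hαU heven hlog hsupp).toLp _ :=
    Lp.ext (hαm.trans (memLp_alphaMinus hlam hαU heven hlog hsupp).coeFn_toLp.symm)
  have eβ : βm = hβ2.toLp _ := Lp.ext (hβm.trans hβ2.coeFn_toLp.symm)
  have hα' : (memLp_alphaMinus hlam hαU heven hlog hsupp).toLp _ ∈ (prolateMax lam).domain :=
    eα ▸ hα
  have hβ' : hβ2.toLp _ ∈ (prolateMax lam).domain := eβ ▸ hβ
  have e1 : (⟨αm, hα⟩ : (prolateMax lam).domain) =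
      ⟨(memLp_alphaMinus hlam hαU heven hlog hsupp).toLp _, hα'⟩ := Subtype.ext eα
  have e2 : (⟨βm, hβ⟩ : (prolateMax lam).domain) = ⟨hβ2.toLp _, hβ'⟩ := Subtype.ext eβ
  have hGtop : ContDiffOn ℝ (⊤ : ℕ∞) (fun t : ℝ ↦ (t : ℂ) * (α t : ℂ)) {x | x ≠ lam ∧ x ≠ -lam} :=
    (Complex.ofRealCLM.contDiff.comp contDiff_id).contDiffOn.mul
      (Complex.ofRealCLM.contDiff.comp_contDiffOn hαU)
  rw [e1, e2, omegaForm_piecewise_indicator hlam (R := 3 / 2 * lam)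
    (cp := (lam : ℂ) * ((-2 * lam : ℝ) : ℂ)) (cm := ((-lam : ℝ) : ℂ) * ((-2 * (-lam) : ℝ) : ℂ)) (f := fun x : ℝ ↦ (x : ℂ))
    (hGtop.of_le (WithTop.coe_le_coe.mpr le_top))
    (fun x hx ↦ by simp [alpha_eq_zero_of_le_abs heven hsupp hx]) (fun x _ _ ↦ rfl)
    (memLp_alphaMinus hlam hαU heven hlog hsupp) (memLp_W_alphaMinus hlam hαU heven hlog hsupp)
    (tendsto_pCoeff_mul_deriv_alphaMinus hlam hαU heven hlog (Or.inl rfl))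
    (by
      have := tendsto_pCoeff_mul_deriv_alphaMinus hlam hαU heven hlog (Or.inr rfl)
      simpa using this)
    (tendsto_pCoeff_mul_alphaMinus hlam heven hlog (Or.inl rfl))
    (tendsto_pCoeff_mul_alphaMinus hlam heven hlog (Or.inr rfl)) Complex.ofRealCLM.contDiff
    hβ2 hα' hβ']
  simp only [Complex.conj_ofReal, map_mul]
  push_cast
  ring

/-- RH-FREE (PROVED). **`Ω(α₊, β₋) = 0`** (even against odd: the two boundary contributions cancel).
[cite: ConnesMoscovici2022, proof of Lemma 1.5 and the parity splitting `Ω = Ω₊ ⊕ Ω₋` (= arXiv:2112.05500, chunk p0005:L40–L44, L94–L98)] -/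
theorem omegaForm_alphaPlus_betaMinus {lam : ℝ} (hlam : 0 < lam)
    (hαU : ContDiffOn ℝ (⊤ : ℕ∞) α {x | x ≠ lam ∧ x ≠ -lam}) (heven : ∀ x, α (-x) = α x)
    (hlog : ∀ x ∈ Icc (3 / 4 * lam) (5 / 4 * lam), α x = Real.log |lam ^ 2 - x ^ 2|)
    (hsupp : ∀ x, 0 ≤ x → α x ≠ 0 → x ∈ Ioo (lam / 2) (3 / 2 * lam)) (αp βm : L2R)
    (hαp : (αp : ℝ → ℂ) =ᵐ[volume] fun x ↦ (α x : ℂ))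
    (hβm : (βm : ℝ → ℂ) =ᵐ[volume] (Icc (-lam) lam).indicator fun x ↦ (x : ℂ))
    (hα : αp ∈ (prolateMax lam).domain) (hβ : βm ∈ (prolateMax lam).domain) :
    omegaForm lam ⟨αp, hα⟩ ⟨βm, hβ⟩ = 0 := by
  have hβ2 : MemLp (fun x ↦ (Icc (-lam) lam).indicator (fun x : ℝ ↦ (x : ℂ)) x) 2 volume :=
    memLp_indicator_mul_of_continuous Complex.continuous_ofReal lam
  have eα : αp = (memLp_alpha hlam hαU heven hlog hsupp).toLp _ :=
    Lp.ext (hαp.trans (memLp_alpha hlam hαU heven hlog hsupp).coeFn_toLp.symm)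
  have eβ : βm = hβ2.toLp _ := Lp.ext (hβm.trans hβ2.coeFn_toLp.symm)
  have hα' : (memLp_alpha hlam hαU heven hlog hsupp).toLp _ ∈ (prolateMax lam).domain := eα ▸ hα
  have hβ' : hβ2.toLp _ ∈ (prolateMax lam).domain := eβ ▸ hβ
  have e1 : (⟨αp, hα⟩ : (prolateMax lam).domain) =
      ⟨(memLp_alpha hlam hαU heven hlog hsupp).toLp _, hα'⟩ := Subtype.ext eα
  have e2 : (⟨βm, hβ⟩ : (prolateMax lam).domain) = ⟨hβ2.toLp _, hβ'⟩ := Subtype.ext eβ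
  have hGtop : ContDiffOn ℝ (⊤ : ℕ∞) (fun t ↦ (α t : ℂ)) {x | x ≠ lam ∧ x ≠ -lam} :=
    Complex.ofRealCLM.contDiff.comp_contDiffOn hαU
  rw [e1, e2, omegaForm_piecewise_indicator hlam (R := 3 / 2 * lam)
    (cp := ((-2 * lam : ℝ) : ℂ)) (cm := ((-2 * (-lam) : ℝ) : ℂ)) (f := fun x : ℝ ↦ (x : ℂ))
    (hGtop.of_le (WithTop.coe_le_coe.mpr le_top))
    (fun x hx ↦ by simp [alpha_eq_zero_of_le_abs heven hsupp hx]) (fun x _ _ ↦ rfl)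
    (memLp_alpha hlam hαU heven hlog hsupp) (memLp_W_alpha hlam hαU heven hlog hsupp)
    (tendsto_pCoeff_mul_deriv_alpha hlam heven hlog (Or.inl rfl))
    (tendsto_pCoeff_mul_deriv_alpha hlam heven hlog (Or.inr rfl))
    (tendsto_pCoeff_mul_alpha hlam heven hlog (Or.inl rfl))
    (tendsto_pCoeff_mul_alpha hlam heven hlog (Or.inr rfl)) Complex.ofRealCLM.contDiff
    hβ2 hα' hβ']
  simp only [Complex.conj_ofReal]
  push_cast
  ring

/-- RH-FREE (PROVED). **`Ω(α₋, β₊) = 0`** (odd against even).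
[cite: ConnesMoscovici2022, proof of Lemma 1.5 and the parity splitting `Ω = Ω₊ ⊕ Ω₋` (= arXiv:2112.05500, chunk p0005:L40–L44, L94–L98)] -/
theorem omegaForm_alphaMinus_betaPlus {lam : ℝ} (hlam : 0 < lam)
    (hαU : ContDiffOn ℝ (⊤ : ℕ∞) α {x | x ≠ lam ∧ x ≠ -lam}) (heven : ∀ x, α (-x) = α x)
    (hlog : ∀ x ∈ Icc (3 / 4 * lam) (5 / 4 * lam), α x = Real.log |lam ^ 2 - x ^ 2|)
    (hsupp : ∀ x, 0 ≤ x → α x ≠ 0 → x ∈ Ioo (lam / 2) (3 / 2 * lam)) (αm βp : L2R)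
    (hαm : (αm : ℝ → ℂ) =ᵐ[volume] fun x ↦ (x * α x : ℂ))
    (hβp : (βp : ℝ → ℂ) =ᵐ[volume] (Icc (-lam) lam).indicator fun _ ↦ (1 : ℂ))
    (hα : αm ∈ (prolateMax lam).domain) (hβ : βp ∈ (prolateMax lam).domain) :
    omegaForm lam ⟨αm, hα⟩ ⟨βp, hβ⟩ = 0 := by
  have hβ2 : MemLp (fun x ↦ (Icc (-lam) lam).indicator (fun _ : ℝ ↦ (1 : ℂ)) x) 2 volume :=
    memLp_indicator_mul_of_continuous continuous_const lam
  have eα : αm = (memLp_alphaMinus hlam hαU heven hlog hsupp).toLp _ :=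
    Lp.ext (hαm.trans (memLp_alphaMinus hlam hαU heven hlog hsupp).coeFn_toLp.symm)
  have eβ : βp = hβ2.toLp _ := Lp.ext (hβp.trans hβ2.coeFn_toLp.symm)
  have hα' : (memLp_alphaMinus hlam hαU heven hlog hsupp).toLp _ ∈ (prolateMax lam).domain :=
    eα ▸ hα
  have hβ' : hβ2.toLp _ ∈ (prolateMax lam).domain := eβ ▸ hβ
  have e1 : (⟨αm, hα⟩ : (prolateMax lam).domain) =
      ⟨(memLp_alphaMinus hlam hαU heven hlog hsupp).toLp _, hα'⟩ := Subtype.ext eα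
  have e2 : (⟨βp, hβ⟩ : (prolateMax lam).domain) = ⟨hβ2.toLp _, hβ'⟩ := Subtype.ext eβ
  have hGtop : ContDiffOn ℝ (⊤ : ℕ∞) (fun t : ℝ ↦ (t : ℂ) * (α t : ℂ)) {x | x ≠ lam ∧ x ≠ -lam} :=
    (Complex.ofRealCLM.contDiff.comp contDiff_id).contDiffOn.mul
      (Complex.ofRealCLM.contDiff.comp_contDiffOn hαU)
  rw [e1, e2, omegaForm_piecewise_indicator hlam (R := 3 / 2 * lam)
    (cp := (lam : ℂ) * ((-2 * lam : ℝ) : ℂ)) (cm := ((-lam : ℝ) : ℂ) * ((-2 * (-lam) : ℝ) : ℂ))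
    (hGtop.of_le (WithTop.coe_le_coe.mpr le_top))
    (fun x hx ↦ by simp [alpha_eq_zero_of_le_abs heven hsupp hx]) (fun x _ _ ↦ rfl)
    (memLp_alphaMinus hlam hαU heven hlog hsupp) (memLp_W_alphaMinus hlam hαU heven hlog hsupp)
    (tendsto_pCoeff_mul_deriv_alphaMinus hlam hαU heven hlog (Or.inl rfl))
    (by
      have := tendsto_pCoeff_mul_deriv_alphaMinus hlam hαU heven hlog (Or.inr rfl)
      simpa using this)
    (tendsto_pCoeff_mul_alphaMinus hlam heven hlog (Or.inl rfl))
    (tendsto_pCoeff_mul_alphaMinus hlam heven hlog (Or.inr rfl)) contDiff_const hβ2 hα' hβ']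
  simp only [Complex.conj_ofReal, map_mul]
  push_cast
  ring

end OmegaMatrix

end OmegaCutoff

/-! ## §7. Eq. (1.7): `Ω` between two piecewise-`C²` vectors as a sum of bracket jumps -/

section OmegaLagrange

variable {lam : ℝ}

/-- **Lagrange's identity (1.5)–(1.6) on a compact piece `[x, y]` avoiding `±λ`, sesquilinear
form**: for two piecewise-`C²` vectors, `∫_x^y (conj(Wg₁) g₂ − conj(g₁) Wg₂) = [conj(g₁)(p g₂′) − conj(p g₁′) g₂]_x^y`.
[cite: ConnesMoscovici2022, §1 eqs. (1.5)–(1.7) (= arXiv:2112.05500 (2.5)–(2.7), chunk p0005:L24–L38)] -/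
theorem intervalIntegral_lagrange_piece (lam : ℝ) {x y : ℝ} (hxy : x ≤ y)
    (hsub : Icc x y ⊆ {s : ℝ | s ≠ lam ∧ s ≠ -lam}) {g₁ Wg₁ g₂ Wg₂ : ℝ → ℂ}
    (hg₁ : ContDiffOn ℝ 2 g₁ {s : ℝ | s ≠ lam ∧ s ≠ -lam})
    (hWg₁ : ∀ s, s ≠ lam → s ≠ -lam →
      Wg₁ s = -deriv (fun t ↦ pCoeff lam t * deriv g₁ t) s + qCoeff lam s * g₁ s)
    (hg₂ : ContDiffOn ℝ 2 g₂ {s : ℝ | s ≠ lam ∧ s ≠ -lam})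
    (hWg₂ : ∀ s, s ≠ lam → s ≠ -lam →
      Wg₂ s = -deriv (fun t ↦ pCoeff lam t * deriv g₂ t) s + qCoeff lam s * g₂ s) :
    ∫ t in x..y, ((starRingEnd ℂ) (Wg₁ t) * g₂ t - (starRingEnd ℂ) (g₁ t) * Wg₂ t) =
      ((starRingEnd ℂ) (g₁ y) * (pCoeff lam y * deriv g₂ y) -
          (starRingEnd ℂ) (pCoeff lam y * deriv g₁ y) * g₂ y) -
        ((starRingEnd ℂ) (g₁ x) * (pCoeff lam x * deriv g₂ x) -
          (starRingEnd ℂ) (pCoeff lam x * deriv g₁ x) * g₂ x) := by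
  set U : Set ℝ := {s : ℝ | s ≠ lam ∧ s ≠ -lam} with hU_def
  have hU : IsOpen U := isOpen_ne_lam lam
  have hpreal : ∀ t, (starRingEnd ℂ) (pCoeff lam t) = pCoeff lam t := fun t ↦ by
    rw [show pCoeff lam t = ((lam ^ 2 - t ^ 2 : ℝ) : ℂ) from rfl, Complex.conj_ofReal]
  have hqreal : ∀ t, (starRingEnd ℂ) (qCoeff lam t) = qCoeff lam t := fun t ↦ by
    rw [show qCoeff lam t = (((2 * π * lam) ^ 2 * t ^ 2 : ℝ) : ℂ) from rfl, Complex.conj_ofReal]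
  -- regularity of both vectors on `U`
  have prep : ∀ {g : ℝ → ℂ}, ContDiffOn ℝ 2 g U →
      (∀ s ∈ U, HasDerivAt g (deriv g s) s) ∧ ContinuousOn (deriv g) U ∧
      (∀ s ∈ U, HasDerivAt (fun t ↦ pCoeff lam t * deriv g t)
        (deriv (fun t ↦ pCoeff lam t * deriv g t) s) s) ∧
      ContinuousOn (deriv (fun t ↦ pCoeff lam t * deriv g t)) U := by
    intro g hg
    have h2 : ContDiffOn ℝ (1 + 1) g U := by simpa [one_add_one_eq_two] using hg
    have hgd' : ContDiffOn ℝ 1 (deriv g) U := h2.deriv_of_isOpen hU le_rfl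
    have hv1 : ContDiffOn ℝ 1 (fun t ↦ pCoeff lam t * deriv g t) U :=
      ((contDiff_pCoeff_def lam 1).contDiffOn).mul hgd'
    refine ⟨fun s hs ↦ ((h2.differentiableOn (by simp) s hs).differentiableAt
      (hU.mem_nhds hs)).hasDerivAt, hgd'.continuousOn, fun s hs ↦
      ((hv1.differentiableOn one_ne_zero s hs).differentiableAt (hU.mem_nhds hs)).hasDerivAt,
      hv1.continuousOn_deriv_of_isOpen hU le_rfl⟩
  obtain ⟨hd₁, hc₁, hvd₁, hvc₁⟩ := prep hg₁
  obtain ⟨hd₂, hc₂, hvd₂, hvc₂⟩ := prep hg₂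
  set v₁ : ℝ → ℂ := fun t ↦ pCoeff lam t * deriv g₁ t with hv₁_def
  set v₂ : ℝ → ℂ := fun t ↦ pCoeff lam t * deriv g₂ t with hv₂_def
  have hIcc : uIcc x y = Icc x y := uIcc_of_le hxy
  -- FTC forms
  have hF₂ : ∀ s ∈ Icc x y, v₂ s = v₂ x + ∫ t in x..s, deriv v₂ t := by
    intro s hs
    have hsub' : uIcc x s ⊆ Icc x y := by
      rw [uIcc_of_le hs.1]; exact Icc_subset_Icc_right hs.2
    rw [intervalIntegral.integral_eq_sub_of_hasDerivAt (fun t ht ↦ hvd₂ t (hsub (hsub' ht)))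
      (((hvc₂.mono (hsub.trans' hsub')).mono (by rw [uIcc_of_le hs.1])).intervalIntegrable_of_Icc
        hs.1)]
    ring
  have hvd₁c : ∀ s ∈ U, HasDerivAt (fun t ↦ (starRingEnd ℂ) (v₁ t))
      ((starRingEnd ℂ) (deriv v₁ s)) s := fun s hs ↦ by
    simpa only [starRingEnd_apply] using (hvd₁ s hs).star
  have hd₁c : ∀ s ∈ U, HasDerivAt (fun t ↦ (starRingEnd ℂ) (g₁ t))
      ((starRingEnd ℂ) (deriv g₁ s)) s := fun s hs ↦ by
    simpa only [starRingEnd_apply] using (hd₁ s hs).star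
  have hF₁ : ∀ s ∈ Icc x y, (starRingEnd ℂ) (v₁ s) =
      (starRingEnd ℂ) (v₁ x) + ∫ t in x..s, (starRingEnd ℂ) (deriv v₁ t) := by
    intro s hs
    have hsub' : uIcc x s ⊆ Icc x y := by
      rw [uIcc_of_le hs.1]; exact Icc_subset_Icc_right hs.2
    rw [intervalIntegral.integral_eq_sub_of_hasDerivAt
      (f := fun t ↦ (starRingEnd ℂ) (v₁ t)) (fun t ht ↦ hvd₁c t (hsub (hsub' ht)))
      ((Complex.continuous_conj.comp_continuousOn
        (((hvc₁.mono (hsub.trans' hsub')).mono (by rw [uIcc_of_le hs.1])))).intervalIntegrable_of_Icc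
        hs.1)]
    ring
  have hlag := intervalIntegral_lagrange_of_primitive hxy (p := pCoeff lam)
    (g₁ := fun t ↦ (starRingEnd ℂ) (g₁ t)) (g₁' := fun t ↦ (starRingEnd ℂ) (deriv g₁ t))
    (u₁ := fun t ↦ (starRingEnd ℂ) (v₁ t)) (f₁ := fun t ↦ (starRingEnd ℂ) (deriv v₁ t))
    (g₂ := g₂) (g₂' := deriv g₂) (u₂ := v₂) (f₂ := deriv v₂)
    (fun s hs ↦ hd₁c s (hsub hs))
    (Complex.continuous_conj.comp_continuousOn (hc₁.mono hsub))
    (fun s _ ↦ by simp only [hv₁_def, map_mul, hpreal])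
    hF₁ ((Complex.continuous_conj.comp_continuousOn (hvc₁.mono hsub)).intervalIntegrable_of_Icc hxy)
    (fun s hs ↦ hd₂ s (hsub hs)) (hc₂.mono hsub) (fun s _ ↦ rfl) hF₂
    ((hvc₂.mono hsub).intervalIntegrable_of_Icc hxy)
  rw [← hlag]
  refine intervalIntegral.integral_congr fun t ht ↦ ?_
  rw [hIcc] at ht
  have htU := hsub ht
  simp only [hWg₁ t htU.1 htU.2, hWg₂ t htU.1 htU.2, map_add, map_neg, map_mul, hqreal, hv₁_def,
    hv₂_def]
  ring

/-- RH-FREE (PROVED). **Eq. (1.7): `Ω` in terms of Lagrange brackets, for two piecewise-`C²`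
compactly supported vectors of `dom W_max`.**  With `B(s) = conj(g₁)(p g₂′) − conj(p g₁′) g₂` and
its four lateral limits `L₁ = B(−λ⁻)`, `L₂ = B(−λ⁺)`, `L₃ = B(λ⁻)`, `L₄ = B(λ⁺)`:
`⟪W_max g₁, g₂⟫ − ⟪g₁, W_max g₂⟫ = L₁ − L₂ + L₃ − L₄`, i.e. `Ω(g₁, g₂) = −i (L₁ − L₂ + L₃ − L₄)`
("`iΩ(ξ,η) = [ξ,η̄]|_{−∞}^{−λ} + [ξ,η̄]|_{−λ}^{λ} + [ξ,η̄]|_{λ}^{∞}`", the terms at `±∞` vanishing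
by compact support). [cite: ConnesMoscovici2022, §1 eq. (1.7) (= arXiv:2112.05500 (2.7), chunk p0005:L31–L38)] -/
theorem omegaForm_piecewise_piecewise (hlam : 0 < lam) {g₁ Wg₁ g₂ Wg₂ : ℝ → ℂ} {R₁ R₂ : ℝ}
    (hg₁ : ContDiffOn ℝ 2 g₁ {x : ℝ | x ≠ lam ∧ x ≠ -lam}) (hgR₁ : ∀ x, R₁ ≤ |x| → g₁ x = 0)
    (hWg₁ : ∀ x, x ≠ lam → x ≠ -lam →
      Wg₁ x = -deriv (fun s ↦ pCoeff lam s * deriv g₁ s) x + qCoeff lam x * g₁ x)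
    (hg₁2 : MemLp g₁ 2 volume) (hWg₁2 : MemLp Wg₁ 2 volume)
    (hg₂ : ContDiffOn ℝ 2 g₂ {x : ℝ | x ≠ lam ∧ x ≠ -lam}) (hgR₂ : ∀ x, R₂ ≤ |x| → g₂ x = 0)
    (hWg₂ : ∀ x, x ≠ lam → x ≠ -lam →
      Wg₂ x = -deriv (fun s ↦ pCoeff lam s * deriv g₂ s) x + qCoeff lam x * g₂ x)
    (hg₂2 : MemLp g₂ 2 volume) (hWg₂2 : MemLp Wg₂ 2 volume)
    {L₁ L₂ L₃ L₄ : ℂ}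
    (hL₁ : Tendsto (fun s ↦ (starRingEnd ℂ) (g₁ s) * (pCoeff lam s * deriv g₂ s) -
      (starRingEnd ℂ) (pCoeff lam s * deriv g₁ s) * g₂ s) (𝓝[<] (-lam)) (𝓝 L₁))
    (hL₂ : Tendsto (fun s ↦ (starRingEnd ℂ) (g₁ s) * (pCoeff lam s * deriv g₂ s) -
      (starRingEnd ℂ) (pCoeff lam s * deriv g₁ s) * g₂ s) (𝓝[>] (-lam)) (𝓝 L₂))
    (hL₃ : Tendsto (fun s ↦ (starRingEnd ℂ) (g₁ s) * (pCoeff lam s * deriv g₂ s) -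
      (starRingEnd ℂ) (pCoeff lam s * deriv g₁ s) * g₂ s) (𝓝[<] lam) (𝓝 L₃))
    (hL₄ : Tendsto (fun s ↦ (starRingEnd ℂ) (g₁ s) * (pCoeff lam s * deriv g₂ s) -
      (starRingEnd ℂ) (pCoeff lam s * deriv g₁ s) * g₂ s) (𝓝[>] lam) (𝓝 L₄))
    (hG₁ : hg₁2.toLp g₁ ∈ (prolateMax lam).domain) (hG₂ : hg₂2.toLp g₂ ∈ (prolateMax lam).domain)
    (hW₁ : prolateMax lam ⟨hg₁2.toLp g₁, hG₁⟩ = hWg₁2.toLp Wg₁)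
    (hW₂ : prolateMax lam ⟨hg₂2.toLp g₂, hG₂⟩ = hWg₂2.toLp Wg₂) :
    omegaForm lam ⟨hg₁2.toLp g₁, hG₁⟩ ⟨hg₂2.toLp g₂, hG₂⟩ = -I * (L₁ - L₂ + L₃ - L₄) := by
  set U : Set ℝ := {s : ℝ | s ≠ lam ∧ s ≠ -lam} with hU_def
  have hU : IsOpen U := isOpen_ne_lam lam
  set B : ℝ → ℂ := fun s ↦ (starRingEnd ℂ) (g₁ s) * (pCoeff lam s * deriv g₂ s) -
      (starRingEnd ℂ) (pCoeff lam s * deriv g₁ s) * g₂ s with hB_def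
  set F : ℝ → ℂ := fun t ↦ (starRingEnd ℂ) (Wg₁ t) * g₂ t - (starRingEnd ℂ) (g₁ t) * Wg₂ t
    with hF_def
  -- everything vanishes for `|x| > R₀`
  set R₀ : ℝ := max (max R₁ R₂) (lam + 1) with hR₀
  have hO : IsOpen {s : ℝ | R₀ < |s|} := isOpen_lt continuous_const continuous_abs
  have hR₀1 : R₁ ≤ R₀ := (le_max_left _ _).trans (le_max_left _ _)
  have hR₀2 : R₂ ≤ R₀ := (le_max_right _ _).trans (le_max_left _ _)
  have hzero : ∀ {g : ℝ → ℂ} {R : ℝ}, R ≤ R₀ → (∀ x, R ≤ |x| → g x = 0) →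
      ∀ s, R₀ < |s| → g s = 0 ∧ deriv g s = 0 := by
    intro g R hR hgR s hs
    have hev : g =ᶠ[𝓝 s] fun _ ↦ (0 : ℂ) :=
      Filter.eventually_of_mem (hO.mem_nhds hs) fun t ht ↦ hgR t (hR.trans (le_of_lt ht))
    exact ⟨hgR s (hR.trans hs.le), by rw [hev.deriv_eq, deriv_const]⟩
  have hB0 : ∀ s, R₀ < |s| → B s = 0 := by
    intro s hs
    obtain ⟨h1, h1'⟩ := hzero hR₀1 hgR₁ s hs
    obtain ⟨h2, h2'⟩ := hzero hR₀2 hgR₂ s hs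
    simp only [hB_def, h1, h1', h2, h2', map_zero, mul_zero, sub_zero]
  have hF0 : ∀ s, R₀ < |s| → F s = 0 := by
    intro s hs
    obtain ⟨h1, _⟩ := hzero hR₀1 hgR₁ s hs
    obtain ⟨h2, _⟩ := hzero hR₀2 hgR₂ s hs
    simp only [hF_def, h1, h2, map_zero, mul_zero, zero_mul, sub_zero]
  have hBout : ∀ s, R₀ < |s| → Tendsto B (𝓝 s) (𝓝 0) := by
    intro s hs
    refine tendsto_const_nhds.congr' ?_
    filter_upwards [hO.mem_nhds hs] with t ht
    exact (hB0 t ht).symm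
  set Rb : ℝ := R₀ + 1 with hRb
  have hR₀lam : lam < R₀ := by
    have : lam + 1 ≤ R₀ := le_max_right _ _; linarith
  have hRabs : R₀ < |Rb| := by rw [abs_of_pos (by linarith)]; linarith
  have hRabs' : R₀ < |(-Rb)| := by rw [abs_neg]; exact hRabs
  -- integrability of `F`
  have hI1 : Integrable (fun t ↦ (starRingEnd ℂ) (Wg₁ t) * g₂ t) := by
    have h := hWg₁2.integrable_mul hg₂2
    refine h.mono ((Complex.continuous_conj.comp_aestronglyMeasurable hWg₁2.1).mul hg₂2.1) ?_
    exact Eventually.of_forall fun t ↦ by simp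
  have hI2 : Integrable (fun t ↦ (starRingEnd ℂ) (g₁ t) * Wg₂ t) := by
    have h := hg₁2.integrable_mul hWg₂2
    refine h.mono ((Complex.continuous_conj.comp_aestronglyMeasurable hg₁2.1).mul hWg₂2.1) ?_
    exact Eventually.of_forall fun t ↦ by simp
  have hFint : Integrable F := hI1.sub hI2
  have hFi : ∀ a b : ℝ, IntervalIntegrable F volume a b := fun a b ↦
    (hFint.integrableOn).intervalIntegrable
  -- Lagrange on compact pieces
  have hId : ∀ a b : ℝ, Ioo a b ⊆ U → ∀ x ∈ Ioo a b, ∀ y ∈ Ioo a b, x ≤ y →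
      ∫ t in x..y, F t = B y - B x := by
    intro a b hab x hx y hy hxy
    have hsub : Icc x y ⊆ U := fun s hs ↦ hab ⟨hx.1.trans_le hs.1, hs.2.trans_lt hy.2⟩
    exact intervalIntegral_lagrange_piece lam hxy hsub hg₁ hWg₁ hg₂ hWg₂
  -- the three pieces
  have hP1 : ∫ t in (-Rb)..(-lam), F t = L₁ - 0 :=
    intervalIntegral_eq_sub_of_boundary_tendsto (by linarith) (hFi _ _)
      (hId (-Rb) (-lam) (fun s hs ↦ ⟨by linarith [hs.2], hs.2.ne⟩))
      ((hBout _ hRabs').mono_left nhdsWithin_le_nhds) hL₁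
  have hP2 : ∫ t in (-lam)..lam, F t = L₃ - L₂ :=
    intervalIntegral_eq_sub_of_boundary_tendsto (by linarith) (hFi _ _)
      (hId (-lam) lam (fun s hs ↦ ⟨hs.2.ne, hs.1.ne'⟩)) hL₂ hL₃
  have hP3 : ∫ t in lam..Rb, F t = 0 - L₄ :=
    intervalIntegral_eq_sub_of_boundary_tendsto (by linarith) (hFi _ _)
      (hId lam Rb (fun s hs ↦ ⟨hs.1.ne', by linarith [hs.1]⟩)) hL₄
      ((hBout _ hRabs).mono_left nhdsWithin_le_nhds)
  have hsupp : Function.support F ⊆ Ioc (-Rb) Rb := by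
    intro t ht
    rw [Function.mem_support] at ht
    by_contra hcon
    apply ht
    have hR : R₀ < |t| := by
      rw [mem_Ioc, not_and_or, not_lt, not_le] at hcon
      rcases hcon with h | h
      · rw [abs_of_neg (by linarith)]; linarith
      · rw [abs_of_pos (by linarith)]; linarith
    exact hF0 t hR
  have hInt : ∫ t, F t = L₁ - L₂ + L₃ - L₄ := by
    rw [← intervalIntegral.integral_eq_integral_of_support_subset hsupp,
      ← intervalIntegral.integral_add_adjacent_intervals (hFi (-Rb) (-lam)) (hFi (-lam) Rb),
      ← intervalIntegral.integral_add_adjacent_intervals (hFi (-lam) lam) (hFi lam Rb),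
      hP1, hP2, hP3]
    ring
  -- the inner products
  have hi1 : ⟪(hWg₁2.toLp Wg₁ : L2R), (hg₂2.toLp g₂ : L2R)⟫_ℂ =
      ∫ t, (starRingEnd ℂ) (Wg₁ t) * g₂ t := by
    rw [L2.inner_def]
    refine integral_congr_ae ?_
    filter_upwards [hWg₁2.coeFn_toLp, hg₂2.coeFn_toLp] with t h1 h2
    rw [h1, h2, RCLike.inner_apply, mul_comm]
  have hi2 : ⟪(hg₁2.toLp g₁ : L2R), (hWg₂2.toLp Wg₂ : L2R)⟫_ℂ =
      ∫ t, (starRingEnd ℂ) (g₁ t) * Wg₂ t := by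
    rw [L2.inner_def]
    refine integral_congr_ae ?_
    filter_upwards [hg₁2.coeFn_toLp, hWg₂2.coeFn_toLp] with t h1 h2
    rw [h1, h2, RCLike.inner_apply, mul_comm]
  unfold omegaForm
  rw [hW₁, hW₂, hi1, hi2, ← integral_sub hI1 hI2]
  change -I * ∫ t, F t = _
  rw [hInt]

/-- RH-FREE (PROVED). **Eq. (1.7), general second argument**: as `omegaForm_piecewise_piecewise`,
but only the FIRST vector needs compact support; the second is any `g₂ ∈ dom W_max`, `C²` off `±λ`,
whose `W_max`-image is the classical `−(p g₂′)′ + q g₂` (e.g. an everywhere-smooth element such as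
the Fourier image of a compactly supported vector) — the integrand `conj(Wg₁) g₂ − conj(g₁) Wg₂` and
the bracket are supported in `supp g₁`.  **Eq. (1.7): `Ω` in terms of Lagrange brackets.**  With `B(s) = conj(g₁)(p g₂′) − conj(p g₁′) g₂` and
its four lateral limits `L₁ = B(−λ⁻)`, `L₂ = B(−λ⁺)`, `L₃ = B(λ⁻)`, `L₄ = B(λ⁺)`:
`⟪W_max g₁, g₂⟫ − ⟪g₁, W_max g₂⟫ = L₁ − L₂ + L₃ − L₄`, i.e. `Ω(g₁, g₂) = −i (L₁ − L₂ + L₃ − L₄)`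
("`iΩ(ξ,η) = [ξ,η̄]|_{−∞}^{−λ} + [ξ,η̄]|_{−λ}^{λ} + [ξ,η̄]|_{λ}^{∞}`", the terms at `±∞` vanishing
by compact support). [cite: ConnesMoscovici2022, §1 eq. (1.7) (= arXiv:2112.05500 (2.7), chunk p0005:L31–L38)] -/
theorem omegaForm_piecewise_general (hlam : 0 < lam) {g₁ Wg₁ g₂ Wg₂ : ℝ → ℂ} {R₁ : ℝ}
    (hg₁ : ContDiffOn ℝ 2 g₁ {x : ℝ | x ≠ lam ∧ x ≠ -lam}) (hgR₁ : ∀ x, R₁ ≤ |x| → g₁ x = 0)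
    (hWg₁ : ∀ x, x ≠ lam → x ≠ -lam →
      Wg₁ x = -deriv (fun s ↦ pCoeff lam s * deriv g₁ s) x + qCoeff lam x * g₁ x)
    (hg₁2 : MemLp g₁ 2 volume) (hWg₁2 : MemLp Wg₁ 2 volume)
    (hg₂ : ContDiffOn ℝ 2 g₂ {x : ℝ | x ≠ lam ∧ x ≠ -lam})
    (hWg₂ : ∀ x, x ≠ lam → x ≠ -lam →
      Wg₂ x = -deriv (fun s ↦ pCoeff lam s * deriv g₂ s) x + qCoeff lam x * g₂ x)
    (hg₂2 : MemLp g₂ 2 volume) (hWg₂2 : MemLp Wg₂ 2 volume)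
    {L₁ L₂ L₃ L₄ : ℂ}
    (hL₁ : Tendsto (fun s ↦ (starRingEnd ℂ) (g₁ s) * (pCoeff lam s * deriv g₂ s) -
      (starRingEnd ℂ) (pCoeff lam s * deriv g₁ s) * g₂ s) (𝓝[<] (-lam)) (𝓝 L₁))
    (hL₂ : Tendsto (fun s ↦ (starRingEnd ℂ) (g₁ s) * (pCoeff lam s * deriv g₂ s) -
      (starRingEnd ℂ) (pCoeff lam s * deriv g₁ s) * g₂ s) (𝓝[>] (-lam)) (𝓝 L₂))
    (hL₃ : Tendsto (fun s ↦ (starRingEnd ℂ) (g₁ s) * (pCoeff lam s * deriv g₂ s) -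
      (starRingEnd ℂ) (pCoeff lam s * deriv g₁ s) * g₂ s) (𝓝[<] lam) (𝓝 L₃))
    (hL₄ : Tendsto (fun s ↦ (starRingEnd ℂ) (g₁ s) * (pCoeff lam s * deriv g₂ s) -
      (starRingEnd ℂ) (pCoeff lam s * deriv g₁ s) * g₂ s) (𝓝[>] lam) (𝓝 L₄))
    (hG₁ : hg₁2.toLp g₁ ∈ (prolateMax lam).domain) (hG₂ : hg₂2.toLp g₂ ∈ (prolateMax lam).domain)
    (hW₁ : prolateMax lam ⟨hg₁2.toLp g₁, hG₁⟩ = hWg₁2.toLp Wg₁)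
    (hW₂ : prolateMax lam ⟨hg₂2.toLp g₂, hG₂⟩ = hWg₂2.toLp Wg₂) :
    omegaForm lam ⟨hg₁2.toLp g₁, hG₁⟩ ⟨hg₂2.toLp g₂, hG₂⟩ = -I * (L₁ - L₂ + L₃ - L₄) := by
  set U : Set ℝ := {s : ℝ | s ≠ lam ∧ s ≠ -lam} with hU_def
  have hU : IsOpen U := isOpen_ne_lam lam
  set B : ℝ → ℂ := fun s ↦ (starRingEnd ℂ) (g₁ s) * (pCoeff lam s * deriv g₂ s) -
      (starRingEnd ℂ) (pCoeff lam s * deriv g₁ s) * g₂ s with hB_def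
  set F : ℝ → ℂ := fun t ↦ (starRingEnd ℂ) (Wg₁ t) * g₂ t - (starRingEnd ℂ) (g₁ t) * Wg₂ t
    with hF_def
  -- everything vanishes for `|x| > R₀`
  set R₀ : ℝ := max R₁ (lam + 1) with hR₀
  have hO : IsOpen {s : ℝ | R₀ < |s|} := isOpen_lt continuous_const continuous_abs
  have hR₀1 : R₁ ≤ R₀ := le_max_left _ _
  have hOU : ∀ s, R₀ < |s| → s ∈ U := by
    intro s hs
    have h1 : lam + 1 ≤ R₀ := le_max_right _ _
    constructor
    · rintro rfl; rw [abs_of_pos hlam] at hs; linarith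
    · rintro rfl; rw [abs_neg, abs_of_pos hlam] at hs; linarith
  have hg0 : ∀ s, R₀ < |s| → g₁ s = 0 := fun s hs ↦ hgR₁ s (hR₀1.trans hs.le)
  have hdg0 : ∀ s, R₀ < |s| → deriv g₁ s = 0 := by
    intro s hs
    have hev : g₁ =ᶠ[𝓝 s] fun _ ↦ (0 : ℂ) :=
      Filter.eventually_of_mem (hO.mem_nhds hs) fun t ht ↦ hg0 t ht
    rw [hev.deriv_eq, deriv_const]
  have hdv0 : ∀ s, R₀ < |s| → deriv (fun t ↦ pCoeff lam t * deriv g₁ t) s = 0 := by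
    intro s hs
    have hev : (fun t ↦ pCoeff lam t * deriv g₁ t) =ᶠ[𝓝 s] fun _ ↦ (0 : ℂ) :=
      Filter.eventually_of_mem (hO.mem_nhds hs) fun t ht ↦ by simp only [hdg0 t ht, mul_zero]
    rw [hev.deriv_eq, deriv_const]
  have hWg0 : ∀ s, R₀ < |s| → Wg₁ s = 0 := by
    intro s hs
    rw [hWg₁ s (hOU s hs).1 (hOU s hs).2, hdv0 s hs, hg0 s hs]; simp
  have hB0 : ∀ s, R₀ < |s| → B s = 0 := by
    intro s hs
    simp only [hB_def, hg0 s hs, hdg0 s hs, map_zero, mul_zero, zero_mul, sub_zero]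
  have hF0 : ∀ s, R₀ < |s| → F s = 0 := by
    intro s hs
    simp only [hF_def, hg0 s hs, hWg0 s hs, map_zero, zero_mul, sub_zero]
  have hBout : ∀ s, R₀ < |s| → Tendsto B (𝓝 s) (𝓝 0) := by
    intro s hs
    refine tendsto_const_nhds.congr' ?_
    filter_upwards [hO.mem_nhds hs] with t ht
    exact (hB0 t ht).symm
  set Rb : ℝ := R₀ + 1 with hRb
  have hR₀lam : lam < R₀ := by
    have : lam + 1 ≤ R₀ := le_max_right _ _; linarith
  have hRabs : R₀ < |Rb| := by rw [abs_of_pos (by linarith)]; linarith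
  have hRabs' : R₀ < |(-Rb)| := by rw [abs_neg]; exact hRabs
  -- integrability of `F`
  have hI1 : Integrable (fun t ↦ (starRingEnd ℂ) (Wg₁ t) * g₂ t) := by
    have h := hWg₁2.integrable_mul hg₂2
    refine h.mono ((Complex.continuous_conj.comp_aestronglyMeasurable hWg₁2.1).mul hg₂2.1) ?_
    exact Eventually.of_forall fun t ↦ by simp
  have hI2 : Integrable (fun t ↦ (starRingEnd ℂ) (g₁ t) * Wg₂ t) := by
    have h := hg₁2.integrable_mul hWg₂2
    refine h.mono ((Complex.continuous_conj.comp_aestronglyMeasurable hg₁2.1).mul hWg₂2.1) ?_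
    exact Eventually.of_forall fun t ↦ by simp
  have hFint : Integrable F := hI1.sub hI2
  have hFi : ∀ a b : ℝ, IntervalIntegrable F volume a b := fun a b ↦
    (hFint.integrableOn).intervalIntegrable
  -- Lagrange on compact pieces
  have hId : ∀ a b : ℝ, Ioo a b ⊆ U → ∀ x ∈ Ioo a b, ∀ y ∈ Ioo a b, x ≤ y →
      ∫ t in x..y, F t = B y - B x := by
    intro a b hab x hx y hy hxy
    have hsub : Icc x y ⊆ U := fun s hs ↦ hab ⟨hx.1.trans_le hs.1, hs.2.trans_lt hy.2⟩
    exact intervalIntegral_lagrange_piece lam hxy hsub hg₁ hWg₁ hg₂ hWg₂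
  -- the three pieces
  have hP1 : ∫ t in (-Rb)..(-lam), F t = L₁ - 0 :=
    intervalIntegral_eq_sub_of_boundary_tendsto (by linarith) (hFi _ _)
      (hId (-Rb) (-lam) (fun s hs ↦ ⟨by linarith [hs.2], hs.2.ne⟩))
      ((hBout _ hRabs').mono_left nhdsWithin_le_nhds) hL₁
  have hP2 : ∫ t in (-lam)..lam, F t = L₃ - L₂ :=
    intervalIntegral_eq_sub_of_boundary_tendsto (by linarith) (hFi _ _)
      (hId (-lam) lam (fun s hs ↦ ⟨hs.2.ne, hs.1.ne'⟩)) hL₂ hL₃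
  have hP3 : ∫ t in lam..Rb, F t = 0 - L₄ :=
    intervalIntegral_eq_sub_of_boundary_tendsto (by linarith) (hFi _ _)
      (hId lam Rb (fun s hs ↦ ⟨hs.1.ne', by linarith [hs.1]⟩)) hL₄
      ((hBout _ hRabs).mono_left nhdsWithin_le_nhds)
  have hsupp : Function.support F ⊆ Ioc (-Rb) Rb := by
    intro t ht
    rw [Function.mem_support] at ht
    by_contra hcon
    apply ht
    have hR : R₀ < |t| := by
      rw [mem_Ioc, not_and_or, not_lt, not_le] at hcon
      rcases hcon with h | h
      · rw [abs_of_neg (by linarith)]; linarith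
      · rw [abs_of_pos (by linarith)]; linarith
    exact hF0 t hR
  have hInt : ∫ t, F t = L₁ - L₂ + L₃ - L₄ := by
    rw [← intervalIntegral.integral_eq_integral_of_support_subset hsupp,
      ← intervalIntegral.integral_add_adjacent_intervals (hFi (-Rb) (-lam)) (hFi (-lam) Rb),
      ← intervalIntegral.integral_add_adjacent_intervals (hFi (-lam) lam) (hFi lam Rb),
      hP1, hP2, hP3]
    ring
  -- the inner products
  have hi1 : ⟪(hWg₁2.toLp Wg₁ : L2R), (hg₂2.toLp g₂ : L2R)⟫_ℂ =
      ∫ t, (starRingEnd ℂ) (Wg₁ t) * g₂ t := by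
    rw [L2.inner_def]
    refine integral_congr_ae ?_
    filter_upwards [hWg₁2.coeFn_toLp, hg₂2.coeFn_toLp] with t h1 h2
    rw [h1, h2, RCLike.inner_apply, mul_comm]
  have hi2 : ⟪(hg₁2.toLp g₁ : L2R), (hWg₂2.toLp Wg₂ : L2R)⟫_ℂ =
      ∫ t, (starRingEnd ℂ) (g₁ t) * Wg₂ t := by
    rw [L2.inner_def]
    refine integral_congr_ae ?_
    filter_upwards [hg₁2.coeFn_toLp, hWg₂2.coeFn_toLp] with t h1 h2
    rw [h1, h2, RCLike.inner_apply, mul_comm]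
  unfold omegaForm
  rw [hW₁, hW₂, hi1, hi2, ← integral_sub hI1 hI2]
  change -I * ∫ t, F t = _
  rw [hInt]

/-! ### The `{α±} × {α±}` block of the `Ω`-matrix of Lemma 1.5: all four entries vanish -/

section OmegaAlphaAlpha

variable {α : ℝ → ℝ}

/-- A real-valued piecewise-smooth vector has real derivative off `±λ`: `conj (α:ℂ)′ = (α:ℂ)′`.
[folklore] -/
private theorem conj_deriv_eq_of_real {G : ℝ → ℂ} {U : Set ℝ} (hU : IsOpen U)
    (hG : ContDiffOn ℝ 2 G U) (hreal : ∀ t, (starRingEnd ℂ) (G t) = G t) {s : ℝ} (hs : s ∈ U) :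
    (starRingEnd ℂ) (deriv G s) = deriv G s := by
  have h2 : ContDiffOn ℝ (1 + 1) G U := by simpa [one_add_one_eq_two] using hG
  have hd : HasDerivAt G (deriv G s) s :=
    ((h2.differentiableOn (by simp) s hs).differentiableAt (hU.mem_nhds hs)).hasDerivAt
  have h1 : HasDerivAt (fun t ↦ (starRingEnd ℂ) (G t)) ((starRingEnd ℂ) (deriv G s)) s := by
    simpa only [starRingEnd_apply] using hd.star
  have e : (fun t ↦ (starRingEnd ℂ) (G t)) = G := funext hreal
  rw [e] at h1
  exact h1.unique hd

/-- `(λ² − x²) log²|λ² − x²| → 0` at `x → a` when `λ² = a²` (`t log² t → 0`). [folklore] -/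
private theorem tendsto_pSq_mul_log_sq {lam a : ℝ} (ha : lam ^ 2 - a ^ 2 = 0) :
    Tendsto (fun x ↦ (lam ^ 2 - x ^ 2) * Real.log |lam ^ 2 - x ^ 2| ^ 2) (𝓝 a) (𝓝 0) := by
  -- `ψ(t) = t log² t → 0` at `0`: `|ψ(t)| = 4 (√|t| log √|t|)²`
  have hψ : Tendsto (fun t : ℝ ↦ t * Real.log |t| ^ 2) (𝓝 0) (𝓝 0) := by
    have hc : Continuous fun t : ℝ ↦ 4 * (Real.sqrt |t| * Real.log (Real.sqrt |t|)) ^ 2 :=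
      continuous_const.mul ((Real.continuous_mul_log.comp
        (Real.continuous_sqrt.comp continuous_abs)).pow 2)
    have h0 := hc.tendsto 0
    simp only [abs_zero, Real.sqrt_zero, Real.log_zero, mul_zero, zero_pow two_ne_zero] at h0
    rw [tendsto_zero_iff_norm_tendsto_zero]
    refine h0.congr fun t ↦ ?_
    rw [Real.log_sqrt (abs_nonneg t), Real.log_abs, Real.norm_eq_abs, abs_mul, abs_pow, sq_abs,
      show (Real.sqrt |t| * (Real.log t / 2)) ^ 2 =
        Real.sqrt |t| ^ 2 * (Real.log t ^ 2 / 4) by ring, Real.sq_sqrt (abs_nonneg t)]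
    ring
  have hc : Tendsto (fun x : ℝ ↦ lam ^ 2 - x ^ 2) (𝓝 a) (𝓝 (lam ^ 2 - a ^ 2)) :=
    (continuous_const.sub (continuous_id.pow 2)).tendsto a
  rw [ha] at hc
  exact hψ.comp hc

/-- RH-FREE (PROVED). **`Ω(α₊, α₊) = 0`** (diagonal entry: `α₊` and `W α₊` are real, the bracket
`[α₊, ᾱ₊]` vanishes identically off `±λ`). [cite: ConnesMoscovici2022, proof of Lemma 1.5 (= arXiv:2112.05500 Lemma 2.5, chunk p0005:L94–L96)] -/
theorem omegaForm_alphaPlus_alphaPlus {lam : ℝ} (hlam : 0 < lam)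
    (hαU : ContDiffOn ℝ (⊤ : ℕ∞) α {x | x ≠ lam ∧ x ≠ -lam}) (heven : ∀ x, α (-x) = α x)
    (hlog : ∀ x ∈ Icc (3 / 4 * lam) (5 / 4 * lam), α x = Real.log |lam ^ 2 - x ^ 2|)
    (hsupp : ∀ x, 0 ≤ x → α x ≠ 0 → x ∈ Ioo (lam / 2) (3 / 2 * lam)) (αp : L2R)
    (hαp : (αp : ℝ → ℂ) =ᵐ[volume] fun x ↦ (α x : ℂ)) (hα : αp ∈ (prolateMax lam).domain) :
    omegaForm lam ⟨αp, hα⟩ ⟨αp, hα⟩ = 0 := by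
  set U : Set ℝ := {s : ℝ | s ≠ lam ∧ s ≠ -lam} with hU_def
  have hU : IsOpen U := isOpen_ne_lam lam
  have eα : αp = (memLp_alpha hlam hαU heven hlog hsupp).toLp _ :=
    Lp.ext (hαp.trans (memLp_alpha hlam hαU heven hlog hsupp).coeFn_toLp.symm)
  have hα' : (memLp_alpha hlam hαU heven hlog hsupp).toLp _ ∈ (prolateMax lam).domain := eα ▸ hα
  have e1 : (⟨αp, hα⟩ : (prolateMax lam).domain) =
      ⟨(memLp_alpha hlam hαU heven hlog hsupp).toLp _, hα'⟩ := Subtype.ext eα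
  obtain ⟨_, hW⟩ := exists_prolateMax_alpha hlam hαU heven hlog hsupp
  have hGtop : ContDiffOn ℝ (⊤ : ℕ∞) (fun t ↦ (α t : ℂ)) U :=
    Complex.ofRealCLM.contDiff.comp_contDiffOn hαU
  have hG2 : ContDiffOn ℝ 2 (fun t ↦ (α t : ℂ)) U := hGtop.of_le (WithTop.coe_le_coe.mpr le_top)
  have hreal : ∀ t, (starRingEnd ℂ) ((α t : ℂ)) = (α t : ℂ) := fun t ↦ Complex.conj_ofReal _
  have hpreal : ∀ t, (starRingEnd ℂ) (pCoeff lam t) = pCoeff lam t := fun t ↦ by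
    rw [show pCoeff lam t = ((lam ^ 2 - t ^ 2 : ℝ) : ℂ) from rfl, Complex.conj_ofReal]
  -- the bracket vanishes identically on `U`
  have hB : ∀ s ∈ U, (starRingEnd ℂ) ((α s : ℂ)) * (pCoeff lam s * deriv (fun t ↦ (α t : ℂ)) s) -
      (starRingEnd ℂ) (pCoeff lam s * deriv (fun t ↦ (α t : ℂ)) s) * (α s : ℂ) = 0 := by
    intro s hs
    rw [map_mul, hpreal, conj_deriv_eq_of_real hU hG2 hreal hs, hreal]; ring
  have hlim : ∀ (a : ℝ) (l : Filter ℝ), l ≤ 𝓝[≠] a → a = lam ∨ a = -lam →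
      Tendsto (fun s ↦ (starRingEnd ℂ) ((α s : ℂ)) * (pCoeff lam s * deriv (fun t ↦ (α t : ℂ)) s) -
        (starRingEnd ℂ) (pCoeff lam s * deriv (fun t ↦ (α t : ℂ)) s) * (α s : ℂ)) l (𝓝 0) := by
    intro a l hl ha
    have hev : ∀ᶠ s in 𝓝[≠] a, s ∈ U := by
      rcases ha with rfl | rfl
      · exact eventually_nhdsNE_mem_ne_lam hlam
      · exact eventually_nhdsNE_neg_mem_ne_lam hlam
    refine tendsto_const_nhds.congr' ?_
    filter_upwards [hl hev] with s hs
    exact (hB s hs).symm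
  rw [e1, omegaForm_piecewise_piecewise hlam (R₁ := 3 / 2 * lam) (R₂ := 3 / 2 * lam)
    hG2 (fun x hx ↦ by simp [alpha_eq_zero_of_le_abs heven hsupp hx]) (fun x _ _ ↦ rfl)
    (memLp_alpha hlam hαU heven hlog hsupp) (memLp_W_alpha hlam hαU heven hlog hsupp)
    hG2 (fun x hx ↦ by simp [alpha_eq_zero_of_le_abs heven hsupp hx]) (fun x _ _ ↦ rfl)
    (memLp_alpha hlam hαU heven hlog hsupp) (memLp_W_alpha hlam hαU heven hlog hsupp)
    (hlim (-lam) _ (nhdsWithin_mono _ fun s hs ↦ ne_of_lt hs) (Or.inr rfl))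
    (hlim (-lam) _ (nhdsWithin_mono _ fun s hs ↦ ne_of_gt hs) (Or.inr rfl))
    (hlim lam _ (nhdsWithin_mono _ fun s hs ↦ ne_of_lt hs) (Or.inl rfl))
    (hlim lam _ (nhdsWithin_mono _ fun s hs ↦ ne_of_gt hs) (Or.inl rfl)) hα' hα' hW hW]
  simp

/-- RH-FREE (PROVED). **`Ω(α₋, α₋) = 0`** (diagonal entry, odd sector).
[cite: ConnesMoscovici2022, proof of Lemma 1.5 (= arXiv:2112.05500 Lemma 2.5, chunk p0005:L96–L98)] -/
theorem omegaForm_alphaMinus_alphaMinus {lam : ℝ} (hlam : 0 < lam)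
    (hαU : ContDiffOn ℝ (⊤ : ℕ∞) α {x | x ≠ lam ∧ x ≠ -lam}) (heven : ∀ x, α (-x) = α x)
    (hlog : ∀ x ∈ Icc (3 / 4 * lam) (5 / 4 * lam), α x = Real.log |lam ^ 2 - x ^ 2|)
    (hsupp : ∀ x, 0 ≤ x → α x ≠ 0 → x ∈ Ioo (lam / 2) (3 / 2 * lam)) (αm : L2R)
    (hαm : (αm : ℝ → ℂ) =ᵐ[volume] fun x ↦ (x * α x : ℂ)) (hα : αm ∈ (prolateMax lam).domain) :
    omegaForm lam ⟨αm, hα⟩ ⟨αm, hα⟩ = 0 := by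
  set U : Set ℝ := {s : ℝ | s ≠ lam ∧ s ≠ -lam} with hU_def
  have hU : IsOpen U := isOpen_ne_lam lam
  have eα : αm = (memLp_alphaMinus hlam hαU heven hlog hsupp).toLp _ :=
    Lp.ext (hαm.trans (memLp_alphaMinus hlam hαU heven hlog hsupp).coeFn_toLp.symm)
  have hα' : (memLp_alphaMinus hlam hαU heven hlog hsupp).toLp _ ∈ (prolateMax lam).domain :=
    eα ▸ hα
  have e1 : (⟨αm, hα⟩ : (prolateMax lam).domain) =
      ⟨(memLp_alphaMinus hlam hαU heven hlog hsupp).toLp _, hα'⟩ := Subtype.ext eα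
  obtain ⟨_, hW⟩ := exists_prolateMax_alphaMinus hlam hαU heven hlog hsupp
  have hGtop : ContDiffOn ℝ (⊤ : ℕ∞) (fun t : ℝ ↦ (t : ℂ) * (α t : ℂ)) U :=
    (Complex.ofRealCLM.contDiff.comp contDiff_id).contDiffOn.mul
      (Complex.ofRealCLM.contDiff.comp_contDiffOn hαU)
  have hG2 : ContDiffOn ℝ 2 (fun t : ℝ ↦ (t : ℂ) * (α t : ℂ)) U :=
    hGtop.of_le (WithTop.coe_le_coe.mpr le_top)
  have hreal : ∀ t : ℝ, (starRingEnd ℂ) ((t : ℂ) * (α t : ℂ)) = (t : ℂ) * (α t : ℂ) := fun t ↦ by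
    rw [map_mul, Complex.conj_ofReal, Complex.conj_ofReal]
  have hpreal : ∀ t, (starRingEnd ℂ) (pCoeff lam t) = pCoeff lam t := fun t ↦ by
    rw [show pCoeff lam t = ((lam ^ 2 - t ^ 2 : ℝ) : ℂ) from rfl, Complex.conj_ofReal]
  have hB : ∀ s ∈ U, (starRingEnd ℂ) ((s : ℂ) * (α s : ℂ)) *
      (pCoeff lam s * deriv (fun t : ℝ ↦ (t : ℂ) * (α t : ℂ)) s) -
      (starRingEnd ℂ) (pCoeff lam s * deriv (fun t : ℝ ↦ (t : ℂ) * (α t : ℂ)) s) *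
      ((s : ℂ) * (α s : ℂ)) = 0 := by
    intro s hs
    rw [map_mul (starRingEnd ℂ) (pCoeff lam s), hpreal, conj_deriv_eq_of_real hU hG2 hreal hs,
      hreal]; ring
  have hlim : ∀ (a : ℝ) (l : Filter ℝ), l ≤ 𝓝[≠] a → a = lam ∨ a = -lam →
      Tendsto (fun s : ℝ ↦ (starRingEnd ℂ) ((s : ℂ) * (α s : ℂ)) *
        (pCoeff lam s * deriv (fun t : ℝ ↦ (t : ℂ) * (α t : ℂ)) s) -
        (starRingEnd ℂ) (pCoeff lam s * deriv (fun t : ℝ ↦ (t : ℂ) * (α t : ℂ)) s) *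
        ((s : ℂ) * (α s : ℂ))) l (𝓝 0) := by
    intro a l hl ha
    have hev : ∀ᶠ s in 𝓝[≠] a, s ∈ U := by
      rcases ha with rfl | rfl
      · exact eventually_nhdsNE_mem_ne_lam hlam
      · exact eventually_nhdsNE_neg_mem_ne_lam hlam
    refine tendsto_const_nhds.congr' ?_
    filter_upwards [hl hev] with s hs
    exact (hB s hs).symm
  rw [e1, omegaForm_piecewise_piecewise hlam (R₁ := 3 / 2 * lam) (R₂ := 3 / 2 * lam)
    hG2 (fun x hx ↦ by simp [alpha_eq_zero_of_le_abs heven hsupp hx]) (fun x _ _ ↦ rfl)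
    (memLp_alphaMinus hlam hαU heven hlog hsupp) (memLp_W_alphaMinus hlam hαU heven hlog hsupp)
    hG2 (fun x hx ↦ by simp [alpha_eq_zero_of_le_abs heven hsupp hx]) (fun x _ _ ↦ rfl)
    (memLp_alphaMinus hlam hαU heven hlog hsupp) (memLp_W_alphaMinus hlam hαU heven hlog hsupp)
    (hlim (-lam) _ (nhdsWithin_mono _ fun s hs ↦ ne_of_lt hs) (Or.inr rfl))
    (hlim (-lam) _ (nhdsWithin_mono _ fun s hs ↦ ne_of_gt hs) (Or.inr rfl))
    (hlim lam _ (nhdsWithin_mono _ fun s hs ↦ ne_of_lt hs) (Or.inl rfl))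
    (hlim lam _ (nhdsWithin_mono _ fun s hs ↦ ne_of_gt hs) (Or.inl rfl)) hα' hα' hW hW]
  simp

/-- RH-FREE (PROVED). **`Ω(α₊, α₋) = 0`**: the bracket is `[α₊, ᾱ₋] = p α₊²` off `±λ`, and
`(λ² − x²) log²|λ² − x²| → 0` at `±λ`. [cite: ConnesMoscovici2022, proof of Lemma 1.5 and the parity splitting `Ω = Ω₊ ⊕ Ω₋` (= arXiv:2112.05500, chunk p0005:L40–L44, L94–L98)] -/
theorem omegaForm_alphaPlus_alphaMinus {lam : ℝ} (hlam : 0 < lam)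
    (hαU : ContDiffOn ℝ (⊤ : ℕ∞) α {x | x ≠ lam ∧ x ≠ -lam}) (heven : ∀ x, α (-x) = α x)
    (hlog : ∀ x ∈ Icc (3 / 4 * lam) (5 / 4 * lam), α x = Real.log |lam ^ 2 - x ^ 2|)
    (hsupp : ∀ x, 0 ≤ x → α x ≠ 0 → x ∈ Ioo (lam / 2) (3 / 2 * lam)) (αp αm : L2R)
    (hαp : (αp : ℝ → ℂ) =ᵐ[volume] fun x ↦ (α x : ℂ))
    (hαm : (αm : ℝ → ℂ) =ᵐ[volume] fun x ↦ (x * α x : ℂ))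
    (hα : αp ∈ (prolateMax lam).domain) (hα2 : αm ∈ (prolateMax lam).domain) :
    omegaForm lam ⟨αp, hα⟩ ⟨αm, hα2⟩ = 0 := by
  set U : Set ℝ := {s : ℝ | s ≠ lam ∧ s ≠ -lam} with hU_def
  have hU : IsOpen U := isOpen_ne_lam lam
  have eα : αp = (memLp_alpha hlam hαU heven hlog hsupp).toLp _ :=
    Lp.ext (hαp.trans (memLp_alpha hlam hαU heven hlog hsupp).coeFn_toLp.symm)
  have eβ : αm = (memLp_alphaMinus hlam hαU heven hlog hsupp).toLp _ :=
    Lp.ext (hαm.trans (memLp_alphaMinus hlam hαU heven hlog hsupp).coeFn_toLp.symm)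
  have hα' : (memLp_alpha hlam hαU heven hlog hsupp).toLp _ ∈ (prolateMax lam).domain := eα ▸ hα
  have hα2' : (memLp_alphaMinus hlam hαU heven hlog hsupp).toLp _ ∈ (prolateMax lam).domain :=
    eβ ▸ hα2
  have e1 : (⟨αp, hα⟩ : (prolateMax lam).domain) =
      ⟨(memLp_alpha hlam hαU heven hlog hsupp).toLp _, hα'⟩ := Subtype.ext eα
  have e2 : (⟨αm, hα2⟩ : (prolateMax lam).domain) =
      ⟨(memLp_alphaMinus hlam hαU heven hlog hsupp).toLp _, hα2'⟩ := Subtype.ext eβ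
  obtain ⟨_, hW₁⟩ := exists_prolateMax_alpha hlam hαU heven hlog hsupp
  obtain ⟨_, hW₂⟩ := exists_prolateMax_alphaMinus hlam hαU heven hlog hsupp
  have hG₁top : ContDiffOn ℝ (⊤ : ℕ∞) (fun t ↦ (α t : ℂ)) U :=
    Complex.ofRealCLM.contDiff.comp_contDiffOn hαU
  have hG₁2 : ContDiffOn ℝ 2 (fun t ↦ (α t : ℂ)) U := hG₁top.of_le (WithTop.coe_le_coe.mpr le_top)
  have hG₂top : ContDiffOn ℝ (⊤ : ℕ∞) (fun t : ℝ ↦ (t : ℂ) * (α t : ℂ)) U :=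
    (Complex.ofRealCLM.contDiff.comp contDiff_id).contDiffOn.mul hG₁top
  have hG₂2 : ContDiffOn ℝ 2 (fun t : ℝ ↦ (t : ℂ) * (α t : ℂ)) U :=
    hG₂top.of_le (WithTop.coe_le_coe.mpr le_top)
  have hreal : ∀ t, (starRingEnd ℂ) ((α t : ℂ)) = (α t : ℂ) := fun t ↦ Complex.conj_ofReal _
  have hpreal : ∀ t, (starRingEnd ℂ) (pCoeff lam t) = pCoeff lam t := fun t ↦ by
    rw [show pCoeff lam t = ((lam ^ 2 - t ^ 2 : ℝ) : ℂ) from rfl, Complex.conj_ofReal]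
  -- the bracket equals `p α²` on `U`
  have hB : ∀ s ∈ U, (starRingEnd ℂ) ((α s : ℂ)) *
      (pCoeff lam s * deriv (fun t : ℝ ↦ (t : ℂ) * (α t : ℂ)) s) -
      (starRingEnd ℂ) (pCoeff lam s * deriv (fun t ↦ (α t : ℂ)) s) * ((s : ℂ) * (α s : ℂ)) =
      pCoeff lam s * (α s : ℂ) * (α s : ℂ) := by
    intro s hs
    rw [deriv_alphaMinus hαU hs, map_mul, hpreal, conj_deriv_eq_of_real hU hG₁2 hreal hs, hreal]
    ring
  -- and `p α² → 0` at `±λ`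
  have hlim0 : ∀ a, a = lam ∨ a = -lam →
      Tendsto (fun s ↦ pCoeff lam s * (α s : ℂ) * (α s : ℂ)) (𝓝[≠] a) (𝓝 0) := by
    intro a ha
    have haw : 3 / 4 * lam < |a| ∧ |a| < 5 / 4 * lam := by
      rcases ha with rfl | rfl
      · rw [abs_of_pos hlam]; constructor <;> linarith
      · rw [abs_neg, abs_of_pos hlam]; constructor <;> linarith
    have ha2 : lam ^ 2 - a ^ 2 = 0 := by rcases ha with rfl | rfl <;> ring
    have h0 : Tendsto (fun x ↦ (((lam ^ 2 - x ^ 2) * Real.log |lam ^ 2 - x ^ 2| ^ 2 : ℝ) : ℂ))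
        (𝓝[≠] a) (𝓝 0) := by
      have := ((Complex.continuous_ofReal.tendsto 0).comp (tendsto_pSq_mul_log_sq ha2)).mono_left
        (nhdsWithin_le_nhds (s := {x | x ≠ a}))
      rw [Complex.ofReal_zero] at this
      exact this
    refine h0.congr' ?_
    filter_upwards [mem_nhdsWithin_of_mem_nhds ((isOpen_logWindow lam).mem_nhds haw)] with x hxw
    rw [alpha_eq_log heven hlog hxw.1.le hxw.2.le,
      show pCoeff lam x = ((lam ^ 2 - x ^ 2 : ℝ) : ℂ) from rfl]
    push_cast; ring
  have hlim : ∀ (a : ℝ) (l : Filter ℝ), l ≤ 𝓝[≠] a → a = lam ∨ a = -lam →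
      Tendsto (fun s ↦ (starRingEnd ℂ) ((α s : ℂ)) *
        (pCoeff lam s * deriv (fun t : ℝ ↦ (t : ℂ) * (α t : ℂ)) s) -
        (starRingEnd ℂ) (pCoeff lam s * deriv (fun t ↦ (α t : ℂ)) s) * ((s : ℂ) * (α s : ℂ)))
        l (𝓝 0) := by
    intro a l hl ha
    have hev : ∀ᶠ s in 𝓝[≠] a, s ∈ U := by
      rcases ha with rfl | rfl
      · exact eventually_nhdsNE_mem_ne_lam hlam
      · exact eventually_nhdsNE_neg_mem_ne_lam hlam
    refine ((hlim0 a ha).mono_left hl).congr' ?_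
    filter_upwards [hl hev] with s hs
    exact (hB s hs).symm
  rw [e1, e2, omegaForm_piecewise_piecewise hlam (R₁ := 3 / 2 * lam) (R₂ := 3 / 2 * lam)
    hG₁2 (fun x hx ↦ by simp [alpha_eq_zero_of_le_abs heven hsupp hx]) (fun x _ _ ↦ rfl)
    (memLp_alpha hlam hαU heven hlog hsupp) (memLp_W_alpha hlam hαU heven hlog hsupp)
    hG₂2 (fun x hx ↦ by simp [alpha_eq_zero_of_le_abs heven hsupp hx]) (fun x _ _ ↦ rfl)
    (memLp_alphaMinus hlam hαU heven hlog hsupp) (memLp_W_alphaMinus hlam hαU heven hlog hsupp)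
    (hlim (-lam) _ (nhdsWithin_mono _ fun s hs ↦ ne_of_lt hs) (Or.inr rfl))
    (hlim (-lam) _ (nhdsWithin_mono _ fun s hs ↦ ne_of_gt hs) (Or.inr rfl))
    (hlim lam _ (nhdsWithin_mono _ fun s hs ↦ ne_of_lt hs) (Or.inl rfl))
    (hlim lam _ (nhdsWithin_mono _ fun s hs ↦ ne_of_gt hs) (Or.inl rfl)) hα' hα2' hW₁ hW₂]
  simp

/-- RH-FREE (PROVED). **`Ω(α₋, α₊) = 0`** (Hermitian symmetry of `Ω`, `UVProlateVonNeumann.omegaForm_swap`). [cite: ConnesMoscovici2022, proof of Lemma 1.5 (= arXiv:2112.05500 Lemma 2.5, chunk p0005:L94–L98)] -/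
theorem omegaForm_alphaMinus_alphaPlus {lam : ℝ} (hlam : 0 < lam)
    (hαU : ContDiffOn ℝ (⊤ : ℕ∞) α {x | x ≠ lam ∧ x ≠ -lam}) (heven : ∀ x, α (-x) = α x)
    (hlog : ∀ x ∈ Icc (3 / 4 * lam) (5 / 4 * lam), α x = Real.log |lam ^ 2 - x ^ 2|)
    (hsupp : ∀ x, 0 ≤ x → α x ≠ 0 → x ∈ Ioo (lam / 2) (3 / 2 * lam)) (αp αm : L2R)
    (hαp : (αp : ℝ → ℂ) =ᵐ[volume] fun x ↦ (α x : ℂ))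
    (hαm : (αm : ℝ → ℂ) =ᵐ[volume] fun x ↦ (x * α x : ℂ))
    (hα : αp ∈ (prolateMax lam).domain) (hα2 : αm ∈ (prolateMax lam).domain) :
    omegaForm lam ⟨αm, hα2⟩ ⟨αp, hα⟩ = 0 := by
  rw [omegaForm_swap, omegaForm_alphaPlus_alphaMinus hlam hαU heven hlog hsupp αp αm hαp hαm hα hα2,
    map_zero]

end OmegaAlphaAlpha

end OmegaLagrange

/-! ## §8. The `{β±} × {β±}` block: cutoff against cutoff gives `Ω = 0` -/

section OmegaBetaBeta

variable {lam : ℝ}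

/-- The boundary data of a cutoff `1_{[−λ,λ]}·f`, `f ∈ C²`: the `W`-image off `±λ`, `p·(1_I f)′ → 0`
and `p·(1_I f) → 0` at `±λ` (the data fed to the generic lemmas; cf. the proof of
`exists_prolateMax_indicator_mul`). [cite: ConnesMoscovici2022, proof of Lemma 1.3, first sentence (= arXiv:2112.05500, chunk p0004:L110–L112)] -/
theorem indicator_mul_piecewise_data (hlam : 0 < lam) {f : ℝ → ℂ} (hf : ContDiff ℝ 2 f) :
    (∀ x, x ≠ lam → x ≠ -lam →
      (Icc (-lam) lam).indicator
          (fun y ↦ -deriv (fun s ↦ pCoeff lam s * deriv f s) y + qCoeff lam y * f y) x =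
        -deriv (fun s ↦ pCoeff lam s * deriv (fun y ↦ (Icc (-lam) lam).indicator f y) s) x +
          qCoeff lam x * (Icc (-lam) lam).indicator f x) ∧
    (∀ a, a = lam ∨ a = -lam →
      Tendsto (fun x ↦ pCoeff lam x * deriv (fun y ↦ (Icc (-lam) lam).indicator f y) x)
        (𝓝[≠] a) (𝓝 0)) ∧
    (∀ a, a = lam ∨ a = -lam →
      Tendsto (fun x ↦ pCoeff lam x * (Icc (-lam) lam).indicator f x) (𝓝[≠] a) (𝓝 0)) := by
  set U : Set ℝ := {s : ℝ | s ≠ lam ∧ s ≠ -lam} with hU_def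
  have hU : IsOpen U := isOpen_ne_lam lam
  have h2 : ContDiff ℝ (1 + 1) f := by simpa [one_add_one_eq_two] using hf
  have hf'1 : ContDiff ℝ 1 (deriv f) := (contDiff_succ_iff_deriv.mp h2).2.2
  set g : ℝ → ℂ := fun x ↦ (Icc (-lam) lam).indicator f x with hg_def
  set w : ℝ → ℂ := fun s ↦ pCoeff lam s * deriv f s with hw_def
  have hv_eq : ∀ s ∈ U, pCoeff lam s * deriv g s = (Icc (-lam) lam).indicator w s := by
    intro s hs
    rw [hg_def, deriv_indicator_mul hs]
    by_cases hsI : s ∈ Icc (-lam) lam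
    · rw [indicator_of_mem hsI, indicator_of_mem hsI]
    · rw [indicator_of_notMem hsI, indicator_of_notMem hsI, mul_zero]
  have hdv_eq : ∀ s ∈ U, deriv (fun t ↦ pCoeff lam t * deriv g t) s =
      (Icc (-lam) lam).indicator (deriv w) s := by
    intro s hs
    have hev : (fun t ↦ pCoeff lam t * deriv g t) =ᶠ[𝓝 s]
        fun t ↦ (Icc (-lam) lam).indicator w t :=
      Filter.eventually_of_mem (hU.mem_nhds hs) fun t ht ↦ hv_eq t ht
    rw [hev.deriv_eq, deriv_indicator_mul hs]
  have hpa : ∀ a, a = lam ∨ a = -lam → pCoeff lam a = 0 := by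
    rintro a (rfl | rfl)
    · exact pCoeff_lam _
    · exact pCoeff_neg_lam _
  have hevU : ∀ a, a = lam ∨ a = -lam → ∀ᶠ x in 𝓝[≠] a, x ≠ lam ∧ x ≠ -lam := by
    rintro a (rfl | rfl)
    · exact eventually_nhdsNE_mem_ne_lam hlam
    · exact eventually_nhdsNE_neg_mem_ne_lam hlam
  refine ⟨fun x h1 h2 ↦ ?_, fun a ha ↦ ?_, fun a ha ↦ ?_⟩
  · rw [hdv_eq x ⟨h1, h2⟩]
    by_cases hxI : x ∈ Icc (-lam) lam
    · simp only [indicator_of_mem hxI, hw_def]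
    · simp only [indicator_of_notMem hxI, neg_zero, mul_zero, add_zero]
  · have h0 : Tendsto (fun x ↦ pCoeff lam x * (Icc (-lam) lam).indicator (deriv f) x)
        (𝓝[≠] a) (𝓝 0) := by
      obtain ⟨C, hC⟩ := (isCompact_Icc (a := a - 1) (b := a + 1)).exists_bound_of_continuousOn
        ((hf'1.continuous).continuousOn)
      refine tendsto_pCoeff_mul_of_bound (hpa a ha) nhdsWithin_le_nhds (C := max C 0) ?_
      filter_upwards [mem_nhdsWithin_of_mem_nhds (Icc_mem_nhds (show a - 1 < a by linarith)
        (show a < a + 1 by linarith))] with x hx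
      exact (norm_indicator_le_norm_self _ _).trans ((hC x hx).trans (le_max_left _ _))
    refine h0.congr' ?_
    filter_upwards [hevU a ha] with x hx
    rw [deriv_indicator_mul hx]
  · obtain ⟨C, hC⟩ := (isCompact_Icc (a := a - 1) (b := a + 1)).exists_bound_of_continuousOn
      (hf.continuous.continuousOn)
    refine tendsto_pCoeff_mul_of_bound (hpa a ha) nhdsWithin_le_nhds (C := max C 0) ?_
    filter_upwards [mem_nhdsWithin_of_mem_nhds (Icc_mem_nhds (show a - 1 < a by linarith)
      (show a < a + 1 by linarith))] with x hx
    exact (norm_indicator_le_norm_self _ _).trans ((hC x hx).trans (le_max_left _ _))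

/-- RH-FREE (PROVED). **`Ω(1_I f₁, 1_I f₂) = 0`** for `f₁, f₂ ∈ C²` — in particular
`Ω(β₊, β₊) = Ω(β₊, β₋) = Ω(β₋, β₊) = Ω(β₋, β₋) = 0`: a cutoff has `p·(1_I f)′ → 0` at `±λ`, so
its pairing against another cutoff has no boundary contribution.
[cite: ConnesMoscovici2022, proof of Lemma 1.5 (= arXiv:2112.05500 Lemma 2.5, chunk p0005:L94–L98)] -/
theorem omegaForm_indicator_indicator (hlam : 0 < lam) {f₁ f₂ : ℝ → ℂ} (hf₁ : ContDiff ℝ 2 f₁)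
    (hf₂ : ContDiff ℝ 2 f₂) (β₁ β₂ : L2R)
    (hβ₁ : (β₁ : ℝ → ℂ) =ᵐ[volume] (Icc (-lam) lam).indicator f₁)
    (hβ₂ : (β₂ : ℝ → ℂ) =ᵐ[volume] (Icc (-lam) lam).indicator f₂)
    (h₁ : β₁ ∈ (prolateMax lam).domain) (h₂ : β₂ ∈ (prolateMax lam).domain) :
    omegaForm lam ⟨β₁, h₁⟩ ⟨β₂, h₂⟩ = 0 := by
  obtain ⟨hg2, hW2, _, _⟩ := exists_prolateMax_indicator_mul hlam hf₁
  have hβ2 : MemLp (fun x ↦ (Icc (-lam) lam).indicator f₂ x) 2 volume :=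
    memLp_indicator_mul_of_continuous hf₂.continuous lam
  have e₁ : β₁ = hg2.toLp _ := Lp.ext (hβ₁.trans hg2.coeFn_toLp.symm)
  have e₂ : β₂ = hβ2.toLp _ := Lp.ext (hβ₂.trans hβ2.coeFn_toLp.symm)
  have h₁' : hg2.toLp _ ∈ (prolateMax lam).domain := e₁ ▸ h₁
  have h₂' : hβ2.toLp _ ∈ (prolateMax lam).domain := e₂ ▸ h₂
  have E1 : (⟨β₁, h₁⟩ : (prolateMax lam).domain) = ⟨hg2.toLp _, h₁'⟩ := Subtype.ext e₁
  have E2 : (⟨β₂, h₂⟩ : (prolateMax lam).domain) = ⟨hβ2.toLp _, h₂'⟩ := Subtype.ext e₂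
  obtain ⟨hWg, hv, hg0⟩ := indicator_mul_piecewise_data hlam hf₁
  rw [E1, E2, omegaForm_piecewise_indicator hlam (R := lam + 1) (cp := 0) (cm := 0)
    (contDiffOn_indicator_mul hf₁ lam)
    (fun x hx ↦ by
      rw [indicator_of_notMem]
      intro hm
      have : |x| ≤ lam := abs_le.2 ⟨hm.1, hm.2⟩
      linarith)
    hWg hg2 hW2 (hv lam (Or.inl rfl)) (hv (-lam) (Or.inr rfl)) (hg0 lam (Or.inl rfl))
    (hg0 (-lam) (Or.inr rfl)) hf₂ hβ2 h₁' h₂']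
  simp

end OmegaBetaBeta

/-! ## §9. The `W_max`-image of a smooth element of `dom W_max` is the classical `W` -/

section SmoothImage

variable {lam : ℝ}

/-- RH-FREE (PROVED). **If `ξ ∈ dom W_max` has a `C²` representative `h`, then
`W_max ξ = −(p h′)′ + q h` a.e.** ("`dom(W_max) = {ξ ∈ L² | Wξ ∈ L²}` with `Wξ` viewed as a
tempered distribution": for smooth `ξ` the distribution `Wξ` is the classical expression) — from the
regular representative of `UVProlateMaxDomainRegularity.exists_regular_repr` (seat cc-t6), which
agrees with `h` off `±λ` and carries `(p g′)′ = q g − W_max ξ` a.e.  This is the `hW₂` input of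
`omegaForm_piecewise_general` for everywhere-smooth second arguments (e.g. Fourier images of
compactly supported vectors). [cite: ConnesMoscovici2022, §1 eq. (1.2) (= arXiv:2112.05500 (2.2), chunk p0004:L16–L22)] -/
theorem prolateMax_ae_eq_classical_of_contDiff (hlam : 0 < lam) (ξ : (prolateMax lam).domain)
    {h : ℝ → ℂ} (hh : ContDiff ℝ 2 h) (hξ : ((ξ : L2R) : ℝ → ℂ) =ᵐ[volume] h) :
    ((prolateMax lam ξ : L2R) : ℝ → ℂ) =ᵐ[volume]
      fun x ↦ -deriv (fun s ↦ pCoeff lam s * deriv h s) x + qCoeff lam x * h x := by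
  obtain ⟨g, hξg, hgU, -, hae, -⟩ := exists_regular_repr hlam ξ
  set U : Set ℝ := {x : ℝ | x ≠ lam ∧ x ≠ -lam} with hU_def
  have hU : IsOpen U := isOpen_ne_lam lam
  have hgh : EqOn g h U :=
    eqOn_of_ae_eq_of_continuousOn (hξg.symm.trans hξ) hgU.continuousOn hh.continuous.continuousOn
  have hd : ∀ x ∈ U, deriv g x = deriv h x := fun x hx ↦
    (Filter.eventuallyEq_of_mem (hU.mem_nhds hx) hgh).deriv_eq
  have h2 : ContDiff ℝ (1 + 1) h := by simpa [one_add_one_eq_two] using hh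
  have hh'1 : ContDiff ℝ 1 (deriv h) := (contDiff_succ_iff_deriv.mp h2).2.2
  have hv1 : ContDiff ℝ 1 (fun s ↦ pCoeff lam s * deriv h s) := (contDiff_pCoeff_def lam 1).mul hh'1
  have hvd : ∀ x, HasDerivAt (fun s ↦ pCoeff lam s * deriv h s)
      (deriv (fun s ↦ pCoeff lam s * deriv h s) x) x := fun x ↦
    ((hv1.differentiable one_ne_zero) x).hasDerivAt
  filter_upwards [hae, ae_mem_ne_lam lam] with x hx hxU
  have H := hx hxU
  have hev : (fun y ↦ pCoeff lam y * deriv h y) =ᶠ[𝓝 x] fun y ↦ pCoeff lam y * deriv g y :=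
    Filter.eventually_of_mem (hU.mem_nhds hxU) fun y hy ↦ by
      show pCoeff lam y * deriv h y = pCoeff lam y * deriv g y
      rw [hd y hy]
  have H' : HasDerivAt (fun y ↦ pCoeff lam y * deriv h y)
      (qCoeff lam x * g x - (prolateMax lam ξ : L2R) x) x := H.congr_of_eventuallyEq hev
  have huniq := (hvd x).unique H'
  rw [hgh hxU] at huniq
  rw [huniq]; ring

end SmoothImage

/-! ## §10. First conjunct of the corrected Lemma 1.5: all eight vectors lie in `dom W_max` -/

section EightVectors

variable {lam : ℝ} {α : ℝ → ℝ}

/-- RH-FREE (PROVED). **First conjunct of `CM22_lemma_1_5_corr`: the eight printed vectors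
`α₊, α₋, β₊, β₋, α̂₊, α̂₋, β̂₊, β̂₋` all lie in `dom W_max`** — the four formula-vectors by §2/§4/§5
and their Fourier images by the `𝔽`-invariance of `dom W_max`
(`UVProlateMaxDomainFourier.fourierL2_mem_prolateMax`, seat cc-t10: "`ℰ±` are invariant under
Fourier transform"). [cite: ConnesMoscovici2022, Lemma 1.5 (= arXiv:2112.05500 Lemma 2.5, chunk p0005:L84–L92) and §1 ¶1 (chunk p0004:L29–L37)] -/
theorem CM22_lemma_1_5_corr_mem_eight (hlam : 0 < lam)
    (hαU : ContDiffOn ℝ (⊤ : ℕ∞) α {x | x ≠ lam ∧ x ≠ -lam}) (heven : ∀ x, α (-x) = α x)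
    (hlog : ∀ x ∈ Icc (3 / 4 * lam) (5 / 4 * lam), α x = Real.log |lam ^ 2 - x ^ 2|)
    (hsupp : ∀ x, 0 ≤ x → α x ≠ 0 → x ∈ Ioo (lam / 2) (3 / 2 * lam)) (αp αm βp βm : L2R)
    (hαp : (αp : ℝ → ℂ) =ᵐ[volume] fun x ↦ (α x : ℂ))
    (hαm : (αm : ℝ → ℂ) =ᵐ[volume] fun x ↦ (x * α x : ℂ))
    (hβp : (βp : ℝ → ℂ) =ᵐ[volume] (Icc (-lam) lam).indicator fun _ ↦ (1 : ℂ))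
    (hβm : (βm : ℝ → ℂ) =ᵐ[volume] (Icc (-lam) lam).indicator fun x ↦ (x : ℂ)) :
    ∀ i, (![αp, αm, βp, βm, fourierL2 αp, fourierL2 αm, fourierL2 βp, fourierL2 βm] : Fin 8 → L2R) i
      ∈ (prolateMax lam).domain := by
  obtain ⟨h0, h1, h2, h3⟩ :=
    CM22_lemma_1_5_corr_mem_four hlam hαU heven hlog hsupp αp αm βp βm hαp hαm hβp hβm
  have h4 := fourierL2_mem_prolateMax lam h0
  have h5 := fourierL2_mem_prolateMax lam h1
  have h6 := fourierL2_mem_prolateMax lam h2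
  have h7 := fourierL2_mem_prolateMax lam h3
  intro i
  fin_cases i
  all_goals simp only [Fin.zero_eta, Fin.mk_one, Fin.reduceFinMk, Matrix.cons_val_zero,
    Matrix.cons_val_one, Matrix.cons_val]
  all_goals first
    | exact h0 | exact h1 | exact h2 | exact h3 | exact h4 | exact h5 | exact h6 | exact h7

end EightVectors

/-! ## §11. The mixed block: a compactly supported piecewise vector against a SMOOTH element of
`dom W_max` pairs to zero -/

section OmegaSmooth

variable {lam : ℝ}

/-- RH-FREE (PROVED). **`Ω(g, η) = 0` for `g` compactly supported piecewise-`C²` (data as in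
`exists_prolateMax_eq_of_piecewise`: `p g′ → c±` two-sided, `p g → 0` at `±λ`) and ANY `η ∈ dom W_max`
with an everywhere-`C²` representative `h`** — the brackets `conj(g)(p h′) − conj(p g′) h` tend to
`−conj(c±) h(±λ)` from BOTH sides of `±λ`, so eq. (1.7) gives zero.  This is the mechanism making
every entry of the printed `Ω`-matrix between a formula-vector `α±, β±` and a Fourier image
`α̂±, β̂±` (entire functions) vanish. [cite: ConnesMoscovici2022, §1 eq. (1.7) and proof of Lemma 1.5 (= arXiv:2112.05500 (2.7), chunk p0005:L31–L38; Lemma 2.5 proof L94–L98)] -/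
theorem omegaForm_piecewise_smooth_eq_zero (hlam : 0 < lam) {g Wg : ℝ → ℂ} {R : ℝ} {cp cm : ℂ}
    (hg : ContDiffOn ℝ 2 g {x : ℝ | x ≠ lam ∧ x ≠ -lam})
    (hgR : ∀ x, R ≤ |x| → g x = 0)
    (hWg : ∀ x, x ≠ lam → x ≠ -lam →
      Wg x = -deriv (fun s ↦ pCoeff lam s * deriv g s) x + qCoeff lam x * g x)
    (hg2 : MemLp g 2 volume) (hWg2 : MemLp Wg 2 volume)
    (hvp : Tendsto (fun x ↦ pCoeff lam x * deriv g x) (𝓝[≠] lam) (𝓝 cp))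
    (hvm : Tendsto (fun x ↦ pCoeff lam x * deriv g x) (𝓝[≠] (-lam)) (𝓝 cm))
    (hgp : Tendsto (fun x ↦ pCoeff lam x * g x) (𝓝[≠] lam) (𝓝 0))
    (hgm : Tendsto (fun x ↦ pCoeff lam x * g x) (𝓝[≠] (-lam)) (𝓝 0))
    (hG : hg2.toLp g ∈ (prolateMax lam).domain)
    (η : L2R) (hη : η ∈ (prolateMax lam).domain) {h : ℝ → ℂ} (hh : ContDiff ℝ 2 h)
    (hηh : (η : ℝ → ℂ) =ᵐ[volume] h) :
    omegaForm lam ⟨hg2.toLp g, hG⟩ ⟨η, hη⟩ = 0 := by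
  set U : Set ℝ := {s : ℝ | s ≠ lam ∧ s ≠ -lam} with hU_def
  -- the smooth second argument: `η = toLp h`, `W_max η = toLp (W h)`
  set Wh : ℝ → ℂ := fun x ↦ -deriv (fun s ↦ pCoeff lam s * deriv h s) x + qCoeff lam x * h x
    with hWh_def
  have hh2 : MemLp h 2 volume := (Lp.memLp η).ae_eq hηh
  have hWae := prolateMax_ae_eq_classical_of_contDiff hlam ⟨η, hη⟩ hh hηh
  have hWh2 : MemLp Wh 2 volume := (Lp.memLp (prolateMax lam ⟨η, hη⟩)).ae_eq hWae
  have eη : η = hh2.toLp h := Lp.ext (hηh.trans hh2.coeFn_toLp.symm)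
  have hη' : hh2.toLp h ∈ (prolateMax lam).domain := eη ▸ hη
  have E2 : (⟨η, hη⟩ : (prolateMax lam).domain) = ⟨hh2.toLp h, hη'⟩ := Subtype.ext eη
  have hW₂ : prolateMax lam ⟨hh2.toLp h, hη'⟩ = hWh2.toLp Wh := by
    rw [← E2]
    exact Lp.ext (hWae.trans hWh2.coeFn_toLp.symm)
  obtain ⟨_, hW₁⟩ := exists_prolateMax_eq_of_piecewise hlam hg hgR hWg hg2 hWg2 hvp hvm hgp hgm
  -- bracket limits: `conj(g)(p h′) − conj(p g′) h → 0·h′(a) − conj(c) h(a)` from both sides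
  have hpreal : ∀ t, (starRingEnd ℂ) (pCoeff lam t) = pCoeff lam t := fun t ↦ by
    rw [show pCoeff lam t = ((lam ^ 2 - t ^ 2 : ℝ) : ℂ) from rfl, Complex.conj_ofReal]
  have hBlim : ∀ (a : ℝ) (c : ℂ), Tendsto (fun x ↦ pCoeff lam x * deriv g x) (𝓝[≠] a) (𝓝 c) →
      Tendsto (fun x ↦ pCoeff lam x * g x) (𝓝[≠] a) (𝓝 0) → ∀ l : Filter ℝ, l ≤ 𝓝[≠] a →
      Tendsto (fun s ↦ (starRingEnd ℂ) (g s) * (pCoeff lam s * deriv h s) -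
        (starRingEnd ℂ) (pCoeff lam s * deriv g s) * h s) l
        (𝓝 (0 * deriv h a - (starRingEnd ℂ) c * h a)) := by
    intro a c hv hg0 l hl
    have h1 : Tendsto (fun s ↦ (starRingEnd ℂ) (pCoeff lam s * g s)) (𝓝[≠] a) (𝓝 0) := by
      have := (Complex.continuous_conj.tendsto 0).comp hg0
      rwa [map_zero] at this
    have h2 : Tendsto (fun s ↦ (starRingEnd ℂ) (pCoeff lam s * deriv g s)) (𝓝[≠] a)
        (𝓝 ((starRingEnd ℂ) c)) := (Complex.continuous_conj.tendsto c).comp hv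
    have hθ : Tendsto h (𝓝[≠] a) (𝓝 (h a)) := (hh.continuous.tendsto a).mono_left nhdsWithin_le_nhds
    have hθ' : Tendsto (deriv h) (𝓝[≠] a) (𝓝 (deriv h a)) :=
      ((hh.continuous_deriv (by norm_num)).tendsto a).mono_left nhdsWithin_le_nhds
    have hall := ((h1.mul hθ').sub (h2.mul hθ)).mono_left hl
    refine hall.congr' (Eventually.of_forall fun s ↦ ?_)
    simp only [map_mul, hpreal]; ring
  rw [E2, omegaForm_piecewise_general hlam hg hgR hWg hg2 hWg2 (hh.contDiffOn) (fun x _ _ ↦ rfl)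
    hh2 hWh2
    (hBlim (-lam) cm hvm hgm _ (nhdsWithin_mono _ fun s hs ↦ ne_of_lt hs))
    (hBlim (-lam) cm hvm hgm _ (nhdsWithin_mono _ fun s hs ↦ ne_of_gt hs))
    (hBlim lam cp hvp hgp _ (nhdsWithin_mono _ fun s hs ↦ ne_of_lt hs))
    (hBlim lam cp hvp hgp _ (nhdsWithin_mono _ fun s hs ↦ ne_of_gt hs)) hG hη' hW₁ hW₂]
  ring

/-- RH-FREE (PROVED). **`Ω(α₊, η) = 0` for every `η ∈ dom W_max` with a `C²` representative** (in
particular for the Fourier images `α̂±, β̂±`, which are entire).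
[cite: ConnesMoscovici2022, proof of Lemma 1.5 (= arXiv:2112.05500 Lemma 2.5, chunk p0005:L94–L98)] -/
theorem omegaForm_alphaPlus_smooth {α : ℝ → ℝ} (hlam : 0 < lam)
    (hαU : ContDiffOn ℝ (⊤ : ℕ∞) α {x | x ≠ lam ∧ x ≠ -lam}) (heven : ∀ x, α (-x) = α x)
    (hlog : ∀ x ∈ Icc (3 / 4 * lam) (5 / 4 * lam), α x = Real.log |lam ^ 2 - x ^ 2|)
    (hsupp : ∀ x, 0 ≤ x → α x ≠ 0 → x ∈ Ioo (lam / 2) (3 / 2 * lam)) (αp : L2R)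
    (hαp : (αp : ℝ → ℂ) =ᵐ[volume] fun x ↦ (α x : ℂ)) (hα : αp ∈ (prolateMax lam).domain)
    (η : L2R) (hη : η ∈ (prolateMax lam).domain) {h : ℝ → ℂ} (hh : ContDiff ℝ 2 h)
    (hηh : (η : ℝ → ℂ) =ᵐ[volume] h) :
    omegaForm lam ⟨αp, hα⟩ ⟨η, hη⟩ = 0 := by
  have eα : αp = (memLp_alpha hlam hαU heven hlog hsupp).toLp _ :=
    Lp.ext (hαp.trans (memLp_alpha hlam hαU heven hlog hsupp).coeFn_toLp.symm)
  have hα' : (memLp_alpha hlam hαU heven hlog hsupp).toLp _ ∈ (prolateMax lam).domain := eα ▸ hα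
  have e1 : (⟨αp, hα⟩ : (prolateMax lam).domain) =
      ⟨(memLp_alpha hlam hαU heven hlog hsupp).toLp _, hα'⟩ := Subtype.ext eα
  have hGtop : ContDiffOn ℝ (⊤ : ℕ∞) (fun t ↦ (α t : ℂ)) {x | x ≠ lam ∧ x ≠ -lam} :=
    Complex.ofRealCLM.contDiff.comp_contDiffOn hαU
  rw [e1]
  exact omegaForm_piecewise_smooth_eq_zero hlam (R := 3 / 2 * lam)
    (cp := ((-2 * lam : ℝ) : ℂ)) (cm := ((-2 * (-lam) : ℝ) : ℂ))
    (hGtop.of_le (WithTop.coe_le_coe.mpr le_top))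
    (fun x hx ↦ by simp [alpha_eq_zero_of_le_abs heven hsupp hx]) (fun x _ _ ↦ rfl)
    (memLp_alpha hlam hαU heven hlog hsupp) (memLp_W_alpha hlam hαU heven hlog hsupp)
    (tendsto_pCoeff_mul_deriv_alpha hlam heven hlog (Or.inl rfl))
    (tendsto_pCoeff_mul_deriv_alpha hlam heven hlog (Or.inr rfl))
    (tendsto_pCoeff_mul_alpha hlam heven hlog (Or.inl rfl))
    (tendsto_pCoeff_mul_alpha hlam heven hlog (Or.inr rfl)) hα' η hη hh hηh

/-- RH-FREE (PROVED). **`Ω(α₋, η) = 0` for every `η ∈ dom W_max` with a `C²` representative.**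
[cite: ConnesMoscovici2022, proof of Lemma 1.5 (= arXiv:2112.05500 Lemma 2.5, chunk p0005:L96–L98)] -/
theorem omegaForm_alphaMinus_smooth {α : ℝ → ℝ} (hlam : 0 < lam)
    (hαU : ContDiffOn ℝ (⊤ : ℕ∞) α {x | x ≠ lam ∧ x ≠ -lam}) (heven : ∀ x, α (-x) = α x)
    (hlog : ∀ x ∈ Icc (3 / 4 * lam) (5 / 4 * lam), α x = Real.log |lam ^ 2 - x ^ 2|)
    (hsupp : ∀ x, 0 ≤ x → α x ≠ 0 → x ∈ Ioo (lam / 2) (3 / 2 * lam)) (αm : L2R)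
    (hαm : (αm : ℝ → ℂ) =ᵐ[volume] fun x ↦ (x * α x : ℂ)) (hα : αm ∈ (prolateMax lam).domain)
    (η : L2R) (hη : η ∈ (prolateMax lam).domain) {h : ℝ → ℂ} (hh : ContDiff ℝ 2 h)
    (hηh : (η : ℝ → ℂ) =ᵐ[volume] h) :
    omegaForm lam ⟨αm, hα⟩ ⟨η, hη⟩ = 0 := by
  have eα : αm = (memLp_alphaMinus hlam hαU heven hlog hsupp).toLp _ :=
    Lp.ext (hαm.trans (memLp_alphaMinus hlam hαU heven hlog hsupp).coeFn_toLp.symm)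
  have hα' : (memLp_alphaMinus hlam hαU heven hlog hsupp).toLp _ ∈ (prolateMax lam).domain :=
    eα ▸ hα
  have e1 : (⟨αm, hα⟩ : (prolateMax lam).domain) =
      ⟨(memLp_alphaMinus hlam hαU heven hlog hsupp).toLp _, hα'⟩ := Subtype.ext eα
  have hGtop : ContDiffOn ℝ (⊤ : ℕ∞) (fun t : ℝ ↦ (t : ℂ) * (α t : ℂ)) {x | x ≠ lam ∧ x ≠ -lam} :=
    (Complex.ofRealCLM.contDiff.comp contDiff_id).contDiffOn.mul
      (Complex.ofRealCLM.contDiff.comp_contDiffOn hαU)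
  rw [e1]
  exact omegaForm_piecewise_smooth_eq_zero hlam (R := 3 / 2 * lam)
    (cp := (lam : ℂ) * ((-2 * lam : ℝ) : ℂ)) (cm := ((-lam : ℝ) : ℂ) * ((-2 * (-lam) : ℝ) : ℂ))
    (hGtop.of_le (WithTop.coe_le_coe.mpr le_top))
    (fun x hx ↦ by simp [alpha_eq_zero_of_le_abs heven hsupp hx]) (fun x _ _ ↦ rfl)
    (memLp_alphaMinus hlam hαU heven hlog hsupp) (memLp_W_alphaMinus hlam hαU heven hlog hsupp)
    (tendsto_pCoeff_mul_deriv_alphaMinus hlam hαU heven hlog (Or.inl rfl))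
    (by
      have := tendsto_pCoeff_mul_deriv_alphaMinus hlam hαU heven hlog (Or.inr rfl)
      simpa using this)
    (tendsto_pCoeff_mul_alphaMinus hlam heven hlog (Or.inl rfl))
    (tendsto_pCoeff_mul_alphaMinus hlam heven hlog (Or.inr rfl)) hα' η hη hh hηh

/-- RH-FREE (PROVED). **`Ω(1_I f, η) = 0`** for `f ∈ C²` and every `η ∈ dom W_max` with a `C²`
representative (in particular `Ω(β±, α̂±) = Ω(β±, β̂±) = 0`).
[cite: ConnesMoscovici2022, proof of Lemma 1.5 (= arXiv:2112.05500 Lemma 2.5, chunk p0005:L94–L98)] -/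
theorem omegaForm_indicator_smooth (hlam : 0 < lam) {f : ℝ → ℂ} (hf : ContDiff ℝ 2 f) (β : L2R)
    (hβ : (β : ℝ → ℂ) =ᵐ[volume] (Icc (-lam) lam).indicator f) (hb : β ∈ (prolateMax lam).domain)
    (η : L2R) (hη : η ∈ (prolateMax lam).domain) {h : ℝ → ℂ} (hh : ContDiff ℝ 2 h)
    (hηh : (η : ℝ → ℂ) =ᵐ[volume] h) :
    omegaForm lam ⟨β, hb⟩ ⟨η, hη⟩ = 0 := by
  obtain ⟨hg2, hW2, _, _⟩ := exists_prolateMax_indicator_mul hlam hf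
  have e₁ : β = hg2.toLp _ := Lp.ext (hβ.trans hg2.coeFn_toLp.symm)
  have hb' : hg2.toLp _ ∈ (prolateMax lam).domain := e₁ ▸ hb
  have E1 : (⟨β, hb⟩ : (prolateMax lam).domain) = ⟨hg2.toLp _, hb'⟩ := Subtype.ext e₁
  obtain ⟨hWg, hv, hg0⟩ := indicator_mul_piecewise_data hlam hf
  rw [E1]
  exact omegaForm_piecewise_smooth_eq_zero hlam (R := lam + 1) (cp := 0) (cm := 0)
    (contDiffOn_indicator_mul hf lam)
    (fun x hx ↦ by
      rw [indicator_of_notMem]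
      intro hm
      have : |x| ≤ lam := abs_le.2 ⟨hm.1, hm.2⟩
      linarith)
    hWg hg2 hW2 (hv lam (Or.inl rfl)) (hv (-lam) (Or.inr rfl)) (hg0 lam (Or.inl rfl))
    (hg0 (-lam) (Or.inr rfl)) hb' η hη hh hηh

end OmegaSmooth

/-! ## §12. Fourier images of compactly supported `L²` functions have smooth representatives -/

section FourierSmooth

/-- RH-FREE (PROVED). **The Fourier image of a compactly supported `L²` function has a `C²` (indeed
smooth) representative**, namely its Fourier integral — so `α̂±, β̂±` are covered by the
smooth-partner lemmas of §11 ("`𝔽 α₊` … the function `cos(2πλy)/|y|`"-type explicit transforms are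
not needed for the vanishing entries). [cite: ConnesMoscovici2022, Lemma 1.4 and proof of Lemma 1.5 (= arXiv:2112.05500 Lemma 2.4–2.5, chunk p0005:L60–L98)] -/
theorem exists_contDiff_repr_fourierL2 {g : ℝ → ℂ} {R : ℝ} (hg2 : MemLp g 2 volume)
    (hgR : ∀ x, R ≤ |x| → g x = 0) :
    ∃ h : ℝ → ℂ, ContDiff ℝ 2 h ∧ ((fourierL2 (hg2.toLp g) : L2R) : ℝ → ℂ) =ᵐ[volume] h := by
  -- `g` is integrable: it vanishes off `[−|R|, |R|]` and is `L²` there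
  have hK : g = (Icc (-|R|) |R|).indicator g := by
    funext x
    by_cases hx : x ∈ Icc (-|R|) |R|
    · rw [indicator_of_mem hx]
    · rw [indicator_of_notMem hx]
      apply hgR
      by_contra hlt
      apply hx
      have : |x| ≤ |R| := (le_of_lt (not_le.1 hlt)).trans (le_abs_self R)
      exact abs_le.1 this
  haveI : IsFiniteMeasure ((volume : Measure ℝ).restrict (Icc (-|R|) |R|)) :=
    ⟨by rw [Measure.restrict_apply_univ]; exact measure_Icc_lt_top⟩
  have hgI : Integrable g := by
    rw [hK, integrable_indicator_iff measurableSet_Icc]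
    exact (hg2.restrict _).integrable one_le_two
  refine ⟨𝓕 g, ?_, ?_⟩
  · apply Real.contDiff_fourier
    intro n _
    refine (hgI.norm.const_mul (|R| ^ n)).mono'
      ((continuous_norm.pow n).aestronglyMeasurable.mul hgI.1.norm) (Eventually.of_forall fun v ↦ ?_)
    rw [Real.norm_eq_abs, abs_of_nonneg (by positivity)]
    by_cases hv : |v| ≤ |R|
    · rw [Real.norm_eq_abs]
      exact mul_le_mul_of_nonneg_right (pow_le_pow_left₀ (abs_nonneg v) hv n) (norm_nonneg _)
    · rw [hgR v ((le_abs_self R).trans (le_of_lt (not_le.1 hv)))]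
      simp
  · exact Literature.Analysis.FunctionSpaces.fourier_toLp_ae_eq_fourierIntegral hgI hg2

end FourierSmooth

end Literature.NumberTheory.ConnesMoscovici2022

end
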